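import Literature.NumberTheory.Automorphic.Liu2021.LemD1AsPrintedIndexedNonVacuitySlots
import Literature.NumberTheory.QuadraticForms.PadicSquares
import Literature.NumberTheory.GaloisRepresentations.LocalFieldPadicProofs
import Mathlib.Algebra.QuadraticAlgebra.Basic
import Mathlib.NumberTheory.Padics.RingHoms
import Mathlib.RingTheory.Etale.Field
import HarnessLib

/-!
# [Liu2021, App. D Lemma D.1 (1) ∧ (3)] on an indexed collection — NON-VACUITY AT A NON-SPLIT PLACE
# (`F = ℚ₃`, `E = ℚ₃(i)` a FIELD: two classes in `E^{−×}/Nm_{E/F} E^×`; the `ε`-conjunct of (3) exercised at FALSE)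

Reproduction ∕ bookkeeping (Literature, theorems only, no record, no definition, nothing asserted about Liu's objects).
The statement-exact records `LemD1IndexedFamily.Item1AsPrinted` (Lemma D.1, first sentence + (1): «Suppose that `F` is
nonarchimedean. Then `ω(μ, ε, χ)` is irreducible and admissible. Moreover, (1) `ω(μ, ε, χ)` is zero if and only if `E` is
a field, `V` is anisotropic (in particular `n = 2`), and `χ̌ = μ²`.») and `LemD1_3AsPrintedI` (Lemma D.1 (3): «If `n ≥ 3`,
then `ω(μ', ε', χ')` is isomorphic to `ω(μ, ε, χ)` if and only if `(μ', ε', χ') = (μ, ε, χ)`.», with «`ε' = ε`» read in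
`E^{−×}/Nm_{E/F} E^×`, READING L3′ `LemD1.SameClass`) are PREDICATES on a consumer's datum
`Lf : LemD1IndexedFamily F E n ι` (`LemD1AsPrintedIndexed.lean`).  Every in-kernel certificate so far
(`LemD1AsPrintedNonVacuity`, `LemD1AsPrintedIndexedNonVacuity`, `LemD1AsPrintedIndexedNonVacuitySlots`) lives at a SPLIT
place `E = F × F` (first case of Liu's proof, l. 5241), where «`E` is a field» is false and — `LemD1.sameClass_of_splitData`
— ALL Step-1 representatives lie in ONE class of `E^{−×}/Nm E^×`, so that the `ε`-conjunct of (3) can only be met at truth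
value TRUE there (`LemD1AsPrintedIndexedNonVacuitySlots.lean`, module docstring: «(3) at a split datum is equivalent to its
`ε`-free variant»).  The second case of Liu's proof, «Now we assume that `E` is a field» (l. 5243; for (3): «it is known when
`n = 3` by [GR90, Proposition 5.1.4]. In fact, the same proof also works for `n > 3`», l. 5255), had no model in the tree.

THIS FILE builds the first NON-SPLIT model of the standing data of §D.1 and certifies IN THE KERNEL that the pair
«(1) for every member ∧ (3)» is jointly satisfiable there with the `ε`-conjunct of (3) at truth value FALSE:

* §1 (three-adic lemmas, folklore): `‖a² + b²‖₃ = max(‖a‖₃, ‖b‖₃)²` (`−1` is not a square mod `3`); hence `−1` is not a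
  square in `ℚ₃`, and a non-zero `a ∈ ℚ₃` is a sum of two squares iff `ord₃ a` is even (Hensel via the tree's
  `QuadraticForms.padicInt_isSquare_of_toZMod_eq_one`); the `3`-adic circle `x² + y² = 1` has integral points with exactly
  one unit coordinate, and the product rule for that coordinate mod `3`.
* §2 `E = ℚ₃(i)` = Mathlib's `QuadraticAlgebra ℚ_[3] (-1) 0` is a FIELD (`isField`); for standing data `S` on it whose
  involution is `i ↦ −i` (Mathlib's `star`): `Nm E^× ∩ ℚ₃^× = {ord₃ even}`, and **the class of a representative
  `ε = b i ∈ E^{−×}` is the parity of `ord₃ b`** (`sameClass_iff`) — so `E^{−×}/Nm E^×` has exactly two elements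
  (`sameClass_or_of_three` + the certificate's `[i] ≠ [3i]`).
* §3 character lines (as in the split certificates, whose helpers are file-private): item (1) AS PRINTED holds at a character
  datum of ANY rank `n ≠ 2` whose character is locally constant and agrees with `χ` on the centre
  (`lemD1_1AsPrinted_of_character_of_rank_ne_two` — both sides of (1) false, the right one through «`n = 2`», valid when
  `E` IS a field); maximal `χ`-quotients of two character lines are isomorphic iff the characters agree.
* §4 the standing data exist at the non-split place for every rank `n ≥ 2` (`exists_standingData`: `F = ℚ₃` is a
  non-archimedean local field by the tree's `Padic.isNonarchimedeanLocalField_holds`, `E/F` étale of rank `2` as a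
  separable field extension, Gram matrix `1`); a Step-2 character EXISTS (`nonempty_muSet`: `μ = (−1)^{ord_E}`,
  `μ|_{ℚ₃^×} = (−1)^{ord₃}` with kernel EXACTLY `Nm E^×` — the printed Step-2 clause is non-trivial here, unlike
  `μ|_{F^×} = 1` at a split place); the sign character `s` of `E¹` (`s(a + b i) = −1` iff `3 ∣ a`; order `2`, `s(i) = −1`,
  locally constant — `exists_signChar`); `det : U(V)(F) → E¹` (`exists_detNormOne`).
* §5 THE CERTIFICATE (`exists_lemD1IndexedFamily_nonsplit`): rank `n = 4` (so that `s ∘ det` is trivial on the centre: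
  `s(z⁴) = 1`), three members with ONE `μ` and ONE `χ = 1`, representatives `ε₀ = i`, `ε₁ = 3i`, `ε₂ = −i = −ε₀`, carriers
  `1`, `s ∘ det`, `1`: `Item1AsPrinted` (lines: irreducible, admissible, NON-ZERO although «`E` is a field» is true) ∧
  `LemD1_3AsPrintedI` (all nine pairs) ∧ members `0, 1` differ ONLY in the class of `ε` (`[i] ≠ [3i]`: `ord₃ 3` odd) and
  `ω(μ, ε₁, χ) ≇ ω(μ, ε₀, χ)` (`diag(i, 1, 1, 1)` acts by `s(i) = −1`) — the `ε`-conjunct at FALSE, alone — ∧ members `0, 2`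
  have `ε₂ ≠ ε₀` as representatives, `[ε₂] = [ε₀]` (`−1 = Nm(√−2 + i)`), isomorphic quotients.  Corollaries: the records do
  not force «one class» (`not_forall_sameClass_…`), nor the representative-level reading (`not_forall_eps_eq_…`); §6 closes
  the topological instance hypotheses with the module topology (`exists_lemD1IndexedFamily_nonsplit_moduleTopology`).

The topology of `E` enters only through `[TopologicalSpace E] [IsTopologicalRing E] [IsModuleTopology ℚ_[3] E]` (the
records' own field `isModuleTopology`); §6 instantiates them with Mathlib's `moduleTopology`, so no instance is declared.

Consequence (T5-style consistency, our bookkeeping): no contradiction is derivable from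
`(Lf : LemD1IndexedFamily …) (h₁ : Lf.Item1AsPrinted) (h₃ : LemD1_3AsPrintedI Lf)` together with «`E` is a field» and
`∃ i j, Lf.mu i = Lf.mu j ∧ Lf.chi i = Lf.chi j ∧ ¬ SameClass (Lf.eps i) (Lf.eps j)`; it says nothing about the truth of
Lemma D.1 for Liu's `ω(μ, ε)` or for the tree's constructed local data (there `E_v` is a `Π`-type over the places above `v`
and `n = 3`; this file's `E` is Mathlib's `QuadraticAlgebra`, `n = 4`).

Cell pub-hodgecm2 (COR-CM), Δ2 BRIDGE cite leg `hμsep` ∕ END rows `hD1″`, `hD3`; seat prover-pub-hodgecm2-b10 (the lineage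
that filed `LemD1AsPrintedIndexed.lean` and the split certificates).  HC_CM is NOT proved.

References: Y. Liu, *Fourier–Jacobi cycles and arithmetic relative trace formula*, Camb. J. Math. 9 (2021) =
arXiv:2102.11518 [Liu2021], App. D §D.1 (l. 5213–5224), Lemma D.1 (1) (l. 5229), (3) (l. 5233), proof l. 5241 (split) /
5243, 5255 (field).  J.-P. Serre, *A Course in Arithmetic* (1973), Ch. II §3.3 (squares in `ℚ_p`), via the tree's
`Literature/NumberTheory/QuadraticForms/PadicSquares.lean` [Serre1973].

## v2 addendum (append-only; §§1–6 unchanged)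

* §7 `exists_lemD1IndexedFamily_nonsplit_rank_three`: the same place at the rows' rank **`n = 3`** — three members, one `μ`,
  `ε₀ = i`, `ε₁ = 3i`, `ε₂ = −i`, `χ₀ = χ₂ = 1`, `χ₁ = s`, carriers `1`, `s ∘ det` (central character `s(z³) = s(z)`), `1`:
  `Item1AsPrinted ∧ LemD1_3AsPrintedI`, members `0, 1` in DIFFERENT `ε`-classes (and different `χ`; at `n = 3` a character line
  cannot separate the classes with `χ` fixed), members `0, 2` equal labels up to the representative, isomorphic.
* §8 rank **`n = 2`** over the field: a Step-2 `μ` with `μ² = 1` (`exists_muSet_sq_eq_one`); the QUARTIC character `t` of `E¹`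
  (reduction to `μ₄(𝔽₉)`, `t(i)² = −1`; `exists_quarticChar`); `det : U(V)(F) → E¹` for any Gram matrix (`exists_detNormOne'`);
  the ANISOTROPIC binary hermitian space `diag(1, 3)` (`exists_standingData_aniso`, `form_anisotropic_of_gram_diag`: `N(x) +
  3 N(y) = 0 ⇒ x = y = 0` by parity of `ord₃`); and three data: **`exists_lemD1Data_exceptional`** — the EXCEPTIONAL CASE of
  Lemma D.1 (1) «`E` is a field, `V` is anisotropic (in particular `n = 2`), and `χ̌ = μ²`» with BOTH sides of (1) TRUE
  (carrier the line `t ∘ det`, on which the centre `i·1₂` acts by `−1 ≠ χ(i)`, so the maximal `χ`-quotient is ZERO; «irreducible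
  and admissible» on the zero space); `exists_lemD1Data_exceptional_violated` — same labels, trivial carrier: non-zero quotient,
  (1) FAILS (the record excludes something at `n = 2`); `exists_lemD1Data_rank_two_isotropic` — same labels and carrier on the
  ISOTROPIC `1₂` (`(x, 1)`, `N(x) = −1`): (1) HOLDS, its right side failing through «`V` is anisotropic» alone
  (`lemD1_1AsPrinted_of_character_of_not_exceptional`).

## v3 addendum (append-only; §§1–8 unchanged)

* §9 `exists_cubicChar`: the CUBIC character `ψ` of `E¹` — reduction modulo `9` (`E¹ = μ₄ × (E¹ ∩ (1 + 3𝒪_E))`; on the twelve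
  points of the circle `X² + Y² = 1` over `ℤ/9` the exponent `Ψ(α, β) = (β/3)·α − (α/3)·β (mod 3)` is additive, by `decide`);
  unitary, locally constant, `ψ³ = 1`, `ψ(i) = 1`, and `ψ(z₀) = ζ₃² ≠ 1` at `z₀ = (−4 + 3i)/5 ∈ E¹`.  At rank `3` the line
  `ψ ∘ det` has TRIVIAL central character (`ψ(z³) = 1`) — what v1/v2 lacked for separating `ε`-classes at the rows' rank with `χ`
  fixed.  §10 `exists_muSet_mul_check`: `μ · χ̌` is again a Step-2 character (same restriction to `F^×`), for every `μ`, `χ`; and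
  **`exists_lemD1IndexedFamily_nonsplit_rank_three_slots`** — the RANK-3 SLOT TABLE over the field: four members `(μ, i, 1; 1)`,
  `(μ, 3i, 1; ψ ∘ det)`, `(μ·š, i, 1; ψ² ∘ det)`, `(μ, i, s; s ∘ det)` with `Item1AsPrinted ∧ LemD1_3AsPrintedI`, all six pairs
  NON-isomorphic, and members `1`, `2`, `3` differing from member `0` in the class of `ε` ALONE, in `μ` ALONE, in `χ` ALONE
  respectively — each conjunct of the printed criterion (3) is, on its own, the deciding one at `n = 3` over a field.
* §11 rank `n = 2`, the conjunct «`χ̌ = μ²`» of (1) ALONE at FALSE: on the anisotropic `diag(1, 3)` with `ε = i`, `χ = 1` and the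
  Step-2 character `μ·ť` (`(μ·ť)(1 + i)² = t(i)² = −1 ≠ 1 = χ̌(1 + i)`), the trivial carrier gives a non-zero quotient and (1)
  HOLDS (`exists_lemD1Data_checkClause_false`: «`E` is a field», «anisotropic», «`n = 2`» TRUE, «`χ̌ = μ²`» FALSE), while the
  carrier `t ∘ det` gives a ZERO quotient and (1) FAILS (`exists_lemD1Data_checkClause_false_violated`) — with
  `exists_lemD1Data_exceptional` (label `μ`, same carrier, (1) HOLDS) the clause is isolated: changing only the Step-2 label flips
  the record's verdict.
-/

noncomputable section

open Literature.RepresentationTheory.Liu2021 (OscillatorStandingData)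
open Literature.RepresentationTheory.CentralCharacterQuotient (augmentation quotRep quotRep_mk)

namespace Literature.NumberTheory.Automorphic.Liu2021

namespace LemD1IndexedNonVacuityNonsplit

/-! ## §1 Three-adic lemmas: `‖a² + b²‖₃ = max(‖a‖₃, ‖b‖₃)²`, and the norm group of `ℚ₃(i)/ℚ₃` -/

section ThreeAdic

/-- In `𝔽₃`, `x² + y² = 0` forces `x = y = 0` (`−1` is not a square mod `3`). [folklore] -/
private theorem zmod3_sq_add_sq_eq_zero : ∀ x y : ZMod 3, x ^ 2 + y ^ 2 = 0 → x = 0 ∧ y = 0 := by decide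

/-- In `𝔽₃`: for two points `(x, y)`, `(u, v)` of the circle `X² + Y² = 1`, the first coordinate `x u − y v` of their
product vanishes iff exactly one of `x`, `u` does. [folklore] -/
private theorem zmod3_re_mul_eq_zero_iff : ∀ x y u v : ZMod 3, x ^ 2 + y ^ 2 = 1 → u ^ 2 + v ^ 2 = 1 →
    (x * u - y * v = 0 ↔ (x = 0 ↔ u ≠ 0)) := by decide

/-- A `3`-adic integer reduces to `0` mod `3` iff its norm is `< 1`. [folklore] -/
private theorem toZMod_eq_zero_iff (x : ℤ_[3]) : PadicInt.toZMod x = 0 ↔ ‖x‖ < 1 := by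
  rw [← RingHom.mem_ker, PadicInt.ker_toZMod, IsLocalRing.mem_maximalIdeal, PadicInt.mem_nonunits]

/-- `a² + b²` is a `3`-adic unit as soon as one of the `3`-adic integers `a`, `b` is. [folklore] -/
private theorem norm_sq_add_sq_int (a b : ℤ_[3]) (h : ‖a‖ = 1 ∨ ‖b‖ = 1) : ‖a ^ 2 + b ^ 2‖ = 1 := by
  have hle : ‖a ^ 2 + b ^ 2‖ ≤ 1 := PadicInt.norm_le_one _
  by_contra hne
  have hlt : ‖a ^ 2 + b ^ 2‖ < 1 := lt_of_le_of_ne hle hne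
  have h0 : PadicInt.toZMod (a ^ 2 + b ^ 2) = 0 := (toZMod_eq_zero_iff _).2 hlt
  rw [map_add, map_pow, map_pow] at h0
  obtain ⟨ha, hb⟩ := zmod3_sq_add_sq_eq_zero _ _ h0
  rw [toZMod_eq_zero_iff] at ha hb
  rcases h with h | h
  · exact absurd h (ne_of_lt ha)
  · exact absurd h (ne_of_lt hb)

/-- **`‖a² + b²‖₃ = max(‖a‖₃, ‖b‖₃)²`** for all `a, b ∈ ℚ₃` (the binary form `X² + Y²` is anisotropic over `ℚ₃` and
takes unit values on primitive vectors, because `−1` is not a square mod `3`). [folklore] -/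
private theorem norm_sq_add_sq (a b : ℚ_[3]) : ‖a ^ 2 + b ^ 2‖ = max ‖a‖ ‖b‖ ^ 2 := by
  obtain ⟨c, hc, hca, hcb⟩ : ∃ c : ℚ_[3], ‖c‖ = max ‖a‖ ‖b‖ ∧ ‖a‖ ≤ ‖c‖ ∧ ‖b‖ ≤ ‖c‖ := by
    rcases le_total ‖a‖ ‖b‖ with h | h
    · exact ⟨b, (max_eq_right h).symm, h, le_rfl⟩
    · exact ⟨a, (max_eq_left h).symm, le_rfl, h⟩
  rw [← hc]
  by_cases hc0 : c = 0
  · have ha : a = 0 := norm_eq_zero.1 (le_antisymm (by simpa [hc0] using hca) (norm_nonneg _))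
    have hb : b = 0 := norm_eq_zero.1 (le_antisymm (by simpa [hc0] using hcb) (norm_nonneg _))
    simp [ha, hb, hc0]
  have hcn : 0 < ‖c‖ := norm_pos_iff.2 hc0
  have ha' : ‖a / c‖ ≤ 1 := by rw [norm_div, div_le_one hcn]; exact hca
  have hb' : ‖b / c‖ ≤ 1 := by rw [norm_div, div_le_one hcn]; exact hcb
  set A : ℤ_[3] := ⟨a / c, ha'⟩ with hA
  set B : ℤ_[3] := ⟨b / c, hb'⟩ with hB
  have hone : ‖A‖ = 1 ∨ ‖B‖ = 1 := by
    change ‖a / c‖ = 1 ∨ ‖b / c‖ = 1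
    rw [norm_div, norm_div, div_eq_one_iff_eq hcn.ne', div_eq_one_iff_eq hcn.ne']
    rcases le_total ‖a‖ ‖b‖ with h | h
    · exact Or.inr (by rw [hc, max_eq_right h])
    · exact Or.inl (by rw [hc, max_eq_left h])
  have key := norm_sq_add_sq_int A B hone
  change ‖(a / c) ^ 2 + (b / c) ^ 2‖ = 1 at key
  have hid : (a / c) ^ 2 + (b / c) ^ 2 = (a ^ 2 + b ^ 2) / c ^ 2 := by
    field_simp
  rw [hid, norm_div, norm_pow, div_eq_one_iff_eq (pow_ne_zero _ hcn.ne')] at key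
  exact key

/-- `−1` is not a square in `ℚ₃` (in Mathlib's `QuadraticAlgebra` normal form `r² ≠ a + b r` with `(a, b) = (−1, 0)`):
the hypothesis under which `QuadraticAlgebra ℚ_[3] (-1) 0 = ℚ₃(i)` is a field. [folklore] -/
private theorem sq_ne_neg_one (r : ℚ_[3]) : r ^ 2 ≠ -1 + 0 * r := by
  intro h
  have h1 : r ^ 2 + 1 ^ 2 = 0 := by rw [h]; ring
  have := norm_sq_add_sq r 1
  rw [h1, norm_zero, norm_one] at this
  have : (1 : ℝ) ≤ max ‖r‖ 1 := le_max_right _ _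
  nlinarith

/-- Every `3`-adic unit is a sum of two squares (its residue is `1 = 1² + 0²` or `2 = 1² + 1²`; Hensel, via the tree's
`padicInt_isSquare_of_toZMod_eq_one`). [folklore] -/
private theorem exists_sq_add_sq_of_norm_eq_one (w : ℚ_[3]) (hw : ‖w‖ = 1) : ∃ a b : ℚ_[3], a ^ 2 + b ^ 2 = w := by
  set W : ℤ_[3] := ⟨w, hw.le⟩ with hW
  have hW0 : PadicInt.toZMod W ≠ 0 := by
    rw [Ne, toZMod_eq_zero_iff]
    exact fun h => absurd hw (ne_of_lt h)
  have hcases : ∀ t : ZMod 3, t ≠ 0 → t = 1 ∨ t = 2 := by decide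
  rcases hcases _ hW0 with h1 | h2
  · obtain ⟨z, hz⟩ :=
      Literature.NumberTheory.QuadraticForms.padicInt_isSquare_of_toZMod_eq_one (p := 3) (by norm_num) h1
    refine ⟨z, 0, ?_⟩
    have : ((W : ℤ_[3]) : ℚ_[3]) = w := rfl
    rw [← this, hz, PadicInt.coe_mul]; ring
  · have h1 : PadicInt.toZMod (W - 1) = 1 := by
      rw [map_sub, map_one, h2]; decide
    obtain ⟨z, hz⟩ :=
      Literature.NumberTheory.QuadraticForms.padicInt_isSquare_of_toZMod_eq_one (p := 3) (by norm_num) h1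
    refine ⟨z, 1, ?_⟩
    have : ((W - 1 : ℤ_[3]) : ℚ_[3]) = w - 1 := rfl
    have hz' := congrArg ((↑) : ℤ_[3] → ℚ_[3]) hz
    rw [this, PadicInt.coe_mul] at hz'
    linear_combination -hz'

/-- A non-zero sum of two squares in `ℚ₃` has EVEN valuation. [folklore] -/
private theorem even_valuation_of_sq_add_sq (a b : ℚ_[3]) (h0 : a ^ 2 + b ^ 2 ≠ 0) :
    Even (a ^ 2 + b ^ 2).valuation := by
  have hn := norm_sq_add_sq a b
  obtain ⟨c, hc⟩ : ∃ c : ℚ_[3], ‖c‖ = max ‖a‖ ‖b‖ := by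
    rcases le_total ‖a‖ ‖b‖ with h | h
    · exact ⟨b, (max_eq_right h).symm⟩
    · exact ⟨a, (max_eq_left h).symm⟩
  rw [← hc] at hn
  have hc0 : c ≠ 0 := by
    intro hc0
    rw [hc0, norm_zero, zero_pow two_ne_zero, norm_eq_zero] at hn
    exact h0 hn
  have h3pos : (0 : ℝ) < ((3 : ℕ) : ℝ) := by norm_num
  have h3ne1 : ((3 : ℕ) : ℝ) ≠ 1 := by norm_num
  have hn' : ‖a ^ 2 + b ^ 2‖ = ‖c‖ * ‖c‖ := by rw [hn, sq]
  rw [Padic.norm_eq_zpow_neg_valuation h0, Padic.norm_eq_zpow_neg_valuation hc0,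
    ← zpow_add₀ h3pos.ne'] at hn'
  have := zpow_right_injective₀ h3pos h3ne1 hn'
  refine ⟨c.valuation, ?_⟩
  omega

/-- Conversely, every non-zero element of `ℚ₃` of even valuation is a sum of two squares. [folklore] -/
private theorem exists_sq_add_sq_of_even_valuation (w : ℚ_[3]) (hw : w ≠ 0) (he : Even w.valuation) :
    ∃ a b : ℚ_[3], a ^ 2 + b ^ 2 = w := by
  obtain ⟨k, hk⟩ := he
  have hp0 : ((3 : ℕ) : ℚ_[3]) ≠ 0 := by exact_mod_cast (Nat.prime_three.ne_zero)
  set u : ℚ_[3] := w * ((3 : ℕ) : ℚ_[3]) ^ (-w.valuation) with hu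
  have hun : ‖u‖ = 1 := by
    rw [hu, norm_mul, Padic.norm_eq_zpow_neg_valuation hw, Padic.norm_p_zpow, neg_neg,
      ← zpow_add₀ (by norm_num : ((3 : ℕ) : ℝ) ≠ 0), neg_add_cancel, zpow_zero]
  obtain ⟨a, b, hab⟩ := exists_sq_add_sq_of_norm_eq_one u hun
  refine ⟨a * ((3 : ℕ) : ℚ_[3]) ^ k, b * ((3 : ℕ) : ℚ_[3]) ^ k, ?_⟩
  have hw' : w = u * ((3 : ℕ) : ℚ_[3]) ^ w.valuation := by
    rw [hu, mul_assoc, ← zpow_add₀ hp0, neg_add_cancel, zpow_zero, mul_one]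
  calc (a * ((3 : ℕ) : ℚ_[3]) ^ k) ^ 2 + (b * ((3 : ℕ) : ℚ_[3]) ^ k) ^ 2
      = (a ^ 2 + b ^ 2) * (((3 : ℕ) : ℚ_[3]) ^ k * ((3 : ℕ) : ℚ_[3]) ^ k) := by ring
    _ = w := by rw [hab, ← zpow_add₀ hp0, ← hk, ← hw']

/-- Elements of `ℚ₃` of the same norm have the same valuation. [folklore] -/
private theorem valuation_eq_of_norm_eq {y y₀ : ℚ_[3]} (hy : y ≠ 0) (hy₀ : y₀ ≠ 0) (h : ‖y‖ = ‖y₀‖) :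
    y.valuation = y₀.valuation := by
  have h3pos : (0 : ℝ) < ((3 : ℕ) : ℝ) := by norm_num
  have h3ne1 : ((3 : ℕ) : ℝ) ≠ 1 := by norm_num
  rw [Padic.norm_eq_zpow_neg_valuation hy, Padic.norm_eq_zpow_neg_valuation hy₀] at h
  have := zpow_right_injective₀ h3pos h3ne1 h
  omega

/-- The valuation is locally constant off `0`: `‖y − y₀‖ < ‖y₀‖` forces `ord y = ord y₀`. [folklore] -/
private theorem valuation_eq_of_norm_sub_lt {y y₀ : ℚ_[3]} (hy₀ : y₀ ≠ 0) (h : ‖y - y₀‖ < ‖y₀‖) :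
    y.valuation = y₀.valuation := by
  have hn : ‖y‖ = ‖y₀‖ :=
    Literature.NumberTheory.QuadraticForms.padic_norm_eq_of_norm_sub_lt (by rwa [norm_sub_rev])
  have hy : y ≠ 0 := fun h0 => by
    rw [h0, norm_zero] at hn
    exact hy₀ (norm_eq_zero.1 hn.symm)
  exact valuation_eq_of_norm_eq hy hy₀ hn

/-- A point of the `3`-adic circle `x² + y² = 1` has integral coordinates, one of them a unit. [folklore] -/
private theorem coords_of_sq_add_sq_eq_one {x y : ℚ_[3]} (h : x ^ 2 + y ^ 2 = 1) :
    ‖x‖ ≤ 1 ∧ ‖y‖ ≤ 1 ∧ (‖x‖ = 1 ∨ ‖y‖ = 1) := by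
  have hn := norm_sq_add_sq x y
  rw [h, norm_one] at hn
  have hm : max ‖x‖ ‖y‖ = 1 := by
    nlinarith [le_max_left ‖x‖ ‖y‖, norm_nonneg x]
  refine ⟨le_trans (le_max_left _ _) hm.le, le_trans (le_max_right _ _) hm.le, ?_⟩
  rcases max_choice ‖x‖ ‖y‖ with h' | h'
  · exact Or.inl (h' ▸ hm)
  · exact Or.inr (h' ▸ hm)

/-- On the `3`-adic circle, the first coordinate `x u − y v` of a product is a non-unit iff exactly one of `x`, `u` is
(reduction mod `3` and `zmod3_re_mul_eq_zero_iff`). [folklore] -/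
private theorem norm_re_mul_lt_one_iff {x y u v : ℚ_[3]} (hx : ‖x‖ ≤ 1) (hy : ‖y‖ ≤ 1) (hu : ‖u‖ ≤ 1)
    (hv : ‖v‖ ≤ 1) (h1 : x ^ 2 + y ^ 2 = 1) (h2 : u ^ 2 + v ^ 2 = 1) :
    ‖x * u - y * v‖ < 1 ↔ (‖x‖ < 1 ↔ ¬ ‖u‖ < 1) := by
  set a : ℤ_[3] := ⟨x, hx⟩ with ha
  set b : ℤ_[3] := ⟨y, hy⟩ with hb
  set c : ℤ_[3] := ⟨u, hu⟩ with hc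
  set d : ℤ_[3] := ⟨v, hv⟩ with hd
  have h1' : a ^ 2 + b ^ 2 = 1 := PadicInt.ext (by push_cast [ha, hb]; exact h1)
  have h2' : c ^ 2 + d ^ 2 = 1 := PadicInt.ext (by push_cast [hc, hd]; exact h2)
  have hr1 := congrArg PadicInt.toZMod h1'
  have hr2 := congrArg PadicInt.toZMod h2'
  rw [map_add, map_pow, map_pow, map_one] at hr1 hr2
  have key := zmod3_re_mul_eq_zero_iff _ _ _ _ hr1 hr2
  rw [← map_mul, ← map_mul, ← map_sub, toZMod_eq_zero_iff, toZMod_eq_zero_iff, Ne, toZMod_eq_zero_iff] at key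
  exact key

end ThreeAdic

/-! ## §2 `E = ℚ₃(i)`, Mathlib's `QuadraticAlgebra ℚ_[3] (-1) 0` (`i² = −1`): a FIELD; `Nm(a + b i) = a² + b²`; the norm
group `Nm E^× = {a ∈ ℚ₃^× | ord₃ a even}`; the class of a representative `ε = b i ∈ E^{−×}` is the parity of `ord₃ b` -/

section QuadraticField

/-- `Nm(a + b i) = a² + b²` in `ℚ₃(i)` (Mathlib's `QuadraticAlgebra.norm`). [folklore] -/
private theorem norm_eq (z : QuadraticAlgebra ℚ_[3] (-1) 0) : z.norm = z.re ^ 2 + z.im ^ 2 := by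
  rw [QuadraticAlgebra.norm_def]; ring

/-- **`E = ℚ₃(i)` IS A FIELD** (`−1` is not a square in `ℚ₃`), so at this datum the clause «`E` is a field» of
[Liu2021, Lemma D.1 (1)] is TRUE — the case «Now we assume that `E` is a field» of Liu's proof (l. 5243), never reached by
the split certificates. [cite: Liu2021, App. D Lemma D.1 (1) (l. 5229) and its proof, field case (l. 5243)] -/
theorem isField : IsField (QuadraticAlgebra ℚ_[3] (-1) 0) := by
  haveI : Fact (∀ r : ℚ_[3], r ^ 2 ≠ -1 + 0 * r) := ⟨sq_ne_neg_one⟩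
  exact Field.toIsField _

/-- A non-zero element of `ℚ₃(i)` has non-zero norm. [folklore] -/
private theorem norm_ne_zero {z : QuadraticAlgebra ℚ_[3] (-1) 0} (hz : z ≠ 0) : z.norm ≠ 0 := by
  haveI : Fact (∀ r : ℚ_[3], r ^ 2 ≠ -1 + 0 * r) := ⟨sq_ne_neg_one⟩
  exact fun h => hz (QuadraticAlgebra.norm_eq_zero_iff_eq_zero.1 h)

/-- Norms from `ℚ₃(i)^×` have even valuation. [folklore] -/
private theorem even_valuation_norm {z : QuadraticAlgebra ℚ_[3] (-1) 0} (hz : z ≠ 0) : Even z.norm.valuation := by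
  have h := norm_ne_zero hz
  rw [norm_eq] at h ⊢
  exact even_valuation_of_sq_add_sq _ _ h

/-- **The norm group of `ℚ₃(i)/ℚ₃`**: a unit `a ∈ ℚ₃^×` is of the form `x x̄` with `x ∈ ℚ₃(i)^×` iff `ord₃ a` is even
(`ℚ₃(i)/ℚ₃` is the unramified quadratic extension). [folklore] -/
private theorem exists_unit_mul_star_eq_iff (a : ℚ_[3]) (ha : a ≠ 0) :
    (∃ x : (QuadraticAlgebra ℚ_[3] (-1) 0)ˣ, (x : QuadraticAlgebra ℚ_[3] (-1) 0) * star (x : QuadraticAlgebra ℚ_[3] (-1) 0) =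
        algebraMap ℚ_[3] (QuadraticAlgebra ℚ_[3] (-1) 0) a) ↔ Even a.valuation := by
  haveI : Fact (∀ r : ℚ_[3], r ^ 2 ≠ -1 + 0 * r) := ⟨sq_ne_neg_one⟩
  constructor
  · rintro ⟨x, hx⟩
    rw [← QuadraticAlgebra.algebraMap_norm_eq_mul_star, QuadraticAlgebra.algebraMap_inj] at hx
    rw [← hx]
    exact even_valuation_norm x.ne_zero
  · intro he
    obtain ⟨b, c, hbc⟩ := exists_sq_add_sq_of_even_valuation a ha he
    have hN : (⟨b, c⟩ : QuadraticAlgebra ℚ_[3] (-1) 0).norm = a := by rw [norm_eq, ← hbc]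
    have hx0 : (⟨b, c⟩ : QuadraticAlgebra ℚ_[3] (-1) 0) ≠ 0 := fun h0 => by
      rw [h0, QuadraticAlgebra.norm_zero] at hN
      exact ha hN.symm
    refine ⟨Units.mk0 _ hx0, ?_⟩
    rw [Units.val_mk0, ← QuadraticAlgebra.algebraMap_norm_eq_mul_star, hN]

variable {n : ℕ} {S : OscillatorStandingData ℚ_[3] (QuadraticAlgebra ℚ_[3] (-1) 0) n}

/-- For standing data on `ℚ₃(i)` whose involution is `i ↦ −i`: skew elements have zero real part. [folklore] -/
private theorem re_eq_zero_of_mem_skew (hS : ∀ x, S.conj x = star x) {x : QuadraticAlgebra ℚ_[3] (-1) 0}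
    (hx : x ∈ S.skew) : x.re = 0 := by
  rw [S.mem_skew_iff, hS] at hx
  have h := congrArg QuadraticAlgebra.re hx
  simp only [QuadraticAlgebra.re_add, QuadraticAlgebra.re_star, zero_mul, add_zero, QuadraticAlgebra.re_zero] at h
  linear_combination h / 2

/-- A representative `ε ∈ E^{−×}` is `b i` with `b ≠ 0`: its real part vanishes … [folklore] -/
private theorem epsRep_re (hS : ∀ x, S.conj x = star x) (e : LemD1.EpsRep S) :
    (((e.1 : (QuadraticAlgebra ℚ_[3] (-1) 0)ˣ)) : QuadraticAlgebra ℚ_[3] (-1) 0).re = 0 :=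
  re_eq_zero_of_mem_skew hS e.2

/-- … and its imaginary part does not. [folklore] -/
private theorem epsRep_im_ne_zero (hS : ∀ x, S.conj x = star x) (e : LemD1.EpsRep S) :
    (((e.1 : (QuadraticAlgebra ℚ_[3] (-1) 0)ˣ)) : QuadraticAlgebra ℚ_[3] (-1) 0).im ≠ 0 := by
  intro h
  apply e.1.ne_zero
  ext
  · rw [epsRep_re hS e]; rfl
  · rw [h]; rfl

/-- `x x̄ · ε = (0, Nm(x) b)` for `ε = b i`. [folklore] -/
private theorem mul_star_mul_epsRep (hS : ∀ x, S.conj x = star x) (e : LemD1.EpsRep S)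
    (x : QuadraticAlgebra ℚ_[3] (-1) 0) :
    x * star x * ((e.1 : (QuadraticAlgebra ℚ_[3] (-1) 0)ˣ) : QuadraticAlgebra ℚ_[3] (-1) 0) =
      ⟨0, x.norm * (((e.1 : (QuadraticAlgebra ℚ_[3] (-1) 0)ˣ)) : QuadraticAlgebra ℚ_[3] (-1) 0).im⟩ := by
  rw [← QuadraticAlgebra.algebraMap_norm_eq_mul_star, QuadraticAlgebra.algebraMap_eq]
  have hre := epsRep_re hS e
  ext
  · simp [QuadraticAlgebra.re_mul, hre]
  · simp [QuadraticAlgebra.im_mul, hre]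

/-- **The class of a representative `ε = b i ∈ E^{−×}` in `E^{−×}/Nm_{E/F} E^×` is the PARITY of `ord₃ b`**: two
representatives `b i`, `b' i` are in the same class (READING L3′ `SameClass`: `ε' = x x^c ε` for a unit `x`) iff
`ord₃ b + ord₃ b'` is even.  So `E^{−×}/Nm E^×` has exactly two elements at this datum (Step 1 of [Liu2021, §D.1]:
«Choose an element `ε ∈ E^{−×}/Nm_{E/F} E^×`»). [cite: Liu2021, App. D §D.1 Step 1 (l. 5217)] -/
theorem sameClass_iff (hS : ∀ x, S.conj x = star x) (e e' : LemD1.EpsRep S) :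
    LemD1.SameClass e e' ↔
      Even ((((e.1 : (QuadraticAlgebra ℚ_[3] (-1) 0)ˣ)) : QuadraticAlgebra ℚ_[3] (-1) 0).im.valuation +
        (((e'.1 : (QuadraticAlgebra ℚ_[3] (-1) 0)ˣ)) : QuadraticAlgebra ℚ_[3] (-1) 0).im.valuation) := by
  haveI : Fact (∀ r : ℚ_[3], r ^ 2 ≠ -1 + 0 * r) := ⟨sq_ne_neg_one⟩
  have hre' := epsRep_re hS e'
  have him := epsRep_im_ne_zero hS e
  have him' := epsRep_im_ne_zero hS e'
  constructor
  · rintro ⟨x, hx⟩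
    have hx' := congrArg (fun u : (QuadraticAlgebra ℚ_[3] (-1) 0)ˣ => (u : QuadraticAlgebra ℚ_[3] (-1) 0).im) hx
    simp only [Units.val_mul, Units.coe_map, MonoidHom.coe_coe, OscillatorStandingData.σ_apply, hS] at hx'
    rw [mul_star_mul_epsRep hS e] at hx'
    change _ = (x : QuadraticAlgebra ℚ_[3] (-1) 0).norm * _ at hx'
    rw [hx', Padic.valuation_mul (norm_ne_zero x.ne_zero) him]
    obtain ⟨k, hk⟩ := even_valuation_norm (x.ne_zero)
    exact ⟨k + (((e.1 : (QuadraticAlgebra ℚ_[3] (-1) 0)ˣ)) : QuadraticAlgebra ℚ_[3] (-1) 0).im.valuation, by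
      rw [hk]; ring⟩
  · intro he
    have hq : Even ((((e'.1 : (QuadraticAlgebra ℚ_[3] (-1) 0)ˣ)) : QuadraticAlgebra ℚ_[3] (-1) 0).im /
        (((e.1 : (QuadraticAlgebra ℚ_[3] (-1) 0)ˣ)) : QuadraticAlgebra ℚ_[3] (-1) 0).im).valuation := by
      rw [div_eq_mul_inv, Padic.valuation_mul him' (inv_ne_zero him), Padic.valuation_inv]
      obtain ⟨k, hk⟩ := he
      exact ⟨k - (((e.1 : (QuadraticAlgebra ℚ_[3] (-1) 0)ˣ)) : QuadraticAlgebra ℚ_[3] (-1) 0).im.valuation, by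
        omega⟩
    obtain ⟨p, q, hpq⟩ := exists_sq_add_sq_of_even_valuation _ (div_ne_zero him' him) hq
    have hN : (⟨p, q⟩ : QuadraticAlgebra ℚ_[3] (-1) 0).norm =
        (((e'.1 : (QuadraticAlgebra ℚ_[3] (-1) 0)ˣ)) : QuadraticAlgebra ℚ_[3] (-1) 0).im /
          (((e.1 : (QuadraticAlgebra ℚ_[3] (-1) 0)ˣ)) : QuadraticAlgebra ℚ_[3] (-1) 0).im := by
      rw [norm_eq, ← hpq]
    have hx0 : (⟨p, q⟩ : QuadraticAlgebra ℚ_[3] (-1) 0) ≠ 0 := fun h0 => by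
      rw [h0, QuadraticAlgebra.norm_zero] at hN
      exact div_ne_zero him' him hN.symm
    refine ⟨Units.mk0 _ hx0, Units.ext ?_⟩
    simp only [Units.val_mul, Units.coe_map, MonoidHom.coe_coe, OscillatorStandingData.σ_apply, hS, Units.val_mk0]
    rw [mul_star_mul_epsRep hS e, hN, div_mul_cancel₀ _ him]
    ext
    · exact hre'
    · rfl

/-- Consequence: among any THREE representatives two lie in the same class — `E^{−×}/Nm E^×` has at most two elements
at this datum. [cite: Liu2021, App. D §D.1 Step 1 (l. 5217)] -/
theorem sameClass_or_of_three (hS : ∀ x, S.conj x = star x) (e₁ e₂ e₃ : LemD1.EpsRep S) :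
    LemD1.SameClass e₁ e₂ ∨ LemD1.SameClass e₁ e₃ ∨ LemD1.SameClass e₂ e₃ := by
  rw [sameClass_iff hS, sameClass_iff hS, sameClass_iff hS]
  generalize (((e₁.1 : (QuadraticAlgebra ℚ_[3] (-1) 0)ˣ)) : QuadraticAlgebra ℚ_[3] (-1) 0).im.valuation = a
  generalize (((e₂.1 : (QuadraticAlgebra ℚ_[3] (-1) 0)ˣ)) : QuadraticAlgebra ℚ_[3] (-1) 0).im.valuation = b
  generalize (((e₃.1 : (QuadraticAlgebra ℚ_[3] (-1) 0)ˣ)) : QuadraticAlgebra ℚ_[3] (-1) 0).im.valuation = c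
  rcases Int.even_or_odd a with h₁ | h₁ <;> rcases Int.even_or_odd b with h₂ | h₂ <;>
    rcases Int.even_or_odd c with h₃ | h₃
  · exact Or.inl (h₁.add h₂)
  · exact Or.inl (h₁.add h₂)
  · exact Or.inr (Or.inl (h₁.add h₃))
  · exact Or.inr (Or.inr (h₂.add_odd h₃))
  · exact Or.inr (Or.inr (h₂.add h₃))
  · exact Or.inr (Or.inl (h₁.add_odd h₃))
  · exact Or.inl (h₁.add_odd h₂)
  · exact Or.inl (h₁.add_odd h₂)

end QuadraticField

/-! ## §3 Character lines: item (1) AS PRINTED at a character datum of rank `n ≠ 2`; maximal `χ`-quotients of two character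
lines are isomorphic iff the characters agree (as in the split certificates, whose helpers are file-private there) -/

section Character

variable {G Z : Type*} [Group G] [Group Z]

/-- If `G` acts on the line `ℂ` through a character `λ` agreeing with `χ` on the central subgroup `ζ(Z)`, the
`χ`-augmentation submodule vanishes (the maximal `χ`-quotient is the line itself). [folklore] -/
private theorem augmentation_eq_bot_of_character (ρ : Representation ℂ G ℂ) (ζ : Z →* G) (χ : Z →* ℂˣ) (lam : G →* ℂˣ)
    (h : ∀ (g : G) (x : ℂ), ρ g x = (lam g : ℂ) * x) (hcen : ∀ z, lam (ζ z) = χ z) : augmentation ρ ζ χ = ⊥ := by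
  unfold augmentation
  refine iSup_eq_bot.2 fun z => ?_
  rw [LinearMap.range_eq_bot]
  ext
  simp [h, hcen]

/-- Two character lines have isomorphic maximal `χ`-quotients iff the characters coincide (both quotients being the lines
themselves). [folklore] -/
private theorem areIsomorphicRep_quotRep_iff_of_character (ρ₁ ρ₂ : Representation ℂ G ℂ) {ζ : Z →* G}
    (hζ : ∀ z, ζ z ∈ Subgroup.center G) (χ₁ χ₂ : Z →* ℂˣ) (lam₁ lam₂ : G →* ℂˣ)
    (h₁ : ∀ (g : G) (x : ℂ), ρ₁ g x = (lam₁ g : ℂ) * x) (h₂ : ∀ (g : G) (x : ℂ), ρ₂ g x = (lam₂ g : ℂ) * x)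
    (hN₁ : augmentation ρ₁ ζ χ₁ = ⊥) (hN₂ : augmentation ρ₂ ζ χ₂ = ⊥) :
    AreIsomorphicRep (quotRep ρ₁ hζ χ₁) (quotRep ρ₂ hζ χ₂) ↔ lam₁ = lam₂ := by
  have hact₁ : ∀ (g : G) (u : ℂ), quotRep ρ₁ hζ χ₁ g (Submodule.Quotient.mk u) =
      (lam₁ g : ℂ) • (Submodule.Quotient.mk u : ℂ ⧸ augmentation ρ₁ ζ χ₁) := fun g u => by
    rw [quotRep_mk, h₁, ← smul_eq_mul, Submodule.Quotient.mk_smul]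
  have hact₂ : ∀ (g : G) (u : ℂ), quotRep ρ₂ hζ χ₂ g (Submodule.Quotient.mk u) =
      (lam₂ g : ℂ) • (Submodule.Quotient.mk u : ℂ ⧸ augmentation ρ₂ ζ χ₂) := fun g u => by
    rw [quotRep_mk, h₂, ← smul_eq_mul, Submodule.Quotient.mk_smul]
  constructor
  · rintro ⟨f, hf⟩
    ext g
    have hw : (Submodule.Quotient.mk 1 : ℂ ⧸ augmentation ρ₁ ζ χ₁) ≠ 0 := by
      rw [Ne, Submodule.Quotient.mk_eq_zero, hN₁, Submodule.mem_bot]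
      exact one_ne_zero
    have key := hf g (Submodule.Quotient.mk 1)
    obtain ⟨u, hu⟩ := Submodule.Quotient.mk_surjective _ (f (Submodule.Quotient.mk 1))
    rw [hact₁, map_smul, ← hu, hact₂] at key
    have hsub : ((lam₁ g : ℂ) - lam₂ g) • (Submodule.Quotient.mk u : ℂ ⧸ augmentation ρ₂ ζ χ₂) = 0 := by
      rw [sub_smul, key, sub_self]
    rcases smul_eq_zero.1 hsub with h | h
    · exact sub_eq_zero.1 h
    · exact (hw (f.injective (by rw [← hu, h, map_zero]))).elim
  · rintro rfl
    refine ⟨(Submodule.quotEquivOfEqBot _ hN₁).trans (Submodule.quotEquivOfEqBot _ hN₂).symm, fun g w => ?_⟩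
    obtain ⟨u, rfl⟩ := Submodule.Quotient.mk_surjective _ w
    rw [hact₁, map_smul, LinearEquiv.trans_apply, Submodule.quotEquivOfEqBot_apply_mk,
      Submodule.quotEquivOfEqBot_symm_apply, hact₂]

variable {F E : Type} [Field F] [ValuativeRel F] [TopologicalSpace F] [CommRing E] [Algebra F E]
  [TopologicalSpace E] [IsTopologicalRing E] {n : ℕ}

/-- **Item (1) AS PRINTED holds at a character datum of rank `n ≠ 2`**: if `ω(μ, ε)` is the line `ℂ` with `U(V)(F)`
acting through a character `λ` which agrees with `χ` on the centre and is trivial on an open neighbourhood of `1`, then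
`LemD1_1AsPrinted L` — the maximal `χ`-quotient is the line (irreducible, admissible, non-zero), and both sides of the printed
equivalence (1) are FALSE, the right one through its conjunct «(in particular `n = 2`)».  Unlike the split variant
`LemD1IndexedNonVacuity.lemD1_1AsPrinted_of_character` (which uses «`E` is a field» false), this applies when `E` IS a field.
[cite: Liu2021, App. D Lemma D.1 (1) (l. 5229)] -/
theorem lemD1_1AsPrinted_of_character_of_rank_ne_two (L : LemD1Data F E n ℂ) (lam : L.S.U →* ℂˣ)
    (hω : ∀ (g : L.S.U) (x : ℂ), L.omega g x = (lam g : ℂ) * x)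
    (hcen : ∀ z : L.S.normOne, lam (L.S.scalar z) = L.chi z)
    (hopen : ∃ O : Set L.S.U, IsOpen O ∧ (1 : L.S.U) ∈ O ∧ ∀ g ∈ O, lam g = 1) (hn : n ≠ 2) :
    LemD1_1AsPrinted L := by
  have hN : augmentation L.omega L.S.scalar L.chi = ⊥ :=
    augmentation_eq_bot_of_character L.omega L.S.scalar L.chi lam hω hcen
  have hfin : Module.finrank ℂ (ℂ ⧸ augmentation L.omega L.S.scalar L.chi) = 1 := by
    rw [(Submodule.quotEquivOfEqBot _ hN).finrank_eq, Module.finrank_self]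
  haveI hsimple : IsSimpleModule ℂ (ℂ ⧸ augmentation L.omega L.S.scalar L.chi) :=
    isSimpleModule_iff_finrank_eq_one.2 hfin
  have hact : ∀ (g : L.S.U) (w : ℂ ⧸ augmentation L.omega L.S.scalar L.chi),
      L.datum.quot g w = (lam g : ℂ) • w := by
    intro g w
    obtain ⟨y, rfl⟩ := Submodule.Quotient.mk_surjective _ w
    rw [LemD1Data.datum_quot, quotRep_mk, hω, ← smul_eq_mul, Submodule.Quotient.mk_smul]
  refine ⟨⟨?_, ?_, ?_⟩, ?_⟩
  · intro W
    rcases eq_bot_or_eq_top W.toSubmodule with h | h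
    · exact Or.inl (Subrepresentation.toSubmodule_injective h)
    · exact Or.inr (Subrepresentation.toSubmodule_injective h)
  · intro x
    obtain ⟨O, hO, h1O, hlam⟩ := hopen
    change IsOpen (L.datum.quot.stabilizerSubgroup x : Set L.S.U)
    refine Subgroup.isOpen_of_mem_nhds _ (g := 1) (Filter.mem_of_superset (hO.mem_nhds h1O) fun g hg => ?_)
    change L.datum.quot g x = x
    rw [hact, hlam g hg, Units.val_one, one_smul]
  · intro K _
    infer_instance
  · refine iff_of_false ?_ ?_
    · rw [not_subsingleton_iff_nontrivial]
      exact Module.nontrivial_of_finrank_pos (R := ℂ) (by rw [hfin]; exact one_pos)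
    · exact fun h => hn h.2.1.2

end Character

/-! ## §4 The non-split standing data on `ℚ₃(i)` (involution `i ↦ −i`, Gram matrix `1`) and its characters:
a Step-2 character `μ = (−1)^{ord Nm}`, the sign character `s` of `E¹`, and `det : U(V)(F) → E¹` -/

section StandingData

/-- **The standing data of [Liu2021, §D.1] ARE satisfied at a non-split place**: `F = ℚ₃` (a non-archimedean local field
of characteristic `0 ≠ 2`), `E = ℚ₃(i)` with `c : i ↦ −i` (Mathlib's `star`; étale of rank `2`, indeed a separable
quadratic FIELD extension), Gram matrix `1` (hermitian, unit determinant), any rank `n ≥ 2`.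
[cite: Liu2021, App. D §D.1 (l. 5213)] -/
theorem exists_standingData (n : ℕ) (hn : 2 ≤ n) :
    ∃ S : OscillatorStandingData ℚ_[3] (QuadraticAlgebra ℚ_[3] (-1) 0) n, (∀ x, S.conj x = star x) ∧ S.gram = 1 := by
  haveI hF : Fact (∀ r : ℚ_[3], r ^ 2 ≠ -1 + 0 * r) := ⟨sq_ne_neg_one⟩
  let c : QuadraticAlgebra ℚ_[3] (-1) 0 ≃ₐ[ℚ_[3]] QuadraticAlgebra ℚ_[3] (-1) 0 :=
    AlgEquiv.ofRingEquiv (f := (starRingAut : RingAut (QuadraticAlgebra ℚ_[3] (-1) 0))) fun r => by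
      change star (algebraMap ℚ_[3] (QuadraticAlgebra ℚ_[3] (-1) 0) r) = _
      rw [QuadraticAlgebra.algebraMap_eq]
      ext <;> simp [QuadraticAlgebra.star_mk]
  have hc : ∀ x, c x = star x := fun x => rfl
  haveI : Algebra.IsIntegral ℚ_[3] (QuadraticAlgebra ℚ_[3] (-1) 0) := Algebra.IsIntegral.of_finite _ _
  refine ⟨{ conj := c
            conj_conj := fun x => by rw [hc, hc, star_star]
            conj_ne_refl := fun h => by
              have := DFunLike.congr_fun h (⟨0, 1⟩ : QuadraticAlgebra ℚ_[3] (-1) 0)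
              rw [hc, QuadraticAlgebra.star_mk, AlgEquiv.coe_refl, id] at this
              have := congrArg QuadraticAlgebra.im this
              norm_num at this
            gram := 1
            gram_hermitian := by rw [Matrix.map_one _ (map_zero c) (map_one c), Matrix.transpose_one]
            isUnit_det_gram := by simp
            ringChar_ne_two := by rw [ringChar.eq_zero]; decide
            formallyEtale := Algebra.FormallyEtale.of_isSeparable ℚ_[3] (QuadraticAlgebra ℚ_[3] (-1) 0)
            finrank_eq_two := QuadraticAlgebra.finrank_eq_two (-1) 0
            two_le := hn }, hc, rfl⟩

variable {n : ℕ} {S : OscillatorStandingData ℚ_[3] (QuadraticAlgebra ℚ_[3] (-1) 0) n}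
  [TopologicalSpace (QuadraticAlgebra ℚ_[3] (-1) 0)] [IsModuleTopology ℚ_[3] (QuadraticAlgebra ℚ_[3] (-1) 0)]

/-- the coordinate `re : ℚ₃(i) → ℚ₃` is continuous for the module topology. [folklore] -/
private theorem continuous_re : Continuous fun z : QuadraticAlgebra ℚ_[3] (-1) 0 => z.re :=
  IsModuleTopology.continuous_of_linearMap (QuadraticAlgebra.reₗ (R := ℚ_[3]) (a := -1) (b := 0))

/-- the coordinate `im : ℚ₃(i) → ℚ₃` is continuous for the module topology. [folklore] -/
private theorem continuous_im : Continuous fun z : QuadraticAlgebra ℚ_[3] (-1) 0 => z.im :=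
  IsModuleTopology.continuous_of_linearMap (QuadraticAlgebra.imₗ (R := ℚ_[3]) (a := -1) (b := 0))

/-- **A Step-2 character exists at the non-split datum**: `μ(z) = (−1)^{ord₃ Nm(z) / 2}` (`= (−1)^{ord_E z}`, the
unramified quadratic character of `E^×`) is unitary, continuous (locally constant), and `μ|_{ℚ₃^×} = (−1)^{ord₃}` has kernel
EXACTLY the norm group `Nm E^× = {ord₃ even}` (§2). [cite: Liu2021, App. D §D.1 Step 2 (l. 5219)] -/
theorem nonempty_muSet (hS : ∀ x, S.conj x = star x) : Nonempty (LemD1.MuSet S) := by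
  classical
  have hk : ∀ z : (QuadraticAlgebra ℚ_[3] (-1) 0)ˣ,
      (z : QuadraticAlgebra ℚ_[3] (-1) 0).norm.valuation = 2 * ((z : QuadraticAlgebra ℚ_[3] (-1) 0).norm.valuation / 2) :=
    fun z => (Int.two_mul_ediv_two_of_even (even_valuation_norm z.ne_zero)).symm
  let f : ℤ →* ℂ := (Int.castRingHom ℂ).toMonoidHom
  have hf : Function.Injective f := Int.cast_injective
  let μ : (QuadraticAlgebra ℚ_[3] (-1) 0)ˣ →* ℂˣ :=
    { toFun := fun z => Units.map f ((z : QuadraticAlgebra ℚ_[3] (-1) 0).norm.valuation / 2).negOnePow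
      map_one' := by simp
      map_mul' := fun z w => by
        have h : ((z * w : (QuadraticAlgebra ℚ_[3] (-1) 0)ˣ) : QuadraticAlgebra ℚ_[3] (-1) 0).norm.valuation / 2 =
            (z : QuadraticAlgebra ℚ_[3] (-1) 0).norm.valuation / 2 +
              (w : QuadraticAlgebra ℚ_[3] (-1) 0).norm.valuation / 2 := by
          have hv : ((z * w : (QuadraticAlgebra ℚ_[3] (-1) 0)ˣ) : QuadraticAlgebra ℚ_[3] (-1) 0).norm.valuation =
              (z : QuadraticAlgebra ℚ_[3] (-1) 0).norm.valuation + (w : QuadraticAlgebra ℚ_[3] (-1) 0).norm.valuation := by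
            rw [Units.val_mul, map_mul, Padic.valuation_mul (norm_ne_zero z.ne_zero) (norm_ne_zero w.ne_zero)]
          have h1 := hk z
          have h2 := hk w
          omega
        simp only [h, Int.negOnePow_add, map_mul] }
  have hμ : ∀ z, μ z = Units.map f ((z : QuadraticAlgebra ℚ_[3] (-1) 0).norm.valuation / 2).negOnePow := fun z => rfl
  have hμval : ∀ z, ((μ z : ℂˣ) : ℂ) =
      (((((z : QuadraticAlgebra ℚ_[3] (-1) 0).norm.valuation / 2).negOnePow : ℤˣ) : ℤ) : ℂ) := fun z => rfl
  refine ⟨⟨μ, fun z => ?_, ?_, fun a => ?_⟩⟩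
  · -- unitary
    rw [hμval]
    rcases Int.units_eq_one_or ((z : QuadraticAlgebra ℚ_[3] (-1) 0).norm.valuation / 2).negOnePow with h | h <;>
      simp [h]
  · -- continuous: locally constant
    have hc : Continuous fun z : (QuadraticAlgebra ℚ_[3] (-1) 0)ˣ => (z : QuadraticAlgebra ℚ_[3] (-1) 0).norm := by
      have heq : (fun z : (QuadraticAlgebra ℚ_[3] (-1) 0)ˣ => (z : QuadraticAlgebra ℚ_[3] (-1) 0).norm) =
          fun z : (QuadraticAlgebra ℚ_[3] (-1) 0)ˣ =>
            (z : QuadraticAlgebra ℚ_[3] (-1) 0).re ^ 2 + (z : QuadraticAlgebra ℚ_[3] (-1) 0).im ^ 2 :=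
        funext fun z => norm_eq _
      rw [heq]
      exact ((continuous_re.comp Units.continuous_val).pow 2).add ((continuous_im.comp Units.continuous_val).pow 2)
    refine continuous_iff_continuousAt.2 fun z₀ => ?_
    have h0 : (z₀ : QuadraticAlgebra ℚ_[3] (-1) 0).norm ≠ 0 := norm_ne_zero z₀.ne_zero
    have hev : ∀ᶠ z : (QuadraticAlgebra ℚ_[3] (-1) 0)ˣ in nhds z₀, (z : QuadraticAlgebra ℚ_[3] (-1) 0).norm.valuation =
        (z₀ : QuadraticAlgebra ℚ_[3] (-1) 0).norm.valuation := by
      have hball : Metric.ball ((z₀ : QuadraticAlgebra ℚ_[3] (-1) 0).norm) ‖(z₀ : QuadraticAlgebra ℚ_[3] (-1) 0).norm‖ ∈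
          nhds ((z₀ : QuadraticAlgebra ℚ_[3] (-1) 0).norm) :=
        Metric.ball_mem_nhds _ (norm_pos_iff.2 h0)
      filter_upwards [hc.continuousAt.preimage_mem_nhds hball] with z hz
      exact valuation_eq_of_norm_sub_lt h0 (by simpa [dist_eq_norm] using hz)
    refine (continuousAt_const (y := ((μ z₀ : ℂˣ) : ℂ))).congr (hev.mono fun z hz => ?_)
    change ((μ z₀ : ℂˣ) : ℂ) = ((μ z : ℂˣ) : ℂ)
    rw [hμval, hμval, hz]
  · -- «μ|_{F^×} is the unique character whose kernel is exactly Nm E^×»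
    have ha0 : (a : ℚ_[3]) ≠ 0 := a.ne_zero
    have hnorm : ((Units.map (algebraMap ℚ_[3] (QuadraticAlgebra ℚ_[3] (-1) 0)).toMonoidHom a :
        (QuadraticAlgebra ℚ_[3] (-1) 0)ˣ) : QuadraticAlgebra ℚ_[3] (-1) 0).norm = (a : ℚ_[3]) ^ 2 := by
      rw [Units.coe_map]
      exact QuadraticAlgebra.norm_algebraMap _
    have hR : (∃ x : (QuadraticAlgebra ℚ_[3] (-1) 0)ˣ, (x : QuadraticAlgebra ℚ_[3] (-1) 0) * S.conj x =
        algebraMap ℚ_[3] (QuadraticAlgebra ℚ_[3] (-1) 0) a) ↔ Even (a : ℚ_[3]).valuation := by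
      simp only [hS]
      exact exists_unit_mul_star_eq_iff _ ha0
    rw [hR, hμ, (Units.map_injective hf).eq_iff' (map_one _), Int.negOnePow_eq_one_iff, hnorm, Padic.valuation_pow]
    have h2 : ((2 : ℕ) : ℤ) * (a : ℚ_[3]).valuation / 2 = (a : ℚ_[3]).valuation := by omega
    rw [h2]

/-- **The sign character of `E¹`** at the non-split datum: for `z = a + b i ∈ E¹` (`a² + b² = 1`, so `a, b ∈ ℤ₃` with
exactly one of them a unit), `s(z) = +1` if `a` is a unit and `−1` if `3 ∣ a` — i.e. `z mod 3 ∈ {±1}` versus `{±i}` in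
`μ₄(𝔽₉)`.  It is a unitary, continuous (locally constant) character of `E¹` of order `2` with `s(i) = −1`; it supplies the
non-trivial carrier `s ∘ det`. [cite: Liu2021, App. D §D.1 Step 3 (l. 5221)] -/
theorem exists_signChar (hS : ∀ x, S.conj x = star x) :
    ∃ s : S.normOne →* ℂˣ, (∀ z, ‖((s z : ℂˣ) : ℂ)‖ = 1) ∧ (Continuous fun z : S.normOne => ((s z : ℂˣ) : ℂ)) ∧
      (∀ z, s z * s z = 1) ∧
      ∀ z : S.normOne, s z = 1 ↔ ¬ ‖(((z : (QuadraticAlgebra ℚ_[3] (-1) 0)ˣ)) : QuadraticAlgebra ℚ_[3] (-1) 0).re‖ < 1 := by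
  classical
  -- norm-one elements: `re² + im² = 1`
  have hsq : ∀ z : S.normOne, (((z : (QuadraticAlgebra ℚ_[3] (-1) 0)ˣ)) : QuadraticAlgebra ℚ_[3] (-1) 0).re ^ 2 +
      (((z : (QuadraticAlgebra ℚ_[3] (-1) 0)ˣ)) : QuadraticAlgebra ℚ_[3] (-1) 0).im ^ 2 = 1 := fun z => by
    have h := (S.mem_normOne_iff' _).1 z.2
    rw [hS, ← QuadraticAlgebra.algebraMap_norm_eq_mul_star, ← QuadraticAlgebra.C_eq_algebraMap,
      QuadraticAlgebra.C_eq_one_iff, norm_eq] at h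
    exact h
  let sf : S.normOne → ℂˣ := fun z =>
    if ‖(((z : (QuadraticAlgebra ℚ_[3] (-1) 0)ˣ)) : QuadraticAlgebra ℚ_[3] (-1) 0).re‖ < 1 then -1 else 1
  have hsf : ∀ z, sf z = if ‖(((z : (QuadraticAlgebra ℚ_[3] (-1) 0)ˣ)) : QuadraticAlgebra ℚ_[3] (-1) 0).re‖ < 1
      then -1 else 1 := fun z => rfl
  have hmul : ∀ z w, sf (z * w) = sf z * sf w := by
    intro z w
    obtain ⟨hzr, hzi, -⟩ := coords_of_sq_add_sq_eq_one (hsq z)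
    obtain ⟨hwr, hwi, -⟩ := coords_of_sq_add_sq_eq_one (hsq w)
    have hre : (((z * w : S.normOne) : (QuadraticAlgebra ℚ_[3] (-1) 0)ˣ) : QuadraticAlgebra ℚ_[3] (-1) 0).re =
        (((z : (QuadraticAlgebra ℚ_[3] (-1) 0)ˣ)) : QuadraticAlgebra ℚ_[3] (-1) 0).re *
            (((w : (QuadraticAlgebra ℚ_[3] (-1) 0)ˣ)) : QuadraticAlgebra ℚ_[3] (-1) 0).re -
          (((z : (QuadraticAlgebra ℚ_[3] (-1) 0)ˣ)) : QuadraticAlgebra ℚ_[3] (-1) 0).im *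
            (((w : (QuadraticAlgebra ℚ_[3] (-1) 0)ˣ)) : QuadraticAlgebra ℚ_[3] (-1) 0).im := by
      change ((((z : (QuadraticAlgebra ℚ_[3] (-1) 0)ˣ) : QuadraticAlgebra ℚ_[3] (-1) 0) *
        ((w : (QuadraticAlgebra ℚ_[3] (-1) 0)ˣ) : QuadraticAlgebra ℚ_[3] (-1) 0))).re = _
      rw [QuadraticAlgebra.re_mul]
      ring
    have key := norm_re_mul_lt_one_iff hzr hzi hwr hwi (hsq z) (hsq w)
    rw [hsf, hsf, hsf, hre]
    by_cases hz : ‖(((z : (QuadraticAlgebra ℚ_[3] (-1) 0)ˣ)) : QuadraticAlgebra ℚ_[3] (-1) 0).re‖ < 1 <;>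
      by_cases hw : ‖(((w : (QuadraticAlgebra ℚ_[3] (-1) 0)ˣ)) : QuadraticAlgebra ℚ_[3] (-1) 0).re‖ < 1
    · rw [if_neg (fun h => (key.1 h).1 hz hw), if_pos hz, if_pos hw, neg_mul_neg, one_mul]
    · rw [if_pos (key.2 (iff_of_true hz hw)), if_pos hz, if_neg hw, mul_one]
    · rw [if_pos (key.2 (iff_of_false hz (not_not.2 hw))), if_neg hz, if_pos hw, one_mul]
    · rw [if_neg (fun h => hz ((key.1 h).2 hw)), if_neg hz, if_neg hw, one_mul]
  have hone : sf 1 = 1 := by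
    rw [hsf, if_neg]
    simp [QuadraticAlgebra.re_one]
  let s : S.normOne →* ℂˣ := { toFun := sf, map_one' := hone, map_mul' := hmul }
  have hs : ∀ z, s z = sf z := fun z => rfl
  have hs_one : ∀ z : S.normOne,
      s z = 1 ↔ ¬ ‖(((z : (QuadraticAlgebra ℚ_[3] (-1) 0)ˣ)) : QuadraticAlgebra ℚ_[3] (-1) 0).re‖ < 1 := by
    intro z
    rw [hs, hsf]
    by_cases h : ‖(((z : (QuadraticAlgebra ℚ_[3] (-1) 0)ˣ)) : QuadraticAlgebra ℚ_[3] (-1) 0).re‖ < 1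
    · rw [if_pos h]
      refine iff_of_false (fun h1 => ?_) (not_not.2 h)
      have := congrArg (fun u : ℂˣ => (u : ℂ)) h1
      norm_num at this
    · rw [if_neg h]
      exact iff_of_true rfl h
  have hre_cont : Continuous fun z : S.normOne =>
      (((z : (QuadraticAlgebra ℚ_[3] (-1) 0)ˣ)) : QuadraticAlgebra ℚ_[3] (-1) 0).re :=
    continuous_re.comp (Units.continuous_val.comp continuous_subtype_val)
  refine ⟨s, fun z => ?_, ?_, fun z => ?_, hs_one⟩
  · rw [hs, hsf]
    by_cases h : ‖(((z : (QuadraticAlgebra ℚ_[3] (-1) 0)ˣ)) : QuadraticAlgebra ℚ_[3] (-1) 0).re‖ < 1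
    · rw [if_pos h]; simp
    · rw [if_neg h]; simp
  · refine IsLocallyConstant.continuous ((IsLocallyConstant.iff_exists_open _).2 fun z => ?_)
    by_cases hz : ‖(((z : (QuadraticAlgebra ℚ_[3] (-1) 0)ˣ)) : QuadraticAlgebra ℚ_[3] (-1) 0).re‖ < 1
    · refine ⟨{w | ‖(((w : (QuadraticAlgebra ℚ_[3] (-1) 0)ˣ)) : QuadraticAlgebra ℚ_[3] (-1) 0).re‖ < 1},
        isOpen_lt (continuous_norm.comp hre_cont) continuous_const, hz,
        fun w (hw : ‖(((w : (QuadraticAlgebra ℚ_[3] (-1) 0)ˣ)) : QuadraticAlgebra ℚ_[3] (-1) 0).re‖ < 1) => ?_⟩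
      rw [hs, hs, hsf, hsf, if_pos hz, if_pos hw]
    · refine ⟨{w | (3 : ℝ)⁻¹ < ‖(((w : (QuadraticAlgebra ℚ_[3] (-1) 0)ˣ)) : QuadraticAlgebra ℚ_[3] (-1) 0).re‖},
        isOpen_lt continuous_const (continuous_norm.comp hre_cont), ?_, fun w hw => ?_⟩
      · change (3 : ℝ)⁻¹ < _
        have : (3 : ℝ)⁻¹ < 1 := by norm_num
        exact this.trans_le (not_lt.1 hz)
      · have hw' : ¬ ‖(((w : (QuadraticAlgebra ℚ_[3] (-1) 0)ˣ)) : QuadraticAlgebra ℚ_[3] (-1) 0).re‖ < 1 := by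
          intro h
          have h' : ‖(((w : (QuadraticAlgebra ℚ_[3] (-1) 0)ˣ)) : QuadraticAlgebra ℚ_[3] (-1) 0).re‖ <
              ((3 : ℕ) : ℝ) ^ ((-1 : ℤ) + 1) := by norm_num; exact h
          have hle := (Padic.norm_le_pow_iff_norm_lt_pow_add_one _ (-1)).2 h'
          have hw2 : (3 : ℝ)⁻¹ < _ := hw
          rw [zpow_neg_one] at hle
          push_cast at hle
          exact absurd (hw2.trans_le hle) (lt_irrefl _)
        change ((s w : ℂˣ) : ℂ) = ((s z : ℂˣ) : ℂ)
        rw [hs, hs, hsf, hsf, if_neg hz, if_neg hw']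
  · rw [hs, hsf]
    by_cases h : ‖(((z : (QuadraticAlgebra ℚ_[3] (-1) 0)ˣ)) : QuadraticAlgebra ℚ_[3] (-1) 0).re‖ < 1
    · rw [if_pos h, neg_mul_neg, one_mul]
    · rw [if_neg h, one_mul]

omit [TopologicalSpace (QuadraticAlgebra ℚ_[3] (-1) 0)] [IsModuleTopology ℚ_[3] (QuadraticAlgebra ℚ_[3] (-1) 0)] in
/-- **`det : U(V)(F) → E¹`** for Gram matrix `1`: a unitary matrix has unitary determinant (`det(ḡᵀ g) = N(det g) = 1`).
[cite: Liu2021, App. D §D.1 (l. 5213)] -/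
theorem exists_detNormOne (hgram : S.gram = 1) :
    ∃ d : S.U →* S.normOne, ∀ g : S.U, ((d g : S.normOne) : (QuadraticAlgebra ℚ_[3] (-1) 0)ˣ) =
      Matrix.GeneralLinearGroup.det (g : GL (Fin n) (QuadraticAlgebra ℚ_[3] (-1) 0)) := by
  have hmem : ∀ g : S.U,
      Matrix.GeneralLinearGroup.det (g : GL (Fin n) (QuadraticAlgebra ℚ_[3] (-1) 0)) ∈ S.normOne := by
    intro g
    rw [S.mem_normOne_iff', Matrix.GeneralLinearGroup.val_det_apply]
    have h := (S.mem_U_iff _).1 g.2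
    rw [hgram, Matrix.mul_one] at h
    have hd := congrArg Matrix.det h
    rw [Matrix.det_mul, Matrix.det_transpose, Matrix.det_one, ← AlgEquiv.mapMatrix_apply, ← AlgEquiv.map_det,
      mul_comm] at hd
    exact hd
  exact ⟨MonoidHom.codRestrict ((Matrix.GeneralLinearGroup.det).comp S.U.subtype) S.normOne hmem, fun g => rfl⟩

end StandingData

/-! ## §5 The certificate: a three-member collection over `ℚ₃(i)/ℚ₃`, rank `n = 4`, Gram matrix `1` — same `μ`, same
`χ = 1` throughout; `ε₀ = i`, `ε₁ = 3i` (the OTHER class), `ε₂ = −i` (a different representative of the class of `ε₀`);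
carriers `1`, `s ∘ det`, `1` -/

section Certificate

variable [TopologicalSpace (QuadraticAlgebra ℚ_[3] (-1) 0)] [IsTopologicalRing (QuadraticAlgebra ℚ_[3] (-1) 0)]
  [IsModuleTopology ℚ_[3] (QuadraticAlgebra ℚ_[3] (-1) 0)]

/-- **NON-VACUITY OF «LEMMA D.1 (1) ∧ (3)» AT A NON-SPLIT PLACE, WITH THE `ε`-CONJUNCT OF (3) AT TRUTH VALUE FALSE**
(in-kernel certificate, our bookkeeping; no statement about Liu's `ω(μ, ε)`).  Over `F = ℚ₃`, `E = ℚ₃(i)` — a FIELD — with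
`c : i ↦ −i`, the hermitian space `(E⁴, 1)` of rank `n = 4`, and `E` carrying its module topology (any instance of it), there is
a collection `Lf : LemD1IndexedFamily ℚ_[3] E 4 (Fin 3)` of Step 1–3 data with ONE Step-2 character `μ = (−1)^{ord_E}` and ONE
Step-3 character `χ = 1` for all three members, representatives `ε₀ = i`, `ε₁ = 3i`, `ε₂ = −i = −ε₀`, and ⟨CARRIER⟩ lines
`ω(μ, ε₀) = ω(μ, ε₂) = 1`, `ω(μ, ε₁) = s ∘ det` (`s` the sign character of `E¹`, trivial on the centre since `s⁴ = 1`,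
`≠ 1` at `diag(i, 1, 1, 1)`), such that:
* `Lf.Item1AsPrinted` — every `ω(μ, ε_k, χ)` is a line: irreducible, admissible, NON-ZERO although «`E` is a field» is TRUE
  (the right side of (1) fails through «`n = 2`»);
* `LemD1_3AsPrintedI Lf` — the printed «isomorphic iff `(μ', ε', χ') = (μ, ε, χ)`» for all nine pairs;
* members `0, 1`: `μ`, `χ` EQUAL, `[ε₀] ≠ [ε₁]` in `E^{−×}/Nm E^×` (`3 = ε₁/ε₀` is not a norm: `ord₃ 3` is odd) and
  `ω(μ, ε₁, χ) ≇ ω(μ, ε₀, χ)` — the `ε`-conjunct of (3) is the ONLY failing conjunct, at truth value FALSE (which no split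
  datum can exercise: there `E^{−×}/Nm E^×` is one point, `LemD1.sameClass_of_splitData`);
* members `0, 2`: `ε₂ = −ε₀ ≠ ε₀` as representatives but `[ε₂] = [ε₀]` (`−1 = Nm(x)`, `x = √−2 + i`), and
  `ω(μ, ε₂, χ) ≅ ω(μ, ε₀, χ)` — so «`ε' = ε`» is read in `E^{−×}/Nm E^×` (READING L3′), not on representatives, at a field too;
* members `1, 2`: `[ε₁] ≠ [ε₂]`, non-isomorphic.
[cite: Liu2021, App. D Lemma D.1 (1) (l. 5229) and (3) (l. 5233); §D.1 Steps 1–3 (l. 5217–5221)] -/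
theorem exists_lemD1IndexedFamily_nonsplit :
    ∃ Lf : LemD1IndexedFamily ℚ_[3] (QuadraticAlgebra ℚ_[3] (-1) 0) 4 (Fin 3),
      IsField (QuadraticAlgebra ℚ_[3] (-1) 0) ∧ (∀ x, Lf.S.conj x = star x) ∧ Lf.S.gram = 1 ∧
      Lf.Item1AsPrinted ∧ LemD1_3AsPrintedI Lf ∧
      (∀ i j, Lf.mu i = Lf.mu j) ∧ (∀ i j, Lf.chi i = Lf.chi j) ∧
      (¬ LemD1.SameClass (Lf.eps 0) (Lf.eps 1) ∧ ¬ AreIsomorphicRep (Lf.quot 1) (Lf.quot 0)) ∧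
      (Lf.eps 2 = LemD1.epsNeg (Lf.eps 0) ∧ Lf.eps 2 ≠ Lf.eps 0 ∧ LemD1.SameClass (Lf.eps 0) (Lf.eps 2) ∧
        AreIsomorphicRep (Lf.quot 2) (Lf.quot 0)) ∧
      (¬ LemD1.SameClass (Lf.eps 1) (Lf.eps 2) ∧ ¬ AreIsomorphicRep (Lf.quot 2) (Lf.quot 1)) := by
  classical
  haveI hF : Fact (∀ r : ℚ_[3], r ^ 2 ≠ -1 + 0 * r) := ⟨sq_ne_neg_one⟩
  obtain ⟨S, hS, hgram⟩ := exists_standingData 4 (by norm_num)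
  obtain ⟨μ⟩ := nonempty_muSet (S := S) hS
  obtain ⟨s, -, -, hs_sq, hs_one⟩ := exists_signChar (S := S) hS
  obtain ⟨detN, hdetN⟩ := exists_detNormOne (S := S) hgram
  -- Step 3: `χ = 1`
  let χ : LemD1.ChiSet S := ⟨1, fun z => by simp, by simpa using continuous_const⟩
  -- Step 1: the representatives `b i`, `b ∈ {1, 3, −1}`
  have hskew : ∀ b : ℚ_[3], (⟨0, b⟩ : QuadraticAlgebra ℚ_[3] (-1) 0) ∈ S.skew := fun b => by
    rw [S.mem_skew_iff, hS, QuadraticAlgebra.star_mk]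
    ext <;> simp
  have hne : ∀ b : ℚ_[3], b ≠ 0 → (⟨0, b⟩ : QuadraticAlgebra ℚ_[3] (-1) 0) ≠ 0 := fun b hb h =>
    hb (by simpa using congrArg QuadraticAlgebra.im h)
  let eb : ∀ b : ℚ_[3], b ≠ 0 → LemD1.EpsRep S := fun b hb =>
    ⟨Units.mk0 _ (hne b hb), by rw [Units.val_mk0]; exact hskew b⟩
  have heb_im : ∀ b hb, (((eb b hb).1 : (QuadraticAlgebra ℚ_[3] (-1) 0)ˣ) : QuadraticAlgebra ℚ_[3] (-1) 0).im = b :=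
    fun b hb => rfl
  have h3 : (3 : ℚ_[3]) ≠ 0 := by norm_num
  have hm1 : (-1 : ℚ_[3]) ≠ 0 := by norm_num
  -- the classes: `ord₃ 1 = 0`, `ord₃ 3 = 1`, `ord₃ (−1) = 0`
  have hv1 : (1 : ℚ_[3]).valuation = 0 := Padic.valuation_one
  have hv3 : (3 : ℚ_[3]).valuation = 1 := by
    rw [Padic.valuation_ofNat]
    simp
  have hvm1 : (-1 : ℚ_[3]).valuation = 0 :=
    (valuation_eq_of_norm_eq hm1 one_ne_zero (by rw [norm_neg])).trans hv1
  have h01 : ¬ LemD1.SameClass (eb 1 one_ne_zero) (eb 3 h3) := by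
    rw [sameClass_iff hS, heb_im 1 one_ne_zero, heb_im 3 h3, hv1, hv3]; decide
  have h02 : LemD1.SameClass (eb 1 one_ne_zero) (eb (-1) hm1) := by
    rw [sameClass_iff hS, heb_im 1 one_ne_zero, heb_im (-1) hm1, hv1, hvm1]; decide
  have h12 : ¬ LemD1.SameClass (eb 3 h3) (eb (-1) hm1) := by
    rw [sameClass_iff hS, heb_im 3 h3, heb_im (-1) hm1, hv3, hvm1]; decide
  have h20 : eb (-1) hm1 ≠ eb 1 one_ne_zero := fun h => by
    have := congrArg (fun e : LemD1.EpsRep S =>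
      (((e.1 : (QuadraticAlgebra ℚ_[3] (-1) 0)ˣ)) : QuadraticAlgebra ℚ_[3] (-1) 0).im) h
    simp only [heb_im] at this
    norm_num at this
  have h2neg : eb (-1) hm1 = LemD1.epsNeg (eb 1 one_ne_zero) := by
    apply Subtype.ext
    apply Units.ext
    change (⟨0, -1⟩ : QuadraticAlgebra ℚ_[3] (-1) 0) = -⟨0, 1⟩
    ext <;> simp
  -- the characters `1` and `λ = s ∘ det` of `U(V)(F)`
  let lam : S.U →* ℂˣ := s.comp detN
  have hlam : ∀ g, lam g = s (detN g) := fun g => rfl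
  have hcen : ∀ z : S.normOne, lam (S.scalar z) = 1 := by
    intro z
    have hd : detN (S.scalar z) = z ^ 4 := by
      apply Subtype.ext
      rw [hdetN]
      apply Units.ext
      rw [Matrix.GeneralLinearGroup.val_det_apply, SubgroupClass.coe_pow, Units.val_pow_eq_pow_val]
      change (Matrix.scalar (Fin 4) (((z : (QuadraticAlgebra ℚ_[3] (-1) 0)ˣ)) : QuadraticAlgebra ℚ_[3] (-1) 0)).det = _
      simp [Matrix.scalar_apply, Matrix.det_diagonal, Finset.prod_const]
    rw [hlam, hd, map_pow]
    simp only [pow_succ, pow_zero, one_mul, hs_sq]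
  have hcenχ : ∀ z : S.normOne, lam (S.scalar z) = χ.1 z := fun z => by rw [hcen]; rfl
  have hcen1 : ∀ z : S.normOne, (1 : S.U →* ℂˣ) (S.scalar z) = χ.1 z := fun z => rfl
  -- the witness `g₀ = diag(i, 1, 1, 1) ∈ U(V)(F)` with `λ g₀ = s(i) = −1`
  have hωne : (⟨0, 1⟩ : QuadraticAlgebra ℚ_[3] (-1) 0) ≠ 0 := hne 1 one_ne_zero
  let d : Fin 4 → QuadraticAlgebra ℚ_[3] (-1) 0 := ![⟨0, 1⟩, 1, 1, 1]
  have hdet_d : (Matrix.diagonal d).det = ⟨0, 1⟩ := by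
    simp [Matrix.det_diagonal, Fin.prod_univ_four, d]
  have hA₀det : (Matrix.diagonal d).det ≠ 0 := by rw [hdet_d]; exact hωne
  let A₀ : GL (Fin 4) (QuadraticAlgebra ℚ_[3] (-1) 0) := Matrix.GeneralLinearGroup.mkOfDetNeZero _ hA₀det
  have hA₀ : ((A₀ : GL (Fin 4) (QuadraticAlgebra ℚ_[3] (-1) 0)) : Matrix (Fin 4) (Fin 4) (QuadraticAlgebra ℚ_[3] (-1) 0)) =
      Matrix.diagonal d := rfl
  have hA₀U : A₀ ∈ S.U := by
    rw [S.mem_U_iff, hgram, Matrix.mul_one, hA₀, Matrix.diagonal_map (map_zero _), Matrix.diagonal_transpose,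
      Matrix.diagonal_mul_diagonal, ← Matrix.diagonal_one]
    congr 1
    funext k
    fin_cases k <;> simp [d, hS, QuadraticAlgebra.star_mk]
    rfl
  let g₀ : S.U := ⟨A₀, hA₀U⟩
  have hdet₀ : (((detN g₀ : S.normOne) : (QuadraticAlgebra ℚ_[3] (-1) 0)ˣ) : QuadraticAlgebra ℚ_[3] (-1) 0) = ⟨0, 1⟩ := by
    rw [hdetN, Matrix.GeneralLinearGroup.val_det_apply]
    exact hdet_d
  have hg₀ : lam g₀ ≠ 1 := by
    rw [hlam, Ne, hs_one, not_not, hdet₀]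
    change ‖(0 : ℚ_[3])‖ < 1
    simp
  -- `λ = 1` on the open neighbourhood `{‖re det g − 1‖ < 1}` of `1`
  have hopen : ∃ O : Set S.U, IsOpen O ∧ (1 : S.U) ∈ O ∧ ∀ g ∈ O, lam g = 1 := by
    refine ⟨{g : S.U | ‖(((g : GL (Fin 4) (QuadraticAlgebra ℚ_[3] (-1) 0)) :
        Matrix (Fin 4) (Fin 4) (QuadraticAlgebra ℚ_[3] (-1) 0)).det).re - 1‖ < 1}, ?_, ?_, ?_⟩
    · have hc : Continuous fun g : S.U => (((g : GL (Fin 4) (QuadraticAlgebra ℚ_[3] (-1) 0)) :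
          Matrix (Fin 4) (Fin 4) (QuadraticAlgebra ℚ_[3] (-1) 0)).det).re :=
        continuous_re.comp ((Units.continuous_val.comp continuous_subtype_val).matrix_det)
      exact isOpen_lt (continuous_norm.comp (hc.sub continuous_const)) continuous_const
    · change ‖((((1 : S.U) : GL (Fin 4) (QuadraticAlgebra ℚ_[3] (-1) 0)) :
        Matrix (Fin 4) (Fin 4) (QuadraticAlgebra ℚ_[3] (-1) 0)).det).re - 1‖ < 1
      simp [QuadraticAlgebra.re_one]
    · intro g hg
      have hg' : ‖(((g : GL (Fin 4) (QuadraticAlgebra ℚ_[3] (-1) 0)) :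
          Matrix (Fin 4) (Fin 4) (QuadraticAlgebra ℚ_[3] (-1) 0)).det).re - 1‖ < 1 := hg
      rw [hlam, hs_one, hdetN, Matrix.GeneralLinearGroup.val_det_apply]
      intro hlt
      have key := Padic.nonarchimedean
        ((((g : GL (Fin 4) (QuadraticAlgebra ℚ_[3] (-1) 0)) : Matrix (Fin 4) (Fin 4) (QuadraticAlgebra ℚ_[3] (-1) 0)).det).re)
        (-((((g : GL (Fin 4) (QuadraticAlgebra ℚ_[3] (-1) 0)) :
          Matrix (Fin 4) (Fin 4) (QuadraticAlgebra ℚ_[3] (-1) 0)).det).re - 1))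
      have h1 : (((g : GL (Fin 4) (QuadraticAlgebra ℚ_[3] (-1) 0)) :
            Matrix (Fin 4) (Fin 4) (QuadraticAlgebra ℚ_[3] (-1) 0)).det).re +
          -((((g : GL (Fin 4) (QuadraticAlgebra ℚ_[3] (-1) 0)) :
            Matrix (Fin 4) (Fin 4) (QuadraticAlgebra ℚ_[3] (-1) 0)).det).re - 1) = 1 := by ring
      rw [h1, norm_one, norm_neg] at key
      exact absurd (max_lt hlt hg') (not_lt.2 key)
  -- the carriers: the lines `1` and `λ`
  let ω₀ : Representation ℂ S.U ℂ := Representation.trivial ℂ S.U ℂ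
  let ω₁ : Representation ℂ S.U ℂ := (DistribMulAction.toModuleEnd ℂ ℂ).comp lam
  have hω₀ : ∀ (g : S.U) (x : ℂ), ω₀ g x = ((1 : S.U →* ℂˣ) g : ℂ) * x := fun g x => by
    rw [MonoidHom.one_apply, Units.val_one, one_mul]; rfl
  have hω₁ : ∀ (g : S.U) (x : ℂ), ω₁ g x = (lam g : ℂ) * x := fun g x => by
    change (lam g : ℂˣ) • x = _
    rw [Units.smul_def, smul_eq_mul]
  -- the collection
  let Lf : LemD1IndexedFamily ℚ_[3] (QuadraticAlgebra ℚ_[3] (-1) 0) 4 (Fin 3) :=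
    { isNonarchimedeanLocalField := Literature.NumberTheory.GaloisRepresentations.Padic.isNonarchimedeanLocalField_holds 3
      isModuleTopology := inferInstance
      S := S
      mu := fun _ => μ
      eps := ![eb 1 one_ne_zero, eb 3 h3, eb (-1) hm1]
      chi := fun _ => χ
      V := fun _ => ℂ
      omega := ![ω₀, ω₁, ω₀] }
  -- Lemma D.1, first sentence + (1), member by member (rank `4 ≠ 2`)
  have hItem1 : Lf.Item1AsPrinted := by
    intro i
    fin_cases i
    · exact lemD1_1AsPrinted_of_character_of_rank_ne_two (Lf.single 0) 1 hω₀ hcen1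
        ⟨Set.univ, isOpen_univ, Set.mem_univ _, fun g _ => rfl⟩ (by norm_num)
    · exact lemD1_1AsPrinted_of_character_of_rank_ne_two (Lf.single 1) lam hω₁ hcenχ hopen (by norm_num)
    · exact lemD1_1AsPrinted_of_character_of_rank_ne_two (Lf.single 2) 1 hω₀ hcen1
        ⟨Set.univ, isOpen_univ, Set.mem_univ _, fun g _ => rfl⟩ (by norm_num)
  -- the isomorphism pattern of the three quotients
  have hN₀ : augmentation ω₀ S.scalar χ.1 = ⊥ := augmentation_eq_bot_of_character ω₀ S.scalar χ.1 1 hω₀ hcen1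
  have hN₁ : augmentation ω₁ S.scalar χ.1 = ⊥ := augmentation_eq_bot_of_character ω₁ S.scalar χ.1 lam hω₁ hcenχ
  have hiso10 : ¬ AreIsomorphicRep (Lf.quot 1) (Lf.quot 0) := fun h => hg₀ (by
    have key := (areIsomorphicRep_quotRep_iff_of_character ω₁ ω₀ S.scalar_mem_center χ.1 χ.1 lam 1 hω₁ hω₀ hN₁ hN₀).1 h
    rw [key, MonoidHom.one_apply])
  have hiso20 : AreIsomorphicRep (Lf.quot 2) (Lf.quot 0) :=
    (areIsomorphicRep_quotRep_iff_of_character ω₀ ω₀ S.scalar_mem_center χ.1 χ.1 1 1 hω₀ hω₀ hN₀ hN₀).2 rfl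
  have hiso21 : ¬ AreIsomorphicRep (Lf.quot 2) (Lf.quot 1) := fun h => hiso10 (h.symm.trans hiso20)
  -- Lemma D.1 (3), all nine pairs
  have hrefl : ∀ k : Fin 3, AreIsomorphicRep (Lf.quot k) (Lf.quot k) ↔
      (Lf.mu k = Lf.mu k ∧ LemD1.SameClass (Lf.eps k) (Lf.eps k) ∧ Lf.chi k = Lf.chi k) :=
    fun k => iff_of_true (AreIsomorphicRep.refl _) ⟨rfl, LemD1.SameClass.refl _, rfl⟩
  have hItem3 : LemD1_3AsPrintedI Lf := by
    intro _ i j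
    fin_cases i <;> fin_cases j
    · exact hrefl 0
    · exact iff_of_false hiso10 fun h => h01 h.2.1
    · exact iff_of_true hiso20 ⟨rfl, h02, rfl⟩
    · exact iff_of_false (fun h => hiso10 h.symm) fun h => h01 h.2.1.symm
    · exact hrefl 1
    · exact iff_of_false hiso21 fun h => h12 h.2.1
    · exact iff_of_true hiso20.symm ⟨rfl, h02.symm, rfl⟩
    · exact iff_of_false (fun h => hiso21 h.symm) fun h => h12 h.2.1.symm
    · exact hrefl 2
  exact ⟨Lf, isField, hS, hgram, hItem1, hItem3, fun _ _ => rfl, fun _ _ => rfl, ⟨h01, hiso10⟩,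
    ⟨h2neg, h20, h02, hiso20⟩, ⟨h12, hiso21⟩⟩

/-- **Consequence**: at a FIELD datum the two printed records do not, by their shape, force all Step-1 representatives into
ONE class of `E^{−×}/Nm E^×` (contrast: at a split datum all representatives ARE in one class —
`LemD1.sameClass_of_splitData` — so the `ε`-conjunct of (3) is idle there). [cite: Liu2021, App. D Lemma D.1 (3) (l. 5233)] -/
theorem not_forall_sameClass_of_item1AsPrinted_of_lemD1_3AsPrintedI :
    ¬ ∀ Lf : LemD1IndexedFamily ℚ_[3] (QuadraticAlgebra ℚ_[3] (-1) 0) 4 (Fin 3),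
        Lf.Item1AsPrinted → LemD1_3AsPrintedI Lf → ∀ i j : Fin 3, LemD1.SameClass (Lf.eps i) (Lf.eps j) := by
  intro h
  obtain ⟨Lf, -, -, -, h1, h3, -, -, ⟨h01, -⟩, -⟩ := exists_lemD1IndexedFamily_nonsplit
  exact h01 (h Lf h1 h3 0 1)

/-- **Consequence**: nor do they force «isomorphic ⇒ equal representatives» — the representative-level reading of «`ε' = ε`»
is refuted at a field datum as well (members `0, 2`: `ε₂ = −ε₀ ≠ ε₀`, same class, isomorphic quotients); the printed equality
is equality in `E^{−×}/Nm_{E/F} E^×` (READING L3′). [cite: Liu2021, App. D Lemma D.1 (3) (l. 5233)] -/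
theorem not_forall_eps_eq_of_areIsomorphicRep_of_lemD1_3AsPrintedI :
    ¬ ∀ Lf : LemD1IndexedFamily ℚ_[3] (QuadraticAlgebra ℚ_[3] (-1) 0) 4 (Fin 3),
        Lf.Item1AsPrinted → LemD1_3AsPrintedI Lf →
          ∀ i j : Fin 3, AreIsomorphicRep (Lf.quot j) (Lf.quot i) → Lf.eps j = Lf.eps i := by
  intro h
  obtain ⟨Lf, -, -, -, h1, h3, -, -, -, ⟨-, hne, -, hiso⟩, -⟩ := exists_lemD1IndexedFamily_nonsplit
  exact hne (h Lf h1 h3 0 2 hiso)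

/-- **Consequence (T5-style consistency, our bookkeeping)**: no contradiction is derivable from
`(h₁ : Lf.Item1AsPrinted) (h₃ : LemD1_3AsPrintedI Lf)` together with «two members with the SAME `μ` and `χ` whose
representatives `ε` lie in DIFFERENT classes» — a model exists (in which, as (3) then demands, the two quotients are
non-isomorphic, in both orientations). [cite: Liu2021, App. D Lemma D.1 (3) (l. 5233)] -/
theorem exists_item1AsPrinted_and_lemD1_3AsPrintedI_and_not_sameClass :
    ∃ Lf : LemD1IndexedFamily ℚ_[3] (QuadraticAlgebra ℚ_[3] (-1) 0) 4 (Fin 3),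
      Lf.Item1AsPrinted ∧ LemD1_3AsPrintedI Lf ∧ Lf.mu 0 = Lf.mu 1 ∧ Lf.chi 0 = Lf.chi 1 ∧
        ¬ LemD1.SameClass (Lf.eps 0) (Lf.eps 1) ∧ ¬ LemD1.SameClass (Lf.eps 1) (Lf.eps 0) ∧
        ¬ AreIsomorphicRep (Lf.quot 1) (Lf.quot 0) ∧ ¬ AreIsomorphicRep (Lf.quot 0) (Lf.quot 1) := by
  obtain ⟨Lf, -, -, -, h1, h3, hμ, hχ, ⟨h01, hiso⟩, -⟩ := exists_lemD1IndexedFamily_nonsplit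
  exact ⟨Lf, h1, h3, hμ 0 1, hχ 0 1, h01, fun h => h01 h.symm, hiso, fun h => hiso h.symm⟩

end Certificate

/-! ## §6 Closed form: the module topology of `ℚ₃(i)` discharges the topological instance hypotheses of §5 -/

/-- **Closed form of the certificate** (no instance hypotheses left): give `E = ℚ₃(i)` its module topology over `ℚ₃`
(Mathlib `moduleTopology`; `E` is then a topological ring, `IsModuleTopology.isTopologicalRing`) — exactly what the records'
field `isModuleTopology` demands —; the collection of `exists_lemD1IndexedFamily_nonsplit` exists for it, so the hypotheses
of §5 are met and nothing above is vacuous. [cite: Liu2021, App. D Lemma D.1 (1) (l. 5229) and (3) (l. 5233)] -/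
theorem exists_lemD1IndexedFamily_nonsplit_moduleTopology :
    letI : TopologicalSpace (QuadraticAlgebra ℚ_[3] (-1) 0) := moduleTopology ℚ_[3] (QuadraticAlgebra ℚ_[3] (-1) 0)
    haveI : IsModuleTopology ℚ_[3] (QuadraticAlgebra ℚ_[3] (-1) 0) := ⟨rfl⟩
    haveI : IsTopologicalRing (QuadraticAlgebra ℚ_[3] (-1) 0) :=
      IsModuleTopology.isTopologicalRing ℚ_[3] (QuadraticAlgebra ℚ_[3] (-1) 0)
    ∃ Lf : LemD1IndexedFamily ℚ_[3] (QuadraticAlgebra ℚ_[3] (-1) 0) 4 (Fin 3),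
      IsField (QuadraticAlgebra ℚ_[3] (-1) 0) ∧ Lf.Item1AsPrinted ∧ LemD1_3AsPrintedI Lf ∧
        Lf.mu 0 = Lf.mu 1 ∧ Lf.chi 0 = Lf.chi 1 ∧
        ¬ LemD1.SameClass (Lf.eps 0) (Lf.eps 1) ∧ ¬ AreIsomorphicRep (Lf.quot 1) (Lf.quot 0) := by
  letI : TopologicalSpace (QuadraticAlgebra ℚ_[3] (-1) 0) := moduleTopology ℚ_[3] (QuadraticAlgebra ℚ_[3] (-1) 0)
  haveI : IsModuleTopology ℚ_[3] (QuadraticAlgebra ℚ_[3] (-1) 0) := ⟨rfl⟩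
  haveI : IsTopologicalRing (QuadraticAlgebra ℚ_[3] (-1) 0) :=
    IsModuleTopology.isTopologicalRing ℚ_[3] (QuadraticAlgebra ℚ_[3] (-1) 0)
  obtain ⟨Lf, hF, -, -, h1, h3, hμ, hχ, ⟨h01, hiso⟩, -⟩ := exists_lemD1IndexedFamily_nonsplit
  exact ⟨Lf, hF, h1, h3, hμ 0 1, hχ 0 1, h01, hiso⟩

/-! ## §7 (v2) The same non-split place at the rows' rank `n = 3`: two `ε`-classes among the members of a model of
«(1) ∧ (3)» (here the member in the other class also carries another `χ`, since `s ∘ det` has central character `s` at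
`n = 3`) -/

section RankThree

variable [TopologicalSpace (QuadraticAlgebra ℚ_[3] (-1) 0)] [IsTopologicalRing (QuadraticAlgebra ℚ_[3] (-1) 0)]
  [IsModuleTopology ℚ_[3] (QuadraticAlgebra ℚ_[3] (-1) 0)]

/-- **Rank `n = 3` at the non-split place** (the Hodge/CM cells' rank): over `F = ℚ₃`, `E = ℚ₃(i)` (a FIELD), Gram matrix
`1` of rank `3`, there is a three-member collection with ONE Step-2 character `μ`, representatives `ε₀ = i`, `ε₁ = 3i`,
`ε₂ = −i`, Step-3 characters `χ₀ = χ₂ = 1`, `χ₁ = s` (the sign character of `E¹`), carriers `1`, `s ∘ det` (central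
character `s(z³) = s(z)`), `1`, satisfying `Item1AsPrinted` (lines, non-zero although «`E` is a field» holds — (1)'s right
side fails through «`n = 2`») ∧ `LemD1_3AsPrintedI` (all nine pairs), in which members `0, 1` lie in DIFFERENT classes of
`E^{−×}/Nm E^×` (and carry different `χ`) with non-isomorphic quotients, and members `0, 2` have `ε₂ = −ε₀ ≠ ε₀`, same
class, same labels, isomorphic quotients.  (At `n = 3` a character line trivial on the centre cannot separate the two
classes with `χ` fixed — `s(z³) = s(z)` —, which is why §5 uses `n = 4` for the `ε`-ISOLATED certificate.)
[cite: Liu2021, App. D Lemma D.1 (1) (l. 5229) and (3) (l. 5233)] -/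
theorem exists_lemD1IndexedFamily_nonsplit_rank_three :
    ∃ Lf : LemD1IndexedFamily ℚ_[3] (QuadraticAlgebra ℚ_[3] (-1) 0) 3 (Fin 3),
      IsField (QuadraticAlgebra ℚ_[3] (-1) 0) ∧ (∀ x, Lf.S.conj x = star x) ∧ Lf.S.gram = 1 ∧
      Lf.Item1AsPrinted ∧ LemD1_3AsPrintedI Lf ∧ (∀ i j, Lf.mu i = Lf.mu j) ∧
      (¬ LemD1.SameClass (Lf.eps 0) (Lf.eps 1) ∧ Lf.chi 0 ≠ Lf.chi 1 ∧ ¬ AreIsomorphicRep (Lf.quot 1) (Lf.quot 0)) ∧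
      (Lf.eps 2 = LemD1.epsNeg (Lf.eps 0) ∧ Lf.eps 2 ≠ Lf.eps 0 ∧ LemD1.SameClass (Lf.eps 0) (Lf.eps 2) ∧
        Lf.chi 0 = Lf.chi 2 ∧ AreIsomorphicRep (Lf.quot 2) (Lf.quot 0)) ∧
      (¬ LemD1.SameClass (Lf.eps 1) (Lf.eps 2) ∧ ¬ AreIsomorphicRep (Lf.quot 2) (Lf.quot 1)) := by
  classical
  haveI hF : Fact (∀ r : ℚ_[3], r ^ 2 ≠ -1 + 0 * r) := ⟨sq_ne_neg_one⟩
  obtain ⟨S, hS, hgram⟩ := exists_standingData 3 (by norm_num)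
  obtain ⟨μ⟩ := nonempty_muSet (S := S) hS
  obtain ⟨s, hs_norm, hs_cont, hs_sq, hs_one⟩ := exists_signChar (S := S) hS
  obtain ⟨detN, hdetN⟩ := exists_detNormOne (S := S) hgram
  -- Step 3: `χ = 1` and `χ = s`
  let χ₁ : LemD1.ChiSet S := ⟨1, fun z => by simp, by simpa using continuous_const⟩
  let χs : LemD1.ChiSet S := ⟨s, hs_norm, hs_cont⟩
  -- Step 1: the representatives `b i`
  have hskew : ∀ b : ℚ_[3], (⟨0, b⟩ : QuadraticAlgebra ℚ_[3] (-1) 0) ∈ S.skew := fun b => by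
    rw [S.mem_skew_iff, hS, QuadraticAlgebra.star_mk]
    ext <;> simp
  have hne : ∀ b : ℚ_[3], b ≠ 0 → (⟨0, b⟩ : QuadraticAlgebra ℚ_[3] (-1) 0) ≠ 0 := fun b hb h =>
    hb (by simpa using congrArg QuadraticAlgebra.im h)
  let eb : ∀ b : ℚ_[3], b ≠ 0 → LemD1.EpsRep S := fun b hb =>
    ⟨Units.mk0 _ (hne b hb), by rw [Units.val_mk0]; exact hskew b⟩
  have heb_im : ∀ b hb, (((eb b hb).1 : (QuadraticAlgebra ℚ_[3] (-1) 0)ˣ) : QuadraticAlgebra ℚ_[3] (-1) 0).im = b :=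
    fun b hb => rfl
  have h3 : (3 : ℚ_[3]) ≠ 0 := by norm_num
  have hm1 : (-1 : ℚ_[3]) ≠ 0 := by norm_num
  have hv1 : (1 : ℚ_[3]).valuation = 0 := Padic.valuation_one
  have hv3 : (3 : ℚ_[3]).valuation = 1 := by
    rw [Padic.valuation_ofNat]
    simp
  have hvm1 : (-1 : ℚ_[3]).valuation = 0 :=
    (valuation_eq_of_norm_eq hm1 one_ne_zero (by rw [norm_neg])).trans hv1
  have h01 : ¬ LemD1.SameClass (eb 1 one_ne_zero) (eb 3 h3) := by
    rw [sameClass_iff hS, heb_im 1 one_ne_zero, heb_im 3 h3, hv1, hv3]; decide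
  have h02 : LemD1.SameClass (eb 1 one_ne_zero) (eb (-1) hm1) := by
    rw [sameClass_iff hS, heb_im 1 one_ne_zero, heb_im (-1) hm1, hv1, hvm1]; decide
  have h12 : ¬ LemD1.SameClass (eb 3 h3) (eb (-1) hm1) := by
    rw [sameClass_iff hS, heb_im 3 h3, heb_im (-1) hm1, hv3, hvm1]; decide
  have h20 : eb (-1) hm1 ≠ eb 1 one_ne_zero := fun h => by
    have := congrArg (fun e : LemD1.EpsRep S =>
      (((e.1 : (QuadraticAlgebra ℚ_[3] (-1) 0)ˣ)) : QuadraticAlgebra ℚ_[3] (-1) 0).im) h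
    simp only [heb_im] at this
    norm_num at this
  have h2neg : eb (-1) hm1 = LemD1.epsNeg (eb 1 one_ne_zero) := by
    apply Subtype.ext
    apply Units.ext
    change (⟨0, -1⟩ : QuadraticAlgebra ℚ_[3] (-1) 0) = -⟨0, 1⟩
    ext <;> simp
  -- the unit `i ∈ E¹`, where `s(i) = −1`: so `χ = s ≠ 1`
  have hωne : (⟨0, 1⟩ : QuadraticAlgebra ℚ_[3] (-1) 0) ≠ 0 := hne 1 one_ne_zero
  have hi1 : Units.mk0 (⟨0, 1⟩ : QuadraticAlgebra ℚ_[3] (-1) 0) hωne ∈ S.normOne := by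
    rw [S.mem_normOne_iff', Units.val_mk0, hS, QuadraticAlgebra.star_mk]
    ext <;> simp [QuadraticAlgebra.re_one, QuadraticAlgebra.im_one]
  have hsi : s ⟨_, hi1⟩ ≠ 1 := by
    rw [Ne, hs_one, not_not]
    change ‖(0 : ℚ_[3])‖ < 1
    simp
  have hχne : χ₁ ≠ χs := fun h => hsi (by
    have := congrArg (fun χ : LemD1.ChiSet S => χ.1 ⟨_, hi1⟩) h
    exact this.symm.trans (MonoidHom.one_apply _))
  -- the characters `1` and `λ = s ∘ det`; at rank 3 the centre acts through `s(z³) = s(z)`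
  let lam : S.U →* ℂˣ := s.comp detN
  have hlam : ∀ g, lam g = s (detN g) := fun g => rfl
  have hcen : ∀ z : S.normOne, lam (S.scalar z) = χs.1 z := by
    intro z
    have hd : detN (S.scalar z) = z ^ 3 := by
      apply Subtype.ext
      rw [hdetN]
      apply Units.ext
      rw [Matrix.GeneralLinearGroup.val_det_apply, SubgroupClass.coe_pow, Units.val_pow_eq_pow_val]
      change (Matrix.scalar (Fin 3) (((z : (QuadraticAlgebra ℚ_[3] (-1) 0)ˣ)) : QuadraticAlgebra ℚ_[3] (-1) 0)).det = _
      simp [Matrix.scalar_apply, Matrix.det_diagonal, Finset.prod_const]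
    rw [hlam, hd, map_pow]
    change s z ^ 3 = s z
    rw [pow_succ, pow_two, hs_sq, one_mul]
  have hcen1 : ∀ z : S.normOne, (1 : S.U →* ℂˣ) (S.scalar z) = χ₁.1 z := fun z => rfl
  -- the witness `g₀ = diag(i, 1, 1) ∈ U(V)(F)` with `λ g₀ = s(i) = −1`
  let d : Fin 3 → QuadraticAlgebra ℚ_[3] (-1) 0 := ![⟨0, 1⟩, 1, 1]
  have hdet_d : (Matrix.diagonal d).det = ⟨0, 1⟩ := by
    simp [Matrix.det_diagonal, Fin.prod_univ_three, d]
  have hA₀det : (Matrix.diagonal d).det ≠ 0 := by rw [hdet_d]; exact hωne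
  let A₀ : GL (Fin 3) (QuadraticAlgebra ℚ_[3] (-1) 0) := Matrix.GeneralLinearGroup.mkOfDetNeZero _ hA₀det
  have hA₀ : ((A₀ : GL (Fin 3) (QuadraticAlgebra ℚ_[3] (-1) 0)) : Matrix (Fin 3) (Fin 3) (QuadraticAlgebra ℚ_[3] (-1) 0)) =
      Matrix.diagonal d := rfl
  have hA₀U : A₀ ∈ S.U := by
    rw [S.mem_U_iff, hgram, Matrix.mul_one, hA₀, Matrix.diagonal_map (map_zero _), Matrix.diagonal_transpose,
      Matrix.diagonal_mul_diagonal, ← Matrix.diagonal_one]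
    congr 1
    funext k
    fin_cases k <;> simp [d, hS, QuadraticAlgebra.star_mk]
    rfl
  let g₀ : S.U := ⟨A₀, hA₀U⟩
  have hdet₀ : (((detN g₀ : S.normOne) : (QuadraticAlgebra ℚ_[3] (-1) 0)ˣ) : QuadraticAlgebra ℚ_[3] (-1) 0) = ⟨0, 1⟩ := by
    rw [hdetN, Matrix.GeneralLinearGroup.val_det_apply]
    exact hdet_d
  have hg₀ : lam g₀ ≠ 1 := by
    rw [hlam, Ne, hs_one, not_not, hdet₀]
    change ‖(0 : ℚ_[3])‖ < 1
    simp
  -- `λ = 1` on the open neighbourhood `{‖re det g − 1‖ < 1}` of `1`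
  have hopen : ∃ O : Set S.U, IsOpen O ∧ (1 : S.U) ∈ O ∧ ∀ g ∈ O, lam g = 1 := by
    refine ⟨{g : S.U | ‖(((g : GL (Fin 3) (QuadraticAlgebra ℚ_[3] (-1) 0)) :
        Matrix (Fin 3) (Fin 3) (QuadraticAlgebra ℚ_[3] (-1) 0)).det).re - 1‖ < 1}, ?_, ?_, ?_⟩
    · have hc : Continuous fun g : S.U => (((g : GL (Fin 3) (QuadraticAlgebra ℚ_[3] (-1) 0)) :
          Matrix (Fin 3) (Fin 3) (QuadraticAlgebra ℚ_[3] (-1) 0)).det).re :=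
        continuous_re.comp ((Units.continuous_val.comp continuous_subtype_val).matrix_det)
      exact isOpen_lt (continuous_norm.comp (hc.sub continuous_const)) continuous_const
    · change ‖((((1 : S.U) : GL (Fin 3) (QuadraticAlgebra ℚ_[3] (-1) 0)) :
        Matrix (Fin 3) (Fin 3) (QuadraticAlgebra ℚ_[3] (-1) 0)).det).re - 1‖ < 1
      simp [QuadraticAlgebra.re_one]
    · intro g hg
      have hg' : ‖(((g : GL (Fin 3) (QuadraticAlgebra ℚ_[3] (-1) 0)) :
          Matrix (Fin 3) (Fin 3) (QuadraticAlgebra ℚ_[3] (-1) 0)).det).re - 1‖ < 1 := hg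
      rw [hlam, hs_one, hdetN, Matrix.GeneralLinearGroup.val_det_apply]
      intro hlt
      have key := Padic.nonarchimedean
        ((((g : GL (Fin 3) (QuadraticAlgebra ℚ_[3] (-1) 0)) : Matrix (Fin 3) (Fin 3) (QuadraticAlgebra ℚ_[3] (-1) 0)).det).re)
        (-((((g : GL (Fin 3) (QuadraticAlgebra ℚ_[3] (-1) 0)) :
          Matrix (Fin 3) (Fin 3) (QuadraticAlgebra ℚ_[3] (-1) 0)).det).re - 1))
      have h1 : (((g : GL (Fin 3) (QuadraticAlgebra ℚ_[3] (-1) 0)) :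
            Matrix (Fin 3) (Fin 3) (QuadraticAlgebra ℚ_[3] (-1) 0)).det).re +
          -((((g : GL (Fin 3) (QuadraticAlgebra ℚ_[3] (-1) 0)) :
            Matrix (Fin 3) (Fin 3) (QuadraticAlgebra ℚ_[3] (-1) 0)).det).re - 1) = 1 := by ring
      rw [h1, norm_one, norm_neg] at key
      exact absurd (max_lt hlt hg') (not_lt.2 key)
  -- the carriers
  let ω₀ : Representation ℂ S.U ℂ := Representation.trivial ℂ S.U ℂ
  let ω₁ : Representation ℂ S.U ℂ := (DistribMulAction.toModuleEnd ℂ ℂ).comp lam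
  have hω₀ : ∀ (g : S.U) (x : ℂ), ω₀ g x = ((1 : S.U →* ℂˣ) g : ℂ) * x := fun g x => by
    rw [MonoidHom.one_apply, Units.val_one, one_mul]; rfl
  have hω₁ : ∀ (g : S.U) (x : ℂ), ω₁ g x = (lam g : ℂ) * x := fun g x => by
    change (lam g : ℂˣ) • x = _
    rw [Units.smul_def, smul_eq_mul]
  let Lf : LemD1IndexedFamily ℚ_[3] (QuadraticAlgebra ℚ_[3] (-1) 0) 3 (Fin 3) :=
    { isNonarchimedeanLocalField := Literature.NumberTheory.GaloisRepresentations.Padic.isNonarchimedeanLocalField_holds 3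
      isModuleTopology := inferInstance
      S := S
      mu := fun _ => μ
      eps := ![eb 1 one_ne_zero, eb 3 h3, eb (-1) hm1]
      chi := ![χ₁, χs, χ₁]
      V := fun _ => ℂ
      omega := ![ω₀, ω₁, ω₀] }
  have hItem1 : Lf.Item1AsPrinted := by
    intro i
    fin_cases i
    · exact lemD1_1AsPrinted_of_character_of_rank_ne_two (Lf.single 0) 1 hω₀ hcen1
        ⟨Set.univ, isOpen_univ, Set.mem_univ _, fun g _ => rfl⟩ (by norm_num)
    · exact lemD1_1AsPrinted_of_character_of_rank_ne_two (Lf.single 1) lam hω₁ hcen hopen (by norm_num)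
    · exact lemD1_1AsPrinted_of_character_of_rank_ne_two (Lf.single 2) 1 hω₀ hcen1
        ⟨Set.univ, isOpen_univ, Set.mem_univ _, fun g _ => rfl⟩ (by norm_num)
  have hN₀ : augmentation ω₀ S.scalar χ₁.1 = ⊥ := augmentation_eq_bot_of_character ω₀ S.scalar χ₁.1 1 hω₀ hcen1
  have hN₁ : augmentation ω₁ S.scalar χs.1 = ⊥ := augmentation_eq_bot_of_character ω₁ S.scalar χs.1 lam hω₁ hcen
  have hiso10 : ¬ AreIsomorphicRep (Lf.quot 1) (Lf.quot 0) := fun h => hg₀ (by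
    have key := (areIsomorphicRep_quotRep_iff_of_character ω₁ ω₀ S.scalar_mem_center χs.1 χ₁.1 lam 1 hω₁ hω₀
      hN₁ hN₀).1 h
    rw [key, MonoidHom.one_apply])
  have hiso20 : AreIsomorphicRep (Lf.quot 2) (Lf.quot 0) :=
    (areIsomorphicRep_quotRep_iff_of_character ω₀ ω₀ S.scalar_mem_center χ₁.1 χ₁.1 1 1 hω₀ hω₀ hN₀ hN₀).2 rfl
  have hiso21 : ¬ AreIsomorphicRep (Lf.quot 2) (Lf.quot 1) := fun h => hiso10 (h.symm.trans hiso20)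
  have hrefl : ∀ k : Fin 3, AreIsomorphicRep (Lf.quot k) (Lf.quot k) ↔
      (Lf.mu k = Lf.mu k ∧ LemD1.SameClass (Lf.eps k) (Lf.eps k) ∧ Lf.chi k = Lf.chi k) :=
    fun k => iff_of_true (AreIsomorphicRep.refl _) ⟨rfl, LemD1.SameClass.refl _, rfl⟩
  have hItem3 : LemD1_3AsPrintedI Lf := by
    intro _ i j
    fin_cases i <;> fin_cases j
    · exact hrefl 0
    · exact iff_of_false hiso10 fun h => h01 h.2.1
    · exact iff_of_true hiso20 ⟨rfl, h02, rfl⟩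
    · exact iff_of_false (fun h => hiso10 h.symm) fun h => h01 h.2.1.symm
    · exact hrefl 1
    · exact iff_of_false hiso21 fun h => h12 h.2.1
    · exact iff_of_true hiso20.symm ⟨rfl, h02.symm, rfl⟩
    · exact iff_of_false (fun h => hiso21 h.symm) fun h => h12 h.2.1.symm
    · exact hrefl 2
  exact ⟨Lf, isField, hS, hgram, hItem1, hItem3, fun _ _ => rfl, ⟨h01, hχne, hiso10⟩,
    ⟨h2neg, h20, h02, rfl, hiso20⟩, ⟨h12, hiso21⟩⟩

end RankThree

/-! ## §8 (v2) Rank `n = 2` over the field `ℚ₃(i)`: the EXCEPTIONAL CASE of Lemma D.1 (1) — «`E` is a field, `V` is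
anisotropic (in particular `n = 2`), and `χ̌ = μ²`» — exercised with BOTH sides of (1) TRUE (anisotropic binary hermitian space
`diag(1, 3)`, carrier the line `t ∘ det` for the quartic character `t` of `E¹`, whose maximal `χ`-quotient VANISHES), next to
the two contrasts: the same labels with the trivial carrier VIOLATE (1) on `diag(1, 3)`, and SATISFY (1) on the isotropic `1₂` -/

section RankTwo

/-- In `𝔽₃`: the «exponent in `μ₄(𝔽₉)`» of a point of the circle `X² + Y² = 1` — `(±1, 0) ↦ 0, 2`, `(0, ±1) ↦ 1, 3` — is
additive under the multiplication `(x, y)·(u, v) = (x u − y v, x v + y u)` of `𝔽₉ = 𝔽₃(i)`. [folklore] -/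
private theorem zmod3_quartic : ∀ x y u v : ZMod 3, x ^ 2 + y ^ 2 = 1 → u ^ 2 + v ^ 2 = 1 →
    (if x * u - y * v = 1 then (0 : ZMod 4) else if x * u - y * v = 2 then 2 else if x * v + y * u = 1 then 1 else 3) =
      (if x = 1 then (0 : ZMod 4) else if x = 2 then 2 else if y = 1 then 1 else 3) +
        (if u = 1 then (0 : ZMod 4) else if u = 2 then 2 else if v = 1 then 1 else 3) := by
  decide

variable {n : ℕ} {S : OscillatorStandingData ℚ_[3] (QuadraticAlgebra ℚ_[3] (-1) 0) n}

section Topological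

variable [TopologicalSpace (QuadraticAlgebra ℚ_[3] (-1) 0)] [IsModuleTopology ℚ_[3] (QuadraticAlgebra ℚ_[3] (-1) 0)]

/-- **A Step-2 character with `μ² = 1`** (the same `μ = (−1)^{ord_E}` as `nonempty_muSet`, with its order recorded: needed
for the printed clause «`χ̌ = μ²`» at `χ = 1`). [cite: Liu2021, App. D §D.1 Step 2 (l. 5219)] -/
theorem exists_muSet_sq_eq_one (hS : ∀ x, S.conj x = star x) : ∃ μ : LemD1.MuSet S, ∀ x, μ.1 x * μ.1 x = 1 := by
  classical
  have hk : ∀ z : (QuadraticAlgebra ℚ_[3] (-1) 0)ˣ,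
      (z : QuadraticAlgebra ℚ_[3] (-1) 0).norm.valuation = 2 * ((z : QuadraticAlgebra ℚ_[3] (-1) 0).norm.valuation / 2) :=
    fun z => (Int.two_mul_ediv_two_of_even (even_valuation_norm z.ne_zero)).symm
  let f : ℤ →* ℂ := (Int.castRingHom ℂ).toMonoidHom
  have hf : Function.Injective f := Int.cast_injective
  let μ : (QuadraticAlgebra ℚ_[3] (-1) 0)ˣ →* ℂˣ :=
    { toFun := fun z => Units.map f ((z : QuadraticAlgebra ℚ_[3] (-1) 0).norm.valuation / 2).negOnePow
      map_one' := by simp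
      map_mul' := fun z w => by
        have h : ((z * w : (QuadraticAlgebra ℚ_[3] (-1) 0)ˣ) : QuadraticAlgebra ℚ_[3] (-1) 0).norm.valuation / 2 =
            (z : QuadraticAlgebra ℚ_[3] (-1) 0).norm.valuation / 2 +
              (w : QuadraticAlgebra ℚ_[3] (-1) 0).norm.valuation / 2 := by
          have hv : ((z * w : (QuadraticAlgebra ℚ_[3] (-1) 0)ˣ) : QuadraticAlgebra ℚ_[3] (-1) 0).norm.valuation =
              (z : QuadraticAlgebra ℚ_[3] (-1) 0).norm.valuation + (w : QuadraticAlgebra ℚ_[3] (-1) 0).norm.valuation := by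
            rw [Units.val_mul, map_mul, Padic.valuation_mul (norm_ne_zero z.ne_zero) (norm_ne_zero w.ne_zero)]
          have h1 := hk z
          have h2 := hk w
          omega
        simp only [h, Int.negOnePow_add, map_mul] }
  have hμ : ∀ z, μ z = Units.map f ((z : QuadraticAlgebra ℚ_[3] (-1) 0).norm.valuation / 2).negOnePow := fun z => rfl
  have hμval : ∀ z, ((μ z : ℂˣ) : ℂ) =
      (((((z : QuadraticAlgebra ℚ_[3] (-1) 0).norm.valuation / 2).negOnePow : ℤˣ) : ℤ) : ℂ) := fun z => rfl
  refine ⟨⟨μ, fun z => ?_, ?_, fun a => ?_⟩, fun z => ?_⟩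
  · rw [hμval]
    rcases Int.units_eq_one_or ((z : QuadraticAlgebra ℚ_[3] (-1) 0).norm.valuation / 2).negOnePow with h | h <;>
      simp [h]
  · have hc : Continuous fun z : (QuadraticAlgebra ℚ_[3] (-1) 0)ˣ => (z : QuadraticAlgebra ℚ_[3] (-1) 0).norm := by
      have heq : (fun z : (QuadraticAlgebra ℚ_[3] (-1) 0)ˣ => (z : QuadraticAlgebra ℚ_[3] (-1) 0).norm) =
          fun z : (QuadraticAlgebra ℚ_[3] (-1) 0)ˣ =>
            (z : QuadraticAlgebra ℚ_[3] (-1) 0).re ^ 2 + (z : QuadraticAlgebra ℚ_[3] (-1) 0).im ^ 2 :=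
        funext fun z => norm_eq _
      rw [heq]
      exact ((continuous_re.comp Units.continuous_val).pow 2).add ((continuous_im.comp Units.continuous_val).pow 2)
    refine continuous_iff_continuousAt.2 fun z₀ => ?_
    have h0 : (z₀ : QuadraticAlgebra ℚ_[3] (-1) 0).norm ≠ 0 := norm_ne_zero z₀.ne_zero
    have hev : ∀ᶠ z : (QuadraticAlgebra ℚ_[3] (-1) 0)ˣ in nhds z₀, (z : QuadraticAlgebra ℚ_[3] (-1) 0).norm.valuation =
        (z₀ : QuadraticAlgebra ℚ_[3] (-1) 0).norm.valuation := by
      have hball : Metric.ball ((z₀ : QuadraticAlgebra ℚ_[3] (-1) 0).norm) ‖(z₀ : QuadraticAlgebra ℚ_[3] (-1) 0).norm‖ ∈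
          nhds ((z₀ : QuadraticAlgebra ℚ_[3] (-1) 0).norm) :=
        Metric.ball_mem_nhds _ (norm_pos_iff.2 h0)
      filter_upwards [hc.continuousAt.preimage_mem_nhds hball] with z hz
      exact valuation_eq_of_norm_sub_lt h0 (by simpa [dist_eq_norm] using hz)
    refine (continuousAt_const (y := ((μ z₀ : ℂˣ) : ℂ))).congr (hev.mono fun z hz => ?_)
    change ((μ z₀ : ℂˣ) : ℂ) = ((μ z : ℂˣ) : ℂ)
    rw [hμval, hμval, hz]
  · have ha0 : (a : ℚ_[3]) ≠ 0 := a.ne_zero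
    have hnorm : ((Units.map (algebraMap ℚ_[3] (QuadraticAlgebra ℚ_[3] (-1) 0)).toMonoidHom a :
        (QuadraticAlgebra ℚ_[3] (-1) 0)ˣ) : QuadraticAlgebra ℚ_[3] (-1) 0).norm = (a : ℚ_[3]) ^ 2 := by
      rw [Units.coe_map]
      exact QuadraticAlgebra.norm_algebraMap _
    have hR : (∃ x : (QuadraticAlgebra ℚ_[3] (-1) 0)ˣ, (x : QuadraticAlgebra ℚ_[3] (-1) 0) * S.conj x =
        algebraMap ℚ_[3] (QuadraticAlgebra ℚ_[3] (-1) 0) a) ↔ Even (a : ℚ_[3]).valuation := by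
      simp only [hS]
      exact exists_unit_mul_star_eq_iff _ ha0
    rw [hR, hμ, (Units.map_injective hf).eq_iff' (map_one _), Int.negOnePow_eq_one_iff, hnorm, Padic.valuation_pow]
    have h2 : ((2 : ℕ) : ℤ) * (a : ℚ_[3]).valuation / 2 = (a : ℚ_[3]).valuation := by omega
    rw [h2]
  · change μ z * μ z = 1
    rw [hμ, ← map_mul, Int.units_mul_self, map_one]

/-- **The quartic character of `E¹`** at the non-split datum — reduction to `μ₄(𝔽₉)`: for `z = a + b i ∈ E¹` (`a, b ∈ ℤ₃`,
exactly one a unit), `t(z) = I^k` with `k = 0, 2, 1, 3` according as `z ≡ 1, −1, i, −i (mod 3)`.  It is a unitary,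
continuous (locally constant) character with `t(i)² = −1`: the centre `z·1₂` of `U(V)` (rank `2`) acts through `t(z²) = t(z)²`
on the line `t ∘ det`, NON-trivially at `z = i`. [cite: Liu2021, App. D §D.1 Step 3 (l. 5221)] -/
theorem exists_quarticChar (hS : ∀ x, S.conj x = star x) :
    ∃ t : S.normOne →* ℂˣ, (∀ z, ‖((t z : ℂˣ) : ℂ)‖ = 1) ∧ (Continuous fun z : S.normOne => ((t z : ℂˣ) : ℂ)) ∧
      ∀ z : S.normOne, (((z : (QuadraticAlgebra ℚ_[3] (-1) 0)ˣ)) : QuadraticAlgebra ℚ_[3] (-1) 0) = ⟨0, 1⟩ →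
        ((t z * t z : ℂˣ) : ℂ) = -1 := by
  classical
  have hsq : ∀ z : S.normOne, (((z : (QuadraticAlgebra ℚ_[3] (-1) 0)ˣ)) : QuadraticAlgebra ℚ_[3] (-1) 0).re ^ 2 +
      (((z : (QuadraticAlgebra ℚ_[3] (-1) 0)ˣ)) : QuadraticAlgebra ℚ_[3] (-1) 0).im ^ 2 = 1 := fun z => by
    have h := (S.mem_normOne_iff' _).1 z.2
    rw [hS, ← QuadraticAlgebra.algebraMap_norm_eq_mul_star, ← QuadraticAlgebra.C_eq_algebraMap,
      QuadraticAlgebra.C_eq_one_iff, norm_eq] at h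
    exact h
  have hco := fun z : S.normOne => coords_of_sq_add_sq_eq_one (hsq z)
  -- integral coordinates and their reductions
  let A : S.normOne → ℤ_[3] := fun z => ⟨(((z : (QuadraticAlgebra ℚ_[3] (-1) 0)ˣ)) : QuadraticAlgebra ℚ_[3] (-1) 0).re, (hco z).1⟩
  let B : S.normOne → ℤ_[3] := fun z => ⟨(((z : (QuadraticAlgebra ℚ_[3] (-1) 0)ˣ)) : QuadraticAlgebra ℚ_[3] (-1) 0).im, (hco z).2.1⟩
  have hA : ∀ z, ((A z : ℤ_[3]) : ℚ_[3]) = (((z : (QuadraticAlgebra ℚ_[3] (-1) 0)ˣ)) : QuadraticAlgebra ℚ_[3] (-1) 0).re :=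
    fun z => rfl
  have hB : ∀ z, ((B z : ℤ_[3]) : ℚ_[3]) = (((z : (QuadraticAlgebra ℚ_[3] (-1) 0)ˣ)) : QuadraticAlgebra ℚ_[3] (-1) 0).im :=
    fun z => rfl
  have hAB : ∀ z, PadicInt.toZMod (A z) ^ 2 + PadicInt.toZMod (B z) ^ 2 = 1 := fun z => by
    have h : A z ^ 2 + B z ^ 2 = 1 := PadicInt.ext (by push_cast [hA, hB]; exact hsq z)
    have := congrArg PadicInt.toZMod h
    rwa [map_add, map_pow, map_pow, map_one] at this
  have hAmul : ∀ z w, A (z * w) = A z * A w - B z * B w := fun z w => PadicInt.ext (by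
    push_cast [hA, hB]
    change ((((z : (QuadraticAlgebra ℚ_[3] (-1) 0)ˣ) : QuadraticAlgebra ℚ_[3] (-1) 0) *
      ((w : (QuadraticAlgebra ℚ_[3] (-1) 0)ˣ) : QuadraticAlgebra ℚ_[3] (-1) 0))).re = _
    rw [QuadraticAlgebra.re_mul]
    ring)
  have hBmul : ∀ z w, B (z * w) = A z * B w + B z * A w := fun z w => PadicInt.ext (by
    push_cast [hA, hB]
    change ((((z : (QuadraticAlgebra ℚ_[3] (-1) 0)ˣ) : QuadraticAlgebra ℚ_[3] (-1) 0) *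
      ((w : (QuadraticAlgebra ℚ_[3] (-1) 0)ˣ) : QuadraticAlgebra ℚ_[3] (-1) 0))).im = _
    rw [QuadraticAlgebra.im_mul]
    ring)
  -- the exponent in `μ₄(𝔽₉)`
  let T : ZMod 3 → ZMod 3 → ZMod 4 := fun x y => if x = 1 then 0 else if x = 2 then 2 else if y = 1 then 1 else 3
  have hT : ∀ x y, T x y = if x = 1 then 0 else if x = 2 then 2 else if y = 1 then 1 else 3 := fun x y => rfl
  let κ : S.normOne → ZMod 4 := fun z => T (PadicInt.toZMod (A z)) (PadicInt.toZMod (B z))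
  have hκ : ∀ z, κ z = T (PadicInt.toZMod (A z)) (PadicInt.toZMod (B z)) := fun z => rfl
  have hκmul : ∀ z w, κ (z * w) = κ z + κ w := fun z w => by
    rw [hκ, hκ, hκ, hAmul, hBmul, map_sub, map_add, map_mul, map_mul, map_mul, map_mul, hT, hT, hT]
    exact zmod3_quartic _ _ _ _ (hAB z) (hAB w)
  -- the unit `I`
  let uI : ℂˣ := Units.mk0 Complex.I Complex.I_ne_zero
  have huI : ((uI : ℂˣ) : ℂ) = Complex.I := rfl
  have huI4 : uI ^ 4 = 1 := by
    apply Units.ext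
    rw [Units.val_pow_eq_pow_val, huI, show (4 : ℕ) = 2 * 2 from rfl, pow_mul, Complex.I_sq]
    norm_num
  have hpow : ∀ a b : ZMod 4, uI ^ (a + b).val = uI ^ a.val * uI ^ b.val := fun a b => by
    rw [← pow_add, ZMod.val_add]
    conv_rhs => rw [← Nat.div_add_mod (a.val + b.val) 4, pow_add, pow_mul, huI4, one_pow, one_mul]
  have hA1 : A 1 = 1 := PadicInt.ext (by rw [hA]; simp [QuadraticAlgebra.re_one])
  have hB1 : B 1 = 0 := PadicInt.ext (by rw [hB]; simp [QuadraticAlgebra.im_one])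
  let t : S.normOne →* ℂˣ :=
    { toFun := fun z => uI ^ (κ z).val
      map_one' := by
        simp only [hκ, hA1, hB1, map_one, map_zero, hT, if_pos]
        rw [ZMod.val_zero, pow_zero]
      map_mul' := fun z w => by simp only [hκmul, hpow] }
  have ht : ∀ z, t z = uI ^ (κ z).val := fun z => rfl
  have hre_cont : Continuous fun z : S.normOne =>
      (((z : (QuadraticAlgebra ℚ_[3] (-1) 0)ˣ)) : QuadraticAlgebra ℚ_[3] (-1) 0).re :=
    continuous_re.comp (Units.continuous_val.comp continuous_subtype_val)
  have him_cont : Continuous fun z : S.normOne =>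
      (((z : (QuadraticAlgebra ℚ_[3] (-1) 0)ˣ)) : QuadraticAlgebra ℚ_[3] (-1) 0).im :=
    continuous_im.comp (Units.continuous_val.comp continuous_subtype_val)
  -- reductions are locally constant
  have hloc : ∀ (a b : ℤ_[3]), ‖(a : ℚ_[3]) - b‖ < 1 → PadicInt.toZMod a = PadicInt.toZMod b := fun a b h => by
    rw [← sub_eq_zero, ← map_sub, toZMod_eq_zero_iff]
    exact h
  refine ⟨t, fun z => ?_, ?_, fun z hz => ?_⟩
  · rw [ht, Units.val_pow_eq_pow_val, huI, norm_pow, Complex.norm_I, one_pow]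
  · refine IsLocallyConstant.continuous ((IsLocallyConstant.iff_exists_open _).2 fun z => ?_)
    refine ⟨{w | ‖(((w : (QuadraticAlgebra ℚ_[3] (-1) 0)ˣ)) : QuadraticAlgebra ℚ_[3] (-1) 0).re -
        (((z : (QuadraticAlgebra ℚ_[3] (-1) 0)ˣ)) : QuadraticAlgebra ℚ_[3] (-1) 0).re‖ < 1 ∧
        ‖(((w : (QuadraticAlgebra ℚ_[3] (-1) 0)ˣ)) : QuadraticAlgebra ℚ_[3] (-1) 0).im -
        (((z : (QuadraticAlgebra ℚ_[3] (-1) 0)ˣ)) : QuadraticAlgebra ℚ_[3] (-1) 0).im‖ < 1},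
      (isOpen_lt (continuous_norm.comp (hre_cont.sub continuous_const)) continuous_const).inter
        (isOpen_lt (continuous_norm.comp (him_cont.sub continuous_const)) continuous_const), ?_, fun w hw => ?_⟩
    · change ‖_‖ < 1 ∧ ‖_‖ < 1
      rw [sub_self, sub_self, norm_zero]
      exact ⟨one_pos, one_pos⟩
    · obtain ⟨hw1, hw2⟩ := hw
      rw [ht, ht, hκ, hκ, hloc (A w) (A z) hw1, hloc (B w) (B z) hw2]
  · have hAz : A z = 0 := PadicInt.ext (by rw [hA, hz]; rfl)
    have hBz : B z = 1 := PadicInt.ext (by rw [hB, hz]; rfl)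
    have hκz : κ z = 1 := by
      rw [hκ, hAz, hBz, map_zero, map_one, hT]
      decide
    rw [ht, hκz, (by decide : (1 : ZMod 4).val = 1), pow_one, Units.val_mul, huI, Complex.I_mul_I]

end Topological

/-- **The standing data at rank `2` with the ANISOTROPIC Gram matrix `diag(1, 3)`** over `ℚ₃(i)/ℚ₃` (hermitian — its
entries are fixed by `c` —, determinant `3`, a unit of the field `E`). [cite: Liu2021, App. D §D.1 (l. 5213)] -/
theorem exists_standingData_aniso :
    ∃ S : OscillatorStandingData ℚ_[3] (QuadraticAlgebra ℚ_[3] (-1) 0) 2,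
      (∀ x, S.conj x = star x) ∧ S.gram = Matrix.diagonal ![1, 3] := by
  haveI hF : Fact (∀ r : ℚ_[3], r ^ 2 ≠ -1 + 0 * r) := ⟨sq_ne_neg_one⟩
  obtain ⟨S₁, hS₁, -⟩ := exists_standingData 2 le_rfl
  have h3 : ((3 : QuadraticAlgebra ℚ_[3] (-1) 0)) ≠ 0 := fun h => by
    have := congrArg QuadraticAlgebra.re h
    rw [QuadraticAlgebra.re_ofNat, QuadraticAlgebra.re_zero] at this
    norm_num at this
  refine ⟨{ S₁ with
            gram := Matrix.diagonal ![1, 3]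
            gram_hermitian := by
              rw [Matrix.diagonal_map (map_zero _), Matrix.diagonal_transpose]
              congr 1
              funext k
              fin_cases k
              · exact map_one S₁.conj
              · change S₁.conj 3 = 3
                exact map_ofNat S₁.conj 3
            isUnit_det_gram := by
              rw [Matrix.det_diagonal, Fin.prod_univ_two]
              exact isUnit_iff_ne_zero.2 (mul_ne_zero one_ne_zero h3) }, hS₁, rfl⟩

/-- **`diag(1, 3)` is ANISOTROPIC over `ℚ₃(i)`**: `N(x) + 3 N(y) = 0` forces `x = y = 0`, since norms have even `ord₃` and
`ord₃ 3` is odd (READING L2 «anisotropic»: no non-zero `v` with `(v, v)_V = 0`). [cite: Liu2021, App. D Lemma D.1 (1) (l. 5229)] -/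
theorem form_anisotropic_of_gram_diag {S : OscillatorStandingData ℚ_[3] (QuadraticAlgebra ℚ_[3] (-1) 0) 2}
    (hS : ∀ x, S.conj x = star x) (hG : S.gram = Matrix.diagonal ![1, 3])
    (v : Fin 2 → QuadraticAlgebra ℚ_[3] (-1) 0) (hv : S.form v v = 0) : v = 0 := by
  have hkey : ∀ x : QuadraticAlgebra ℚ_[3] (-1) 0, star x * x = ⟨x.norm, 0⟩ := fun x => by
    rw [mul_comm, ← QuadraticAlgebra.algebraMap_norm_eq_mul_star, QuadraticAlgebra.algebraMap_eq]
  have h : star (v 0) * ((1 : QuadraticAlgebra ℚ_[3] (-1) 0) * v 0) + star (v 1) * ((3 : QuadraticAlgebra ℚ_[3] (-1) 0) * v 1) = 0 := by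
    have hv' := hv
    unfold OscillatorStandingData.form Literature.AlgebraicGeometry.ShimuraVarieties.hermForm at hv'
    rw [hG, dotProduct, Fin.sum_univ_two] at hv'
    simp only [Function.comp_apply, Matrix.mulVec_diagonal, OscillatorStandingData.σ_apply, hS,
      Matrix.cons_val_zero, Matrix.cons_val_one] at hv'
    exact hv'
  rw [one_mul, ← mul_assoc, mul_comm (star (v 1)) 3, mul_assoc, hkey, hkey] at h
  have hre := congrArg QuadraticAlgebra.re h
  simp only [QuadraticAlgebra.re_add, QuadraticAlgebra.re_mul, QuadraticAlgebra.re_ofNat, QuadraticAlgebra.im_ofNat,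
    QuadraticAlgebra.re_zero, mul_zero, add_zero] at hre
  -- `hre : N(v 0) + 3 N(v 1) = 0`
  by_cases h1 : v 1 = 0
  · have h0 : (v 0).norm = 0 := by simpa [h1, QuadraticAlgebra.norm_zero] using hre
    have hv0 : v 0 = 0 := not_not.1 fun hne => norm_ne_zero hne h0
    funext i
    fin_cases i
    · exact hv0
    · exact h1
  · exfalso
    have hN1 : (v 1).norm ≠ 0 := norm_ne_zero h1
    have hN0 : (v 0).norm = -3 * (v 1).norm := by linear_combination hre
    have hv0 : v 0 ≠ 0 := fun h0 => by
      rw [h0, QuadraticAlgebra.norm_zero] at hN0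
      exact hN1 (by linear_combination hN0 / 3)
    have he0 := even_valuation_norm hv0
    have he1 := even_valuation_norm h1
    have h3 : (3 : ℚ_[3]) ≠ 0 := by norm_num
    have hv3 : (-3 : ℚ_[3]).valuation = 1 := by
      rw [valuation_eq_of_norm_eq (neg_ne_zero.2 h3) h3 (norm_neg _), Padic.valuation_ofNat]
      simp
    rw [hN0, Padic.valuation_mul (neg_ne_zero.2 h3) hN1, hv3] at he0
    obtain ⟨a, ha⟩ := he0
    obtain ⟨b, hb⟩ := he1
    omega

/-- **`det : U(V)(F) → E¹` for ANY Gram matrix** (the unit `det(gram)` cancels in `det((ḡ)ᵀ · gram · g) = det gram`);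
`exists_detNormOne` is the case `gram = 1`. [cite: Liu2021, App. D §D.1 (l. 5213)] -/
theorem exists_detNormOne' :
    ∃ d : S.U →* S.normOne, ∀ g : S.U, ((d g : S.normOne) : (QuadraticAlgebra ℚ_[3] (-1) 0)ˣ) =
      Matrix.GeneralLinearGroup.det (g : GL (Fin n) (QuadraticAlgebra ℚ_[3] (-1) 0)) := by
  have hmem : ∀ g : S.U,
      Matrix.GeneralLinearGroup.det (g : GL (Fin n) (QuadraticAlgebra ℚ_[3] (-1) 0)) ∈ S.normOne := by
    intro g
    rw [S.mem_normOne_iff', Matrix.GeneralLinearGroup.val_det_apply]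
    have h := (S.mem_U_iff _).1 g.2
    have hd := congrArg Matrix.det h
    rw [Matrix.det_mul, Matrix.det_mul, Matrix.det_transpose, ← AlgEquiv.mapMatrix_apply, ← AlgEquiv.map_det,
      mul_right_comm] at hd
    have hd' := (S.isUnit_det_gram.mul_left_inj).1 (hd.trans (one_mul _).symm)
    rw [mul_comm]
    exact hd'
  exact ⟨MonoidHom.codRestrict ((Matrix.GeneralLinearGroup.det).comp S.U.subtype) S.normOne hmem, fun g => rfl⟩

section Data

variable [TopologicalSpace (QuadraticAlgebra ℚ_[3] (-1) 0)] [IsTopologicalRing (QuadraticAlgebra ℚ_[3] (-1) 0)]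
  [IsModuleTopology ℚ_[3] (QuadraticAlgebra ℚ_[3] (-1) 0)]

omit [IsModuleTopology ℚ_[3] (QuadraticAlgebra ℚ_[3] (-1) 0)] in
/-- Item (1) AS PRINTED at a character datum (character locally constant, agreeing with `χ` on the centre) whose printed
right-hand side «`E` is a field, `V` is anisotropic (in particular `n = 2`), and `χ̌ = μ²`» is FALSE for whatever reason —
here it will be «`V` is anisotropic» that fails. [cite: Liu2021, App. D Lemma D.1 (1) (l. 5229)] -/
theorem lemD1_1AsPrinted_of_character_of_not_exceptional
    (L : LemD1Data ℚ_[3] (QuadraticAlgebra ℚ_[3] (-1) 0) n ℂ) (lam : L.S.U →* ℂˣ)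
    (hω : ∀ (g : L.S.U) (x : ℂ), L.omega g x = (lam g : ℂ) * x)
    (hcen : ∀ z : L.S.normOne, lam (L.S.scalar z) = L.chi z)
    (hopen : ∃ O : Set L.S.U, IsOpen O ∧ (1 : L.S.U) ∈ O ∧ ∀ g ∈ O, lam g = 1)
    (hR : ¬ (IsField (QuadraticAlgebra ℚ_[3] (-1) 0) ∧ (L.IsAnisotropic ∧ n = 2) ∧
      ∀ x : (QuadraticAlgebra ℚ_[3] (-1) 0)ˣ, L.S.check L.chi x = L.mu x ^ 2)) :
    LemD1_1AsPrinted L := by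
  have hN : augmentation L.omega L.S.scalar L.chi = ⊥ :=
    augmentation_eq_bot_of_character L.omega L.S.scalar L.chi lam hω hcen
  have hfin : Module.finrank ℂ (ℂ ⧸ augmentation L.omega L.S.scalar L.chi) = 1 := by
    rw [(Submodule.quotEquivOfEqBot _ hN).finrank_eq, Module.finrank_self]
  haveI hsimple : IsSimpleModule ℂ (ℂ ⧸ augmentation L.omega L.S.scalar L.chi) :=
    isSimpleModule_iff_finrank_eq_one.2 hfin
  have hact : ∀ (g : L.S.U) (w : ℂ ⧸ augmentation L.omega L.S.scalar L.chi),
      L.datum.quot g w = (lam g : ℂ) • w := by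
    intro g w
    obtain ⟨y, rfl⟩ := Submodule.Quotient.mk_surjective _ w
    rw [LemD1Data.datum_quot, quotRep_mk, hω, ← smul_eq_mul, Submodule.Quotient.mk_smul]
  refine ⟨⟨?_, ?_, ?_⟩, ?_⟩
  · intro W
    rcases eq_bot_or_eq_top W.toSubmodule with h | h
    · exact Or.inl (Subrepresentation.toSubmodule_injective h)
    · exact Or.inr (Subrepresentation.toSubmodule_injective h)
  · intro x
    obtain ⟨O, hO, h1O, hlam⟩ := hopen
    change IsOpen (L.datum.quot.stabilizerSubgroup x : Set L.S.U)
    refine Subgroup.isOpen_of_mem_nhds _ (g := 1) (Filter.mem_of_superset (hO.mem_nhds h1O) fun g hg => ?_)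
    change L.datum.quot g x = x
    rw [hact, hlam g hg, Units.val_one, one_smul]
  · intro K _
    infer_instance
  · refine iff_of_false ?_ hR
    rw [not_subsingleton_iff_nontrivial]
    exact Module.nontrivial_of_finrank_pos (R := ℂ) (by rw [hfin]; exact one_pos)

omit [IsTopologicalRing (QuadraticAlgebra ℚ_[3] (-1) 0)] in
/-- **THE EXCEPTIONAL CASE OF LEMMA D.1 (1), EXERCISED WITH BOTH SIDES TRUE** (in-kernel certificate, our bookkeeping):
over `F = ℚ₃`, `E = ℚ₃(i)` — a FIELD —, the ANISOTROPIC binary hermitian space `(E², diag(1, 3))` (`n = 2`), `ε = i`, the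
Step-2 character `μ = (−1)^{ord_E}` (`μ² = 1`), `χ = 1` (so «`χ̌ = μ²`» reads `1 = 1`), and the ⟨CARRIER⟩ line `t ∘ det` (`t` the
quartic character of `E¹`): the centre `i·1₂` acts on the carrier by `t(i²) = −1 ≠ χ(i) = 1`, so the maximal `χ`-quotient
`ω(μ, ε, χ)` is the ZERO space — and `LemD1_1AsPrinted` HOLDS: «irreducible and admissible» on the zero space, and the
printed equivalence (1) with its left side («is zero») TRUE and its right side («`E` is a field, `V` is anisotropic (in
particular `n = 2`), and `χ̌ = μ²`») TRUE, conjunct by conjunct.  No split datum and no datum of rank `≠ 2` can exercise this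
row of the truth table. [cite: Liu2021, App. D Lemma D.1 (1) (l. 5229)] -/
theorem exists_lemD1Data_exceptional :
    ∃ L : LemD1Data ℚ_[3] (QuadraticAlgebra ℚ_[3] (-1) 0) 2 ℂ,
      (∀ x, L.S.conj x = star x) ∧ L.S.gram = Matrix.diagonal ![1, 3] ∧
      LemD1_1AsPrinted L ∧
      Subsingleton (ℂ ⧸ augmentation L.omega L.S.scalar L.chi) ∧
      (IsField (QuadraticAlgebra ℚ_[3] (-1) 0) ∧ L.IsAnisotropic ∧
        ∀ x : (QuadraticAlgebra ℚ_[3] (-1) 0)ˣ, L.S.check L.chi x = L.mu x ^ 2) ∧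
      ∃ z : L.S.normOne, L.omega (L.S.scalar z) 1 = -1 := by
  classical
  haveI hF : Fact (∀ r : ℚ_[3], r ^ 2 ≠ -1 + 0 * r) := ⟨sq_ne_neg_one⟩
  obtain ⟨S, hS, hG⟩ := exists_standingData_aniso
  obtain ⟨μ, hμsq⟩ := exists_muSet_sq_eq_one (S := S) hS
  obtain ⟨t, -, -, ht_i⟩ := exists_quarticChar (S := S) hS
  obtain ⟨detN, hdetN⟩ := exists_detNormOne' (S := S)
  -- `ε = i`, and `i ∈ E¹`
  have hωne : (⟨0, 1⟩ : QuadraticAlgebra ℚ_[3] (-1) 0) ≠ 0 := fun h => by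
    have := congrArg QuadraticAlgebra.im h
    norm_num at this
  have hskew : (⟨0, 1⟩ : QuadraticAlgebra ℚ_[3] (-1) 0) ∈ S.skew := by
    rw [S.mem_skew_iff, hS, QuadraticAlgebra.star_mk]
    ext <;> simp
  have hi1 : Units.mk0 (⟨0, 1⟩ : QuadraticAlgebra ℚ_[3] (-1) 0) hωne ∈ S.normOne := by
    rw [S.mem_normOne_iff', Units.val_mk0, hS, QuadraticAlgebra.star_mk]
    ext <;> simp [QuadraticAlgebra.re_one, QuadraticAlgebra.im_one]
  let zi : S.normOne := ⟨_, hi1⟩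
  -- the carrier: the line `t ∘ det`
  let lam : S.U →* ℂˣ := t.comp detN
  let ω : Representation ℂ S.U ℂ := (DistribMulAction.toModuleEnd ℂ ℂ).comp lam
  have hω : ∀ (g : S.U) (x : ℂ), ω g x = ((t (detN g) : ℂˣ) : ℂ) * x := fun g x => by
    change (lam g : ℂˣ) • x = _
    rw [Units.smul_def, smul_eq_mul]
    rfl
  let L : LemD1Data ℚ_[3] (QuadraticAlgebra ℚ_[3] (-1) 0) 2 ℂ :=
    { isNonarchimedeanLocalField := Literature.NumberTheory.GaloisRepresentations.Padic.isNonarchimedeanLocalField_holds 3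
      isModuleTopology := inferInstance
      S := S
      eps := Units.mk0 _ hωne
      eps_mem_skew := by rw [Units.val_mk0]; exact hskew
      mu := μ.1
      norm_mu := μ.2.1
      continuous_mu := μ.2.2.1
      mu_algebraMap_eq_one_iff := μ.2.2.2
      chi := 1
      norm_chi := fun z => by simp
      continuous_chi := by simpa using continuous_const
      omega := ω }
  -- the centre element `i·1₂` acts by `t(i²) = t(i)² = −1`
  have hdet_zi : detN (S.scalar zi) = zi ^ 2 := by
    apply Subtype.ext
    rw [hdetN]
    apply Units.ext
    rw [Matrix.GeneralLinearGroup.val_det_apply, SubgroupClass.coe_pow, Units.val_pow_eq_pow_val]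
    change (Matrix.scalar (Fin 2) (((zi : (QuadraticAlgebra ℚ_[3] (-1) 0)ˣ)) : QuadraticAlgebra ℚ_[3] (-1) 0)).det = _
    simp [Matrix.scalar_apply, Matrix.det_diagonal, Finset.prod_const]
  have hact : ω (S.scalar zi) 1 = -1 := by
    rw [hω, mul_one, hdet_zi, map_pow, pow_two]
    exact ht_i zi rfl
  -- hence the `χ`-augmentation (χ = 1) is everything and `ω(μ, ε, χ) = 0`
  have hmem : (2 : ℂ) ∈ augmentation ω S.scalar (1 : S.normOne →* ℂˣ) := by
    have h := Literature.RepresentationTheory.CentralCharacterQuotient.sub_smul_mem_augmentation ω S.scalar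
      (1 : S.normOne →* ℂˣ) zi (1 : ℂ)
    rw [hact, MonoidHom.one_apply, Units.val_one, one_smul] at h
    norm_num at h
    exact h
  have htop : augmentation ω S.scalar (1 : S.normOne →* ℂˣ) = ⊤ := by
    rw [Submodule.eq_top_iff']
    intro x
    have h := Submodule.smul_mem _ (x * (2 : ℂ)⁻¹) hmem
    rwa [smul_eq_mul, inv_mul_cancel_right₀ (by norm_num : (2 : ℂ) ≠ 0)] at h
  have hsub : Subsingleton (ℂ ⧸ augmentation ω S.scalar (1 : S.normOne →* ℂˣ)) :=
    Submodule.Quotient.subsingleton_iff.2 htop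
  -- the printed right-hand side of (1), conjunct by conjunct
  have haniso : L.IsAnisotropic := fun v hv => form_anisotropic_of_gram_diag hS hG v hv
  have hcheck : ∀ x : (QuadraticAlgebra ℚ_[3] (-1) 0)ˣ, L.S.check L.chi x = L.mu x ^ 2 := fun x => by
    change S.check 1 x = μ.1 x ^ 2
    rw [pow_two, hμsq, OscillatorStandingData.check_apply, MonoidHom.one_apply]
  have h1 : LemD1_1AsPrinted L := by
    refine ⟨⟨fun W => Or.inl (Subrepresentation.toSubmodule_injective (Subsingleton.elim _ _)), fun x => ?_,
      fun K _ => inferInstance⟩, iff_of_true hsub ⟨isField, ⟨haniso, rfl⟩, hcheck⟩⟩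
    change IsOpen (L.datum.quot.stabilizerSubgroup x : Set S.U)
    rw [Subsingleton.elim x 0, Representation.stabilizerSubgroup_zero, Subgroup.coe_top]
    exact isOpen_univ
  exact ⟨L, hS, hG, h1, hsub, ⟨isField, haniso, hcheck⟩, zi, hact⟩

omit [IsTopologicalRing (QuadraticAlgebra ℚ_[3] (-1) 0)] in
/-- **Contrast 1 — item (1) EXCLUDES a non-zero `ω(μ, ε, χ)` at the exceptional configuration**: the same standing data
(`ℚ₃(i)/ℚ₃`, anisotropic `diag(1, 3)`, `n = 2`), the same labels `μ`, `ε = i`, `χ = 1` (so the printed right-hand side of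
(1) is TRUE), but the trivial line as carrier: the maximal `χ`-quotient is a NON-ZERO line and `LemD1_1AsPrinted` FAILS —
the record has content at `n = 2` over a field. [cite: Liu2021, App. D Lemma D.1 (1) (l. 5229)] -/
theorem exists_lemD1Data_exceptional_violated :
    ∃ L : LemD1Data ℚ_[3] (QuadraticAlgebra ℚ_[3] (-1) 0) 2 ℂ,
      (∀ x, L.S.conj x = star x) ∧ L.S.gram = Matrix.diagonal ![1, 3] ∧
      (IsField (QuadraticAlgebra ℚ_[3] (-1) 0) ∧ L.IsAnisotropic ∧
        ∀ x : (QuadraticAlgebra ℚ_[3] (-1) 0)ˣ, L.S.check L.chi x = L.mu x ^ 2) ∧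
      Nontrivial (ℂ ⧸ augmentation L.omega L.S.scalar L.chi) ∧ ¬ LemD1_1AsPrinted L := by
  classical
  haveI hF : Fact (∀ r : ℚ_[3], r ^ 2 ≠ -1 + 0 * r) := ⟨sq_ne_neg_one⟩
  obtain ⟨S, hS, hG⟩ := exists_standingData_aniso
  obtain ⟨μ, hμsq⟩ := exists_muSet_sq_eq_one (S := S) hS
  have hωne : (⟨0, 1⟩ : QuadraticAlgebra ℚ_[3] (-1) 0) ≠ 0 := fun h => by
    have := congrArg QuadraticAlgebra.im h
    norm_num at this
  have hskew : (⟨0, 1⟩ : QuadraticAlgebra ℚ_[3] (-1) 0) ∈ S.skew := by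
    rw [S.mem_skew_iff, hS, QuadraticAlgebra.star_mk]
    ext <;> simp
  let ω : Representation ℂ S.U ℂ := Representation.trivial ℂ S.U ℂ
  have hω : ∀ (g : S.U) (x : ℂ), ω g x = ((1 : S.U →* ℂˣ) g : ℂ) * x := fun g x => by
    rw [MonoidHom.one_apply, Units.val_one, one_mul]; rfl
  let L : LemD1Data ℚ_[3] (QuadraticAlgebra ℚ_[3] (-1) 0) 2 ℂ :=
    { isNonarchimedeanLocalField := Literature.NumberTheory.GaloisRepresentations.Padic.isNonarchimedeanLocalField_holds 3
      isModuleTopology := inferInstance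
      S := S
      eps := Units.mk0 _ hωne
      eps_mem_skew := by rw [Units.val_mk0]; exact hskew
      mu := μ.1
      norm_mu := μ.2.1
      continuous_mu := μ.2.2.1
      mu_algebraMap_eq_one_iff := μ.2.2.2
      chi := 1
      norm_chi := fun z => by simp
      continuous_chi := by simpa using continuous_const
      omega := ω }
  have hN : augmentation ω S.scalar (1 : S.normOne →* ℂˣ) = ⊥ :=
    augmentation_eq_bot_of_character ω S.scalar 1 1 hω fun z => rfl
  have hnt : Nontrivial (ℂ ⧸ augmentation ω S.scalar (1 : S.normOne →* ℂˣ)) :=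
    Submodule.Quotient.nontrivial_iff.2 (by rw [hN]; exact bot_ne_top)
  have haniso : L.IsAnisotropic := fun v hv => form_anisotropic_of_gram_diag hS hG v hv
  have hcheck : ∀ x : (QuadraticAlgebra ℚ_[3] (-1) 0)ˣ, L.S.check L.chi x = L.mu x ^ 2 := fun x => by
    change S.check 1 x = μ.1 x ^ 2
    rw [pow_two, hμsq, OscillatorStandingData.check_apply, MonoidHom.one_apply]
  refine ⟨L, hS, hG, ⟨isField, haniso, hcheck⟩, hnt, fun h => ?_⟩
  have hsub : Subsingleton (ℂ ⧸ augmentation ω S.scalar (1 : S.normOne →* ℂˣ)) := h.2.2 ⟨isField, ⟨haniso, rfl⟩, hcheck⟩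
  exact not_subsingleton _ hsub

/-- **Contrast 2 — «`V` is anisotropic» is the operative conjunct**: the same field `E = ℚ₃(i)`, rank `n = 2`, the same
labels `μ`, `ε = i`, `χ = 1` (so «`E` is a field», «`n = 2`», «`χ̌ = μ²`» all hold) and the same trivial-line carrier as in
Contrast 1, but on the ISOTROPIC binary hermitian space `(E², 1₂)` (`(x, 1)` with `N(x) = −1` is isotropic): now the right
side of (1) is FALSE through «`V` is anisotropic» alone, the quotient is a non-zero line, and `LemD1_1AsPrinted` HOLDS.
[cite: Liu2021, App. D Lemma D.1 (1) (l. 5229)] -/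
theorem exists_lemD1Data_rank_two_isotropic :
    ∃ L : LemD1Data ℚ_[3] (QuadraticAlgebra ℚ_[3] (-1) 0) 2 ℂ,
      (∀ x, L.S.conj x = star x) ∧ L.S.gram = 1 ∧
      (IsField (QuadraticAlgebra ℚ_[3] (-1) 0) ∧ LemD1.IsIsotropic L.S ∧ ¬ L.IsAnisotropic ∧
        ∀ x : (QuadraticAlgebra ℚ_[3] (-1) 0)ˣ, L.S.check L.chi x = L.mu x ^ 2) ∧
      Nontrivial (ℂ ⧸ augmentation L.omega L.S.scalar L.chi) ∧ LemD1_1AsPrinted L := by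
  classical
  haveI hF : Fact (∀ r : ℚ_[3], r ^ 2 ≠ -1 + 0 * r) := ⟨sq_ne_neg_one⟩
  obtain ⟨S, hS, hG⟩ := exists_standingData 2 le_rfl
  obtain ⟨μ, hμsq⟩ := exists_muSet_sq_eq_one (S := S) hS
  have hωne : (⟨0, 1⟩ : QuadraticAlgebra ℚ_[3] (-1) 0) ≠ 0 := fun h => by
    have := congrArg QuadraticAlgebra.im h
    norm_num at this
  have hskew : (⟨0, 1⟩ : QuadraticAlgebra ℚ_[3] (-1) 0) ∈ S.skew := by
    rw [S.mem_skew_iff, hS, QuadraticAlgebra.star_mk]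
    ext <;> simp
  let ω : Representation ℂ S.U ℂ := Representation.trivial ℂ S.U ℂ
  have hω : ∀ (g : S.U) (x : ℂ), ω g x = ((1 : S.U →* ℂˣ) g : ℂ) * x := fun g x => by
    rw [MonoidHom.one_apply, Units.val_one, one_mul]; rfl
  let L : LemD1Data ℚ_[3] (QuadraticAlgebra ℚ_[3] (-1) 0) 2 ℂ :=
    { isNonarchimedeanLocalField := Literature.NumberTheory.GaloisRepresentations.Padic.isNonarchimedeanLocalField_holds 3
      isModuleTopology := inferInstance
      S := S
      eps := Units.mk0 _ hωne
      eps_mem_skew := by rw [Units.val_mk0]; exact hskew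
      mu := μ.1
      norm_mu := μ.2.1
      continuous_mu := μ.2.2.1
      mu_algebraMap_eq_one_iff := μ.2.2.2
      chi := 1
      norm_chi := fun z => by simp
      continuous_chi := by simpa using continuous_const
      omega := ω }
  have hN : augmentation ω S.scalar (1 : S.normOne →* ℂˣ) = ⊥ :=
    augmentation_eq_bot_of_character ω S.scalar 1 1 hω fun z => rfl
  have hnt : Nontrivial (ℂ ⧸ augmentation ω S.scalar (1 : S.normOne →* ℂˣ)) :=
    Submodule.Quotient.nontrivial_iff.2 (by rw [hN]; exact bot_ne_top)
  -- an isotropic vector `(x, 1)` with `N(x) = −1` (`−1` is a norm: `ord₃(−1) = 0` is even)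
  have hm1 : (-1 : ℚ_[3]) ≠ 0 := by norm_num
  have hvm1 : (-1 : ℚ_[3]).valuation = 0 :=
    (valuation_eq_of_norm_eq hm1 one_ne_zero (by rw [norm_neg])).trans Padic.valuation_one
  obtain ⟨x, hx⟩ := (exists_unit_mul_star_eq_iff (-1 : ℚ_[3]) hm1).2 (by rw [hvm1]; exact ⟨0, rfl⟩)
  have hiso : LemD1.IsIsotropic S := by
    refine ⟨![(x : QuadraticAlgebra ℚ_[3] (-1) 0), 1], fun h => one_ne_zero (congrFun h 1), ?_⟩
    unfold OscillatorStandingData.form Literature.AlgebraicGeometry.ShimuraVarieties.hermForm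
    rw [hG, Matrix.one_mulVec, dotProduct, Fin.sum_univ_two]
    simp only [Function.comp_apply, OscillatorStandingData.σ_apply, hS, Matrix.cons_val_zero, Matrix.cons_val_one,
      star_one, mul_one]
    rw [mul_comm, hx, map_neg, map_one, neg_add_cancel]
  have hnotaniso : ¬ L.IsAnisotropic := fun h => (L.isAnisotropic_iff_not_isIsotropic.1 h) hiso
  have hcheck : ∀ y : (QuadraticAlgebra ℚ_[3] (-1) 0)ˣ, L.S.check L.chi y = L.mu y ^ 2 := fun y => by
    change S.check 1 y = μ.1 y ^ 2
    rw [pow_two, hμsq, OscillatorStandingData.check_apply, MonoidHom.one_apply]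
  have h1 : LemD1_1AsPrinted L :=
    lemD1_1AsPrinted_of_character_of_not_exceptional L 1 hω (fun z => rfl)
      ⟨Set.univ, isOpen_univ, Set.mem_univ _, fun g _ => rfl⟩ fun h => hnotaniso h.2.1.1
  exact ⟨L, hS, hG, ⟨isField, hiso, hnotaniso, hcheck⟩, hnt, h1⟩

end Data

end RankTwo

/-! ## §9 (v3) The CUBIC character of `E¹` at the non-split datum (level-`9` reduction: `E¹ → (𝒪_E/9)^{N=1} ≅ ℤ/12 → ℤ/3`),
trivial on `μ₄ ∋ i`, non-trivial at `z₀ = (−4 + 3i)/5 ≡ 1 + 6i (mod 9)`; a cube root of unity in `ℂ^×` -/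

section CubicCharacter

/-- On the twelve points of the circle `X² + Y² = 1` over `ℤ/9` (the image of `E¹ = {a + b i : a² + b² = 1}` modulo `9`),
the exponent `Ψ(α, β) := (β/3)·α − (α/3)·β (mod 3)` (integer division by `3` of the representatives in `{0, …, 8}`) —
which reads the level-one digit of `z/ω(z)`, `ω(z) ∈ μ₄` the Teichmüller representative — is ADDITIVE under the
multiplication `(α, β)·(γ, δ) = (αγ − βδ, αδ + βγ)` of `(ℤ/9)[i]`: it is the cubic character of the `12`-element group
`E¹/E¹ ∩ (1 + 9𝒪_E) ≅ ℤ/12`. Checked by `decide`. [folklore] -/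
private theorem zmod9_cubic : ∀ α β γ δ : ZMod 9, α * α + β * β = 1 → γ * γ + δ * δ = 1 →
    ((((α * δ + β * γ).val / 3 * (α * γ - β * δ).val : ℕ) : ZMod 3) -
        (((α * γ - β * δ).val / 3 * (α * δ + β * γ).val : ℕ) : ZMod 3)) =
      ((((β.val / 3 * α.val : ℕ) : ZMod 3) - ((α.val / 3 * β.val : ℕ) : ZMod 3)) +
        (((δ.val / 3 * γ.val : ℕ) : ZMod 3) - ((γ.val / 3 * δ.val : ℕ) : ZMod 3))) := by
  decide

/-- In `ℤ/9`, `5` is invertible: `5 α = −4` forces `α = 1` … [folklore] -/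
private theorem zmod9_eq_one_of_five_mul : ∀ α : ZMod 9, ((5 : ℕ) : ZMod 9) * α = -(((4 : ℕ) : ZMod 9)) → α = 1 := by
  decide

/-- … and `5 β = 3` forces `β = 6`. [folklore] -/
private theorem zmod9_eq_six_of_five_mul : ∀ β : ZMod 9, ((5 : ℕ) : ZMod 9) * β = ((3 : ℕ) : ZMod 9) → β = 6 := by
  decide

/-- A `3`-adic integer reduces to `0` mod `9` iff its norm is `< 3⁻¹` (Mathlib `PadicInt.ker_toZModPow`). [folklore] -/
private theorem toZModPow_two_eq_zero_iff (x : ℤ_[3]) :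
    (PadicInt.toZModPow 2 : ℤ_[3] →+* ZMod 9) x = 0 ↔ ‖x‖ < 3⁻¹ := by
  rw [← RingHom.mem_ker, PadicInt.ker_toZModPow, ← PadicInt.norm_le_pow_iff_mem_span_pow,
    PadicInt.norm_le_pow_iff_norm_lt_pow_add_one]
  norm_num

/-- A primitive cube root of unity `ζ₃ = e^{2πi/3}` as a unit of `ℂ`: `ζ₃³ = 1`, `ζ₃ ≠ 1`, `ζ₃² ≠ 1`, `‖ζ₃‖ = 1`. [folklore] -/
private theorem exists_cubeRoot_unit : ∃ ζ : ℂˣ, ζ ^ 3 = 1 ∧ ζ ≠ 1 ∧ ζ ^ 2 ≠ 1 ∧ ‖(ζ : ℂ)‖ = 1 := by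
  have hprim : IsPrimitiveRoot (Complex.exp (2 * Real.pi * Complex.I / (3 : ℕ))) 3 :=
    Complex.isPrimitiveRoot_exp 3 (by norm_num)
  have hu : IsUnit (Complex.exp (2 * Real.pi * Complex.I / (3 : ℕ))) := hprim.isUnit (by norm_num)
  have hζ : IsPrimitiveRoot hu.unit 3 := IsPrimitiveRoot.coe_units_iff.1 (by rw [hu.unit_spec]; exact hprim)
  exact ⟨hu.unit, hζ.pow_eq_one, hζ.ne_one (by norm_num), hζ.pow_ne_one_of_pos_of_lt two_ne_zero (by norm_num),
    by rw [hu.unit_spec]; exact hprim.norm'_eq_one (by norm_num)⟩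

variable {n : ℕ} {S : OscillatorStandingData ℚ_[3] (QuadraticAlgebra ℚ_[3] (-1) 0) n}
  [TopologicalSpace (QuadraticAlgebra ℚ_[3] (-1) 0)] [IsModuleTopology ℚ_[3] (QuadraticAlgebra ℚ_[3] (-1) 0)]

/-- **The cubic character of `E¹`** at the non-split datum `ℚ₃(i)/ℚ₃` — reduction modulo `9`: `E¹ = μ₄ × (E¹ ∩ (1 + 3𝒪_E))`,
and on `E¹ ∩ (1 + 3𝒪_E) ∋ 1 + 3w` the level-one digit `im w (mod 3)` is additive; for `z = a + b i ∈ E¹` (`a, b ∈ ℤ₃`) with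
residues `α = a`, `β = b (mod 9)` the exponent is `Ψ(α, β) = (β/3)·α − (α/3)·β (mod 3)` and `ψ(z) := ζ₃^{Ψ}`.  It is a
unitary, continuous (locally constant: `ψ = 1` on `{‖a − 1‖ < 3⁻¹, ‖b‖ < 3⁻¹}`) character of `E¹` of ORDER `3`, trivial on
`μ₄ ∋ i` (so `ψ(i) = 1`), and NON-trivial: at `z₀ = (−4 + 3i)/5 ∈ E¹` (`≡ 1 + 6i (mod 9)`) one has `ψ(z₀) = ζ₃²`, so
`ψ(z₀) ≠ 1` and `ψ(z₀)² ≠ 1`.  At rank `3` the line `ψ ∘ det` has TRIVIAL central character (`ψ(z³) = ψ(z)³ = 1`) — the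
ingredient missing in v1/v2 for an `ε`-isolated certificate at the rows' rank. [cite: Liu2021, App. D §D.1 Step 3 (l. 5221)] -/
theorem exists_cubicChar (hS : ∀ x, S.conj x = star x) :
    ∃ ψ : S.normOne →* ℂˣ, (∀ z, ‖((ψ z : ℂˣ) : ℂ)‖ = 1) ∧ (Continuous fun z : S.normOne => ((ψ z : ℂˣ) : ℂ)) ∧
      (∀ z, ψ z ^ 3 = 1) ∧
      (∀ z : S.normOne, ‖(((z : (QuadraticAlgebra ℚ_[3] (-1) 0)ˣ)) : QuadraticAlgebra ℚ_[3] (-1) 0).re - 1‖ < 3⁻¹ →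
        ‖(((z : (QuadraticAlgebra ℚ_[3] (-1) 0)ˣ)) : QuadraticAlgebra ℚ_[3] (-1) 0).im‖ < 3⁻¹ → ψ z = 1) ∧
      (∀ z : S.normOne, (((z : (QuadraticAlgebra ℚ_[3] (-1) 0)ˣ)) : QuadraticAlgebra ℚ_[3] (-1) 0) = ⟨0, 1⟩ → ψ z = 1) ∧
      ∃ z₀ : S.normOne, (((z₀ : (QuadraticAlgebra ℚ_[3] (-1) 0)ˣ)) : QuadraticAlgebra ℚ_[3] (-1) 0) = ⟨-4 / 5, 3 / 5⟩ ∧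
        ψ z₀ ≠ 1 ∧ ψ z₀ ^ 2 ≠ 1 := by
  classical
  haveI hF : Fact (∀ r : ℚ_[3], r ^ 2 ≠ -1 + 0 * r) := ⟨sq_ne_neg_one⟩
  have hsq : ∀ z : S.normOne, (((z : (QuadraticAlgebra ℚ_[3] (-1) 0)ˣ)) : QuadraticAlgebra ℚ_[3] (-1) 0).re ^ 2 +
      (((z : (QuadraticAlgebra ℚ_[3] (-1) 0)ˣ)) : QuadraticAlgebra ℚ_[3] (-1) 0).im ^ 2 = 1 := fun z => by
    have h := (S.mem_normOne_iff' _).1 z.2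
    rw [hS, ← QuadraticAlgebra.algebraMap_norm_eq_mul_star, ← QuadraticAlgebra.C_eq_algebraMap,
      QuadraticAlgebra.C_eq_one_iff, norm_eq] at h
    exact h
  have hco := fun z : S.normOne => coords_of_sq_add_sq_eq_one (hsq z)
  -- integral coordinates and their reductions mod `9`
  let A : S.normOne → ℤ_[3] := fun z => ⟨(((z : (QuadraticAlgebra ℚ_[3] (-1) 0)ˣ)) : QuadraticAlgebra ℚ_[3] (-1) 0).re, (hco z).1⟩
  let B : S.normOne → ℤ_[3] := fun z => ⟨(((z : (QuadraticAlgebra ℚ_[3] (-1) 0)ˣ)) : QuadraticAlgebra ℚ_[3] (-1) 0).im, (hco z).2.1⟩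
  have hA : ∀ z, ((A z : ℤ_[3]) : ℚ_[3]) = (((z : (QuadraticAlgebra ℚ_[3] (-1) 0)ˣ)) : QuadraticAlgebra ℚ_[3] (-1) 0).re :=
    fun z => rfl
  have hB : ∀ z, ((B z : ℤ_[3]) : ℚ_[3]) = (((z : (QuadraticAlgebra ℚ_[3] (-1) 0)ˣ)) : QuadraticAlgebra ℚ_[3] (-1) 0).im :=
    fun z => rfl
  let r : ℤ_[3] →+* ZMod 9 := PadicInt.toZModPow 2
  have hAB : ∀ z, r (A z) * r (A z) + r (B z) * r (B z) = 1 := fun z => by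
    have h : A z * A z + B z * B z = 1 := PadicInt.ext (by push_cast [hA, hB]; rw [← sq, ← sq]; exact hsq z)
    have := congrArg r h
    rwa [map_add, map_mul, map_mul, map_one] at this
  have hAmul : ∀ z w, A (z * w) = A z * A w - B z * B w := fun z w => PadicInt.ext (by
    push_cast [hA, hB]
    change ((((z : (QuadraticAlgebra ℚ_[3] (-1) 0)ˣ) : QuadraticAlgebra ℚ_[3] (-1) 0) *
      ((w : (QuadraticAlgebra ℚ_[3] (-1) 0)ˣ) : QuadraticAlgebra ℚ_[3] (-1) 0))).re = _
    rw [QuadraticAlgebra.re_mul]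
    ring)
  have hBmul : ∀ z w, B (z * w) = A z * B w + B z * A w := fun z w => PadicInt.ext (by
    push_cast [hA, hB]
    change ((((z : (QuadraticAlgebra ℚ_[3] (-1) 0)ˣ) : QuadraticAlgebra ℚ_[3] (-1) 0) *
      ((w : (QuadraticAlgebra ℚ_[3] (-1) 0)ˣ) : QuadraticAlgebra ℚ_[3] (-1) 0))).im = _
    rw [QuadraticAlgebra.im_mul]
    ring)
  -- the exponent `Ψ` with values in `ℤ/3`
  let T : ZMod 9 → ZMod 9 → ZMod 3 := fun α β => ((β.val / 3 * α.val : ℕ) : ZMod 3) - ((α.val / 3 * β.val : ℕ) : ZMod 3)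
  have hT : ∀ α β, T α β = ((β.val / 3 * α.val : ℕ) : ZMod 3) - ((α.val / 3 * β.val : ℕ) : ZMod 3) := fun α β => rfl
  let κ : S.normOne → ZMod 3 := fun z => T (r (A z)) (r (B z))
  have hκ : ∀ z, κ z = T (r (A z)) (r (B z)) := fun z => rfl
  have hκmul : ∀ z w, κ (z * w) = κ z + κ w := fun z w => by
    rw [hκ, hκ, hκ, hAmul, hBmul, map_sub, map_add, map_mul, map_mul, map_mul, map_mul, hT, hT, hT]
    exact zmod9_cubic _ _ _ _ (hAB z) (hAB w)
  -- the unit `ζ₃`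
  obtain ⟨ζ, hζ3, hζ1, hζ2, hζn⟩ := exists_cubeRoot_unit
  have hpow : ∀ a b : ZMod 3, ζ ^ (a + b).val = ζ ^ a.val * ζ ^ b.val := fun a b => by
    rw [← pow_add, ZMod.val_add]
    conv_rhs => rw [← Nat.div_add_mod (a.val + b.val) 3, pow_add, pow_mul, hζ3, one_pow, one_mul]
  have hA1 : A 1 = 1 := PadicInt.ext (by rw [hA]; simp [QuadraticAlgebra.re_one])
  have hB1 : B 1 = 0 := PadicInt.ext (by rw [hB]; simp [QuadraticAlgebra.im_one])
  have hT10 : T 1 0 = 0 := by rw [hT]; decide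
  have hT01 : T 0 1 = 0 := by rw [hT]; decide
  have hT16 : T 1 6 = 2 := by rw [hT]; decide
  let ψ : S.normOne →* ℂˣ :=
    { toFun := fun z => ζ ^ (κ z).val
      map_one' := by
        simp only [hκ, hA1, hB1, map_one, map_zero, hT10]
        rw [ZMod.val_zero, pow_zero]
      map_mul' := fun z w => by simp only [hκmul, hpow] }
  have hψ : ∀ z, ψ z = ζ ^ (κ z).val := fun z => rfl
  have hre_cont : Continuous fun z : S.normOne =>
      (((z : (QuadraticAlgebra ℚ_[3] (-1) 0)ˣ)) : QuadraticAlgebra ℚ_[3] (-1) 0).re :=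
    continuous_re.comp (Units.continuous_val.comp continuous_subtype_val)
  have him_cont : Continuous fun z : S.normOne =>
      (((z : (QuadraticAlgebra ℚ_[3] (-1) 0)ˣ)) : QuadraticAlgebra ℚ_[3] (-1) 0).im :=
    continuous_im.comp (Units.continuous_val.comp continuous_subtype_val)
  -- reductions mod `9` are locally constant
  have hloc : ∀ (a b : ℤ_[3]), ‖(a : ℚ_[3]) - b‖ < 3⁻¹ → r a = r b := fun a b h => by
    rw [← sub_eq_zero, ← map_sub, toZModPow_two_eq_zero_iff]
    exact h
  -- the witness `z₀ = (−4 + 3i)/5`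
  have hz₀ne : (⟨-4 / 5, 3 / 5⟩ : QuadraticAlgebra ℚ_[3] (-1) 0) ≠ 0 := fun h => by
    have := congrArg QuadraticAlgebra.im h
    norm_num at this
  have hz₀1 : Units.mk0 (⟨-4 / 5, 3 / 5⟩ : QuadraticAlgebra ℚ_[3] (-1) 0) hz₀ne ∈ S.normOne := by
    rw [S.mem_normOne_iff', Units.val_mk0, hS, QuadraticAlgebra.star_mk]
    ext
    · simp [QuadraticAlgebra.re_one]; norm_num
    · simp [QuadraticAlgebra.im_one]; norm_num
  let z₀ : S.normOne := ⟨_, hz₀1⟩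
  have hz₀A : r (A z₀) = 1 := by
    apply zmod9_eq_one_of_five_mul
    have h : ((5 : ℕ) : ℤ_[3]) * A z₀ = -(((4 : ℕ) : ℤ_[3])) := PadicInt.ext (by
      push_cast [hA]
      change (5 : ℚ_[3]) * (-4 / 5) = -4
      norm_num)
    have := congrArg r h
    rwa [map_mul, map_neg, map_natCast, map_natCast] at this
  have hz₀B : r (B z₀) = 6 := by
    apply zmod9_eq_six_of_five_mul
    have h : ((5 : ℕ) : ℤ_[3]) * B z₀ = ((3 : ℕ) : ℤ_[3]) := PadicInt.ext (by
      push_cast [hB]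
      change (5 : ℚ_[3]) * (3 / 5) = 3
      norm_num)
    have := congrArg r h
    rwa [map_mul, map_natCast, map_natCast] at this
  have hκz₀ : κ z₀ = 2 := by rw [hκ, hz₀A, hz₀B, hT16]
  have hψz₀ : ψ z₀ = ζ ^ 2 := by rw [hψ, hκz₀]; rfl
  refine ⟨ψ, fun z => ?_, ?_, fun z => ?_, fun z hre him => ?_, fun z hz => ?_, z₀, rfl, ?_, ?_⟩
  · -- unitary
    rw [hψ, Units.val_pow_eq_pow_val, norm_pow, hζn, one_pow]
  · -- continuous (locally constant)
    refine IsLocallyConstant.continuous ((IsLocallyConstant.iff_exists_open _).2 fun z => ?_)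
    refine ⟨{w | ‖(((w : (QuadraticAlgebra ℚ_[3] (-1) 0)ˣ)) : QuadraticAlgebra ℚ_[3] (-1) 0).re -
        (((z : (QuadraticAlgebra ℚ_[3] (-1) 0)ˣ)) : QuadraticAlgebra ℚ_[3] (-1) 0).re‖ < 3⁻¹ ∧
        ‖(((w : (QuadraticAlgebra ℚ_[3] (-1) 0)ˣ)) : QuadraticAlgebra ℚ_[3] (-1) 0).im -
        (((z : (QuadraticAlgebra ℚ_[3] (-1) 0)ˣ)) : QuadraticAlgebra ℚ_[3] (-1) 0).im‖ < 3⁻¹},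
      (isOpen_lt (continuous_norm.comp (hre_cont.sub continuous_const)) continuous_const).inter
        (isOpen_lt (continuous_norm.comp (him_cont.sub continuous_const)) continuous_const), ?_, fun w hw => ?_⟩
    · change ‖_‖ < 3⁻¹ ∧ ‖_‖ < 3⁻¹
      rw [sub_self, sub_self, norm_zero]
      exact ⟨by norm_num, by norm_num⟩
    · obtain ⟨hw1, hw2⟩ := hw
      rw [hψ, hψ, hκ, hκ, hloc (A w) (A z) hw1, hloc (B w) (B z) hw2]
  · -- order `3`
    rw [hψ, ← pow_mul, mul_comm, pow_mul, hζ3, one_pow]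
  · -- `ψ = 1` near `1`
    have h1 : r (A z) = r (A 1) := hloc _ _ (by rw [hA, hA1, PadicInt.coe_one]; exact hre)
    have h2 : r (B z) = r (B 1) := hloc _ _ (by rw [hB, hB1, PadicInt.coe_zero, sub_zero]; exact him)
    rw [hψ, hκ, h1, h2, hA1, hB1, map_one, map_zero, hT10, ZMod.val_zero, pow_zero]
  · -- `ψ(i) = 1`
    have hAz : A z = 0 := PadicInt.ext (by rw [hA, hz]; rfl)
    have hBz : B z = 1 := PadicInt.ext (by rw [hB, hz]; rfl)
    rw [hψ, hκ, hAz, hBz, map_zero, map_one, hT01, ZMod.val_zero, pow_zero]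
  · -- `ψ(z₀) = ζ₃² ≠ 1`
    rw [hψz₀]; exact hζ2
  · -- `ψ(z₀)² = ζ₃ ≠ 1`
    rw [hψz₀, ← pow_mul, show 2 * 2 = 3 + 1 from rfl, pow_add, hζ3, one_mul, pow_one]
    exact hζ1

end CubicCharacter

/-! ## §10 (v3) A second Step-2 character, and the RANK-3 SLOT TABLE over the field: each label `μ`, `ε`, `χ` of
Lemma D.1 (3) is, ALONE, the deciding conjunct at the rows' rank `n = 3` -/

section SlotTable

/-- **Twisting a Step-2 character by `χ̌`.**  For any `μ` of Step 2 and any `χ` of Step 3, `μ · χ̌` (`χ̌(x) = χ(x/x^c)`) is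
again as in Step 2: unitary, continuous, and with the SAME restriction to `F^×` (`χ̌|_{F^×} = 1`, tree `LemD1.check_algebraMap`),
hence with kernel-of-restriction exactly `Nm E^×` again.  (For `μ^c = μ` this is the tree's `LemD1.muTwist μ χ = μ^c χ̌`; stated as
an existence so that no definition is introduced.) [cite: Liu2021, App. D §D.1 Step 2 (l. 5219) and l. 5224] -/
theorem exists_muSet_mul_check {F E : Type} [Field F] [CommRing E] [Algebra F E] [TopologicalSpace E] {m : ℕ}
    [TopologicalSpace F] [IsTopologicalRing E] [IsModuleTopology F E] {S : OscillatorStandingData F E m}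
    (μ : LemD1.MuSet S) (χ : LemD1.ChiSet S) : ∃ μ' : LemD1.MuSet S, ∀ x, μ'.1 x = μ.1 x * S.check χ.1 x := by
  refine ⟨⟨μ.1 * S.check χ.1, fun x => ?_, ?_, fun a => ?_⟩, fun x => rfl⟩
  · rw [MonoidHom.mul_apply, Units.val_mul, norm_mul, μ.2.1 x]
    have : ‖((S.check χ.1 x : ℂˣ) : ℂ)‖ = 1 := χ.2.1 _
    rw [this, mul_one]
  · have h : (fun x : Eˣ => (((μ.1 * S.check χ.1) x : ℂˣ) : ℂ)) =
        fun x => ((μ.1 x : ℂˣ) : ℂ) * ((S.check χ.1 x : ℂˣ) : ℂ) := by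
      funext x; rw [MonoidHom.mul_apply, Units.val_mul]
    rw [h]
    exact μ.2.2.1.mul (LemD1.continuous_check χ)
  · rw [MonoidHom.mul_apply, LemD1.check_algebraMap, mul_one]
    exact μ.2.2.2 a

variable [TopologicalSpace (QuadraticAlgebra ℚ_[3] (-1) 0)] [IsTopologicalRing (QuadraticAlgebra ℚ_[3] (-1) 0)]
  [IsModuleTopology ℚ_[3] (QuadraticAlgebra ℚ_[3] (-1) 0)]

/-- **THE RANK-3 SLOT TABLE OF LEMMA D.1 (3) OVER A FIELD** (in-kernel certificate, our bookkeeping; no statement about Liu's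
`ω(μ, ε)`).  Over `F = ℚ₃`, `E = ℚ₃(i)` — a FIELD —, `c : i ↦ −i`, the hermitian space `(E³, 1)` of the rows' rank `n = 3`,
`E` with its module topology (any instance of it), there is a FOUR-member collection `Lf : LemD1IndexedFamily ℚ_[3] E 3 (Fin 4)`

* member `0`: `(μ, ε = i, χ = 1)`, carrier the trivial line;
* member `1`: `(μ, ε = 3i, χ = 1)`, carrier the line `ψ ∘ det` (`ψ` the CUBIC character of `E¹`, `exists_cubicChar`; central
  character `ψ(z³) = 1`) — it differs from member `0` in the CLASS OF `ε` ALONE (`[3i] ≠ [i]`);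
* member `2`: `(μ·š, ε = i, χ = 1)`, carrier the line `ψ² ∘ det` — it differs from member `0` in `μ` ALONE (`š(1 + i) = s(i) = −1`,
  `s` the sign character; `μ·š` is a Step-2 character by `exists_muSet_mul_check`);
* member `3`: `(μ, ε = i, χ = s)`, carrier the line `s ∘ det` (central character `s(z³) = s(z)`) — it differs from member `0` in
  `χ` ALONE;

such that `Lf.Item1AsPrinted` (four lines: irreducible, admissible, NON-ZERO although «`E` is a field» holds — (1)'s right side
fails through «`n = 2`») ∧ `LemD1_3AsPrintedI Lf` (all sixteen pairs) ∧ every two distinct members have NON-isomorphic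
`ω(μ, ε, χ)` (the characters are separated at `diag(z₀, 1, 1)`, `ψ(z₀) = ζ₃²`, and at `diag(i, 1, 1)`, `s(i) = −1`).  So at the
rows' own rank `3` and over a field, EACH of the three conjuncts «`μ' = μ`», «`ε' = ε`» (in `E^{−×}/Nm E^×`), «`χ' = χ`» of the
printed criterion (3) is, on its own, the deciding one for some pair of a model of «(1) ∧ (3)» — in particular the `ε`-conjunct
ALONE at `n = 3` (v1 needed `n = 4`, v2's rank-3 model had `ε` and `χ` failing together). [cite: Liu2021, App. D Lemma D.1 (1)
(l. 5229) and (3) (l. 5233); §D.1 Steps 1–3 (l. 5217–5221)] -/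
theorem exists_lemD1IndexedFamily_nonsplit_rank_three_slots :
    ∃ Lf : LemD1IndexedFamily ℚ_[3] (QuadraticAlgebra ℚ_[3] (-1) 0) 3 (Fin 4),
      IsField (QuadraticAlgebra ℚ_[3] (-1) 0) ∧ (∀ x, Lf.S.conj x = star x) ∧ Lf.S.gram = 1 ∧
      Lf.Item1AsPrinted ∧ LemD1_3AsPrintedI Lf ∧
      (∀ i j : Fin 4, i ≠ j → ¬ AreIsomorphicRep (Lf.quot j) (Lf.quot i)) ∧
      (Lf.mu 1 = Lf.mu 0 ∧ ¬ LemD1.SameClass (Lf.eps 0) (Lf.eps 1) ∧ Lf.chi 1 = Lf.chi 0) ∧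
      (Lf.mu 2 ≠ Lf.mu 0 ∧ Lf.eps 2 = Lf.eps 0 ∧ Lf.chi 2 = Lf.chi 0) ∧
      (Lf.mu 3 = Lf.mu 0 ∧ Lf.eps 3 = Lf.eps 0 ∧ Lf.chi 3 ≠ Lf.chi 0) := by
  classical
  haveI hF : Fact (∀ r : ℚ_[3], r ^ 2 ≠ -1 + 0 * r) := ⟨sq_ne_neg_one⟩
  obtain ⟨S, hS, hgram⟩ := exists_standingData 3 (by norm_num)
  obtain ⟨μ⟩ := nonempty_muSet (S := S) hS
  obtain ⟨s, hs_norm, hs_cont, hs_sq, hs_one⟩ := exists_signChar (S := S) hS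
  obtain ⟨ψ, -, -, hψ3, hψnear, hψi, z₀, hz₀, hψz₀, hψz₀sq⟩ := exists_cubicChar (S := S) hS
  obtain ⟨detN, hdetN⟩ := exists_detNormOne (S := S) hgram
  -- Step 3: `χ = 1` and `χ = s`
  let χ₁ : LemD1.ChiSet S := ⟨1, fun z => by simp, by simpa using continuous_const⟩
  let χs : LemD1.ChiSet S := ⟨s, hs_norm, hs_cont⟩
  -- Step 2: `μ` and `μ' = μ·š`
  obtain ⟨μ', hμ'⟩ := exists_muSet_mul_check μ χs
  -- Step 1: the representatives `i`, `3i`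
  have hskew : ∀ b : ℚ_[3], (⟨0, b⟩ : QuadraticAlgebra ℚ_[3] (-1) 0) ∈ S.skew := fun b => by
    rw [S.mem_skew_iff, hS, QuadraticAlgebra.star_mk]
    ext <;> simp
  have hne : ∀ b : ℚ_[3], b ≠ 0 → (⟨0, b⟩ : QuadraticAlgebra ℚ_[3] (-1) 0) ≠ 0 := fun b hb h =>
    hb (by simpa using congrArg QuadraticAlgebra.im h)
  let eb : ∀ b : ℚ_[3], b ≠ 0 → LemD1.EpsRep S := fun b hb =>
    ⟨Units.mk0 _ (hne b hb), by rw [Units.val_mk0]; exact hskew b⟩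
  have heb_im : ∀ b hb, (((eb b hb).1 : (QuadraticAlgebra ℚ_[3] (-1) 0)ˣ) : QuadraticAlgebra ℚ_[3] (-1) 0).im = b :=
    fun b hb => rfl
  have h3 : (3 : ℚ_[3]) ≠ 0 := by norm_num
  have hv1 : (1 : ℚ_[3]).valuation = 0 := Padic.valuation_one
  have hv3 : (3 : ℚ_[3]).valuation = 1 := by
    rw [Padic.valuation_ofNat]
    simp
  have h01 : ¬ LemD1.SameClass (eb 1 one_ne_zero) (eb 3 h3) := by
    rw [sameClass_iff hS, heb_im 1 one_ne_zero, heb_im 3 h3, hv1, hv3]; decide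
  -- the unit `i ∈ E¹`: `s(i) = −1 ≠ 1`, `ψ(i) = 1`
  have hωne : (⟨0, 1⟩ : QuadraticAlgebra ℚ_[3] (-1) 0) ≠ 0 := hne 1 one_ne_zero
  have hi1 : Units.mk0 (⟨0, 1⟩ : QuadraticAlgebra ℚ_[3] (-1) 0) hωne ∈ S.normOne := by
    rw [S.mem_normOne_iff', Units.val_mk0, hS, QuadraticAlgebra.star_mk]
    ext <;> simp [QuadraticAlgebra.re_one, QuadraticAlgebra.im_one]
  let zi : S.normOne := ⟨_, hi1⟩
  have hsi : s zi ≠ 1 := by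
    rw [Ne, hs_one, not_not]
    change ‖(0 : ℚ_[3])‖ < 1
    simp
  have hχne : χs ≠ χ₁ := fun h => hsi (by
    have := congrArg (fun χ : LemD1.ChiSet S => χ.1 zi) h
    exact this.trans (MonoidHom.one_apply _))
  -- `μ' ≠ μ`: at `x₀ = 1 + i`, `x₀ / x₀^c = i` and `š(x₀) = s(i) = −1`
  have hx₀ne : (⟨1, 1⟩ : QuadraticAlgebra ℚ_[3] (-1) 0) ≠ 0 := fun h => by
    have := congrArg QuadraticAlgebra.im h
    norm_num at this
  have hdc : (((S.divConj (Units.mk0 _ hx₀ne) : S.normOne) : (QuadraticAlgebra ℚ_[3] (-1) 0)ˣ) :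
      QuadraticAlgebra ℚ_[3] (-1) 0) = ⟨0, 1⟩ := by
    rw [OscillatorStandingData.coe_divConj, Units.val_div_eq_div_val, Units.coe_map, Units.val_mk0,
      MonoidHom.coe_coe, OscillatorStandingData.σ_apply, hS, QuadraticAlgebra.star_mk]
    have hne' : (⟨1 + 0 * 1, -1⟩ : QuadraticAlgebra ℚ_[3] (-1) 0) ≠ 0 := fun h => by
      have := congrArg QuadraticAlgebra.im h
      norm_num at this
    rw [div_eq_iff hne']
    ext <;> simp
  have hdc' : S.divConj (Units.mk0 _ hx₀ne) = zi := Subtype.ext (Units.ext hdc)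
  have hμne : μ' ≠ μ := fun h => hsi (by
    have h1 := hμ' (Units.mk0 _ hx₀ne)
    rw [h, OscillatorStandingData.check_apply, hdc'] at h1
    exact (mul_eq_left.1 h1.symm))
  -- `det (z·1₃) = z³`
  have hdet_scalar : ∀ z : S.normOne, detN (S.scalar z) = z ^ 3 := fun z => by
    apply Subtype.ext
    rw [hdetN]
    apply Units.ext
    rw [Matrix.GeneralLinearGroup.val_det_apply, SubgroupClass.coe_pow, Units.val_pow_eq_pow_val]
    change (Matrix.scalar (Fin 3) (((z : (QuadraticAlgebra ℚ_[3] (-1) 0)ˣ)) : QuadraticAlgebra ℚ_[3] (-1) 0)).det = _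
    simp [Matrix.scalar_apply, Matrix.det_diagonal, Finset.prod_const]
  -- the diagonal witnesses `diag(u, 1, 1) ∈ U(V)(F)` for `u ∈ E¹`
  have hdiag : ∀ u : S.normOne, ∃ g : S.U, detN g = u := by
    intro u
    let d : Fin 3 → QuadraticAlgebra ℚ_[3] (-1) 0 :=
      ![(((u : (QuadraticAlgebra ℚ_[3] (-1) 0)ˣ)) : QuadraticAlgebra ℚ_[3] (-1) 0), 1, 1]
    have hdet_d : (Matrix.diagonal d).det = (((u : (QuadraticAlgebra ℚ_[3] (-1) 0)ˣ)) : QuadraticAlgebra ℚ_[3] (-1) 0) := by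
      simp [Matrix.det_diagonal, Fin.prod_univ_three, d]
    have hddet : (Matrix.diagonal d).det ≠ 0 := by rw [hdet_d]; exact (u : (QuadraticAlgebra ℚ_[3] (-1) 0)ˣ).ne_zero
    let A₀ : GL (Fin 3) (QuadraticAlgebra ℚ_[3] (-1) 0) := Matrix.GeneralLinearGroup.mkOfDetNeZero _ hddet
    have hA₀ : ((A₀ : GL (Fin 3) (QuadraticAlgebra ℚ_[3] (-1) 0)) : Matrix (Fin 3) (Fin 3) (QuadraticAlgebra ℚ_[3] (-1) 0)) =
        Matrix.diagonal d := rfl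
    have hu : star (((u : (QuadraticAlgebra ℚ_[3] (-1) 0)ˣ)) : QuadraticAlgebra ℚ_[3] (-1) 0) *
        (((u : (QuadraticAlgebra ℚ_[3] (-1) 0)ˣ)) : QuadraticAlgebra ℚ_[3] (-1) 0) = 1 := by
      rw [mul_comm, ← hS]; exact (S.mem_normOne_iff' _).1 u.2
    have hA₀U : A₀ ∈ S.U := by
      rw [S.mem_U_iff, hgram, Matrix.mul_one, hA₀, Matrix.diagonal_map (map_zero _), Matrix.diagonal_transpose,
        Matrix.diagonal_mul_diagonal, ← Matrix.diagonal_one]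
      congr 1
      funext k
      fin_cases k
      · simpa [d, hS] using hu
      · simp [d]
      · simp [d]
    refine ⟨⟨A₀, hA₀U⟩, Subtype.ext (Units.ext ?_)⟩
    rw [hdetN, Matrix.GeneralLinearGroup.val_det_apply]
    exact hdet_d
  obtain ⟨g₁, hg₁⟩ := hdiag zi
  obtain ⟨g₀, hg₀⟩ := hdiag z₀
  -- the four characters of `U(V)(F)`
  let lamv : Fin 4 → (S.U →* ℂˣ) := ![1, ψ.comp detN, (ψ * ψ).comp detN, s.comp detN]
  have hl0 : lamv 0 = 1 := rfl
  have hl1 : ∀ g, lamv 1 g = ψ (detN g) := fun g => rfl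
  have hl2 : ∀ g, lamv 2 g = ψ (detN g) * ψ (detN g) := fun g => rfl
  have hl3 : ∀ g, lamv 3 g = s (detN g) := fun g => rfl
  let chiv : Fin 4 → LemD1.ChiSet S := ![χ₁, χ₁, χ₁, χs]
  have hcen : ∀ (k : Fin 4) (z : S.normOne), lamv k (S.scalar z) = (chiv k).1 z := by
    intro k z
    fin_cases k
    · rfl
    · change lamv 1 _ = (1 : S.normOne →* ℂˣ) z
      rw [hl1, hdet_scalar, map_pow, hψ3, MonoidHom.one_apply]
    · change lamv 2 _ = (1 : S.normOne →* ℂˣ) z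
      rw [hl2, hdet_scalar, map_pow, hψ3, one_mul, MonoidHom.one_apply]
    · change lamv 3 _ = s z
      rw [hl3, hdet_scalar, map_pow, pow_succ, pow_two, hs_sq, one_mul]
  -- local triviality of the characters near `1`
  have hre_det : Continuous fun g : S.U => (((g : GL (Fin 3) (QuadraticAlgebra ℚ_[3] (-1) 0)) :
      Matrix (Fin 3) (Fin 3) (QuadraticAlgebra ℚ_[3] (-1) 0)).det).re :=
    continuous_re.comp ((Units.continuous_val.comp continuous_subtype_val).matrix_det)
  have him_det : Continuous fun g : S.U => (((g : GL (Fin 3) (QuadraticAlgebra ℚ_[3] (-1) 0)) :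
      Matrix (Fin 3) (Fin 3) (QuadraticAlgebra ℚ_[3] (-1) 0)).det).im :=
    continuous_im.comp ((Units.continuous_val.comp continuous_subtype_val).matrix_det)
  have hdet_val : ∀ g : S.U, (((detN g : S.normOne) : (QuadraticAlgebra ℚ_[3] (-1) 0)ˣ) : QuadraticAlgebra ℚ_[3] (-1) 0) =
      ((g : GL (Fin 3) (QuadraticAlgebra ℚ_[3] (-1) 0)) : Matrix (Fin 3) (Fin 3) (QuadraticAlgebra ℚ_[3] (-1) 0)).det :=
    fun g => by rw [hdetN, Matrix.GeneralLinearGroup.val_det_apply]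
  have hopenψ : ∃ O : Set S.U, IsOpen O ∧ (1 : S.U) ∈ O ∧ ∀ g ∈ O, ψ (detN g) = 1 := by
    refine ⟨{g : S.U | ‖(((g : GL (Fin 3) (QuadraticAlgebra ℚ_[3] (-1) 0)) :
        Matrix (Fin 3) (Fin 3) (QuadraticAlgebra ℚ_[3] (-1) 0)).det).re - 1‖ < 3⁻¹ ∧
        ‖(((g : GL (Fin 3) (QuadraticAlgebra ℚ_[3] (-1) 0)) :
        Matrix (Fin 3) (Fin 3) (QuadraticAlgebra ℚ_[3] (-1) 0)).det).im‖ < 3⁻¹}, ?_, ?_, ?_⟩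
    · exact (isOpen_lt (continuous_norm.comp (hre_det.sub continuous_const)) continuous_const).inter
        (isOpen_lt (continuous_norm.comp him_det) continuous_const)
    · change ‖_‖ < 3⁻¹ ∧ ‖_‖ < 3⁻¹
      simp [QuadraticAlgebra.re_one, QuadraticAlgebra.im_one]
    · rintro g ⟨hg1, hg2⟩
      exact hψnear (detN g) (by rw [hdet_val]; exact hg1) (by rw [hdet_val]; exact hg2)
  have hopens : ∃ O : Set S.U, IsOpen O ∧ (1 : S.U) ∈ O ∧ ∀ g ∈ O, s (detN g) = 1 := by
    refine ⟨{g : S.U | ‖(((g : GL (Fin 3) (QuadraticAlgebra ℚ_[3] (-1) 0)) :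
        Matrix (Fin 3) (Fin 3) (QuadraticAlgebra ℚ_[3] (-1) 0)).det).re - 1‖ < 1}, ?_, ?_, ?_⟩
    · exact isOpen_lt (continuous_norm.comp (hre_det.sub continuous_const)) continuous_const
    · change ‖((((1 : S.U) : GL (Fin 3) (QuadraticAlgebra ℚ_[3] (-1) 0)) :
        Matrix (Fin 3) (Fin 3) (QuadraticAlgebra ℚ_[3] (-1) 0)).det).re - 1‖ < 1
      simp [QuadraticAlgebra.re_one]
    · intro g hg
      have hg' : ‖(((g : GL (Fin 3) (QuadraticAlgebra ℚ_[3] (-1) 0)) :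
          Matrix (Fin 3) (Fin 3) (QuadraticAlgebra ℚ_[3] (-1) 0)).det).re - 1‖ < 1 := hg
      rw [hs_one, hdet_val]
      intro hlt
      have key := Padic.nonarchimedean
        ((((g : GL (Fin 3) (QuadraticAlgebra ℚ_[3] (-1) 0)) : Matrix (Fin 3) (Fin 3) (QuadraticAlgebra ℚ_[3] (-1) 0)).det).re)
        (-((((g : GL (Fin 3) (QuadraticAlgebra ℚ_[3] (-1) 0)) :
          Matrix (Fin 3) (Fin 3) (QuadraticAlgebra ℚ_[3] (-1) 0)).det).re - 1))
      have h1 : (((g : GL (Fin 3) (QuadraticAlgebra ℚ_[3] (-1) 0)) :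
            Matrix (Fin 3) (Fin 3) (QuadraticAlgebra ℚ_[3] (-1) 0)).det).re +
          -((((g : GL (Fin 3) (QuadraticAlgebra ℚ_[3] (-1) 0)) :
            Matrix (Fin 3) (Fin 3) (QuadraticAlgebra ℚ_[3] (-1) 0)).det).re - 1) = 1 := by ring
      rw [h1, norm_one, norm_neg] at key
      exact absurd (max_lt hlt hg') (not_lt.2 key)
  have hopen : ∀ k : Fin 4, ∃ O : Set S.U, IsOpen O ∧ (1 : S.U) ∈ O ∧ ∀ g ∈ O, lamv k g = 1 := by
    intro k
    fin_cases k
    · exact ⟨Set.univ, isOpen_univ, Set.mem_univ _, fun g _ => rfl⟩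
    · obtain ⟨O, hO, h1, hO'⟩ := hopenψ
      exact ⟨O, hO, h1, fun g hg => by change lamv 1 g = 1; rw [hl1, hO' g hg]⟩
    · obtain ⟨O, hO, h1, hO'⟩ := hopenψ
      exact ⟨O, hO, h1, fun g hg => by change lamv 2 g = 1; rw [hl2, hO' g hg, one_mul]⟩
    · obtain ⟨O, hO, h1, hO'⟩ := hopens
      exact ⟨O, hO, h1, fun g hg => by change lamv 3 g = 1; rw [hl3, hO' g hg]⟩
  -- the characters are pairwise distinct: values at `g₀ = diag(z₀, 1, 1)` and `g₁ = diag(i, 1, 1)`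
  have hv1 : ∀ k : Fin 4, k ≠ 3 → lamv k g₁ = 1 := by
    intro k hk
    fin_cases k
    · rfl
    · change lamv 1 g₁ = 1; rw [hl1, hg₁, hψi zi rfl]
    · change lamv 2 g₁ = 1; rw [hl2, hg₁, hψi zi rfl, one_mul]
    · exact absurd rfl hk
  have hv13 : lamv 3 g₁ ≠ 1 := by rw [hl3, hg₁]; exact hsi
  have hv00 : lamv 0 g₀ = 1 := rfl
  have hv01 : lamv 1 g₀ = ψ z₀ := by rw [hl1, hg₀]
  have hv02 : lamv 2 g₀ = ψ z₀ ^ 2 := by rw [hl2, hg₀, pow_two]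
  have hdist : ∀ i j : Fin 4, i ≠ j → lamv j ≠ lamv i := by
    have h10 : lamv 1 ≠ lamv 0 := fun h => hψz₀ (by rw [← hv01, DFunLike.congr_fun h g₀, hv00])
    have h20 : lamv 2 ≠ lamv 0 := fun h => hψz₀sq (by rw [← hv02, DFunLike.congr_fun h g₀, hv00])
    have h21 : lamv 2 ≠ lamv 1 := fun h => hψz₀ (by
      have h' : ψ z₀ ^ 2 = ψ z₀ := by rw [← hv02, DFunLike.congr_fun h g₀, hv01]
      rwa [pow_two, mul_eq_left] at h')
    have h3k : ∀ k : Fin 4, k ≠ 3 → lamv 3 ≠ lamv k := fun k hk h =>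
      hv13 (by rw [DFunLike.congr_fun h g₁]; exact hv1 k hk)
    intro i j hij h
    fin_cases i <;> fin_cases j
    · exact hij rfl
    · exact h10 h
    · exact h20 h
    · exact h3k 0 (by decide) h
    · exact h10 h.symm
    · exact hij rfl
    · exact h21 h
    · exact h3k 1 (by decide) h
    · exact h20 h.symm
    · exact h21 h.symm
    · exact hij rfl
    · exact h3k 2 (by decide) h
    · exact h3k 0 (by decide) h.symm
    · exact h3k 1 (by decide) h.symm
    · exact h3k 2 (by decide) h.symm
    · exact hij rfl
  -- the carriers: the lines `λ_k`
  let ωv : Fin 4 → Representation ℂ S.U ℂ := fun k => (DistribMulAction.toModuleEnd ℂ ℂ).comp (lamv k)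
  have hω : ∀ (k : Fin 4) (g : S.U) (x : ℂ), ωv k g x = (lamv k g : ℂ) * x := fun k g x => by
    change (lamv k g : ℂˣ) • x = _
    rw [Units.smul_def, smul_eq_mul]
  -- the collection
  let Lf : LemD1IndexedFamily ℚ_[3] (QuadraticAlgebra ℚ_[3] (-1) 0) 3 (Fin 4) :=
    { isNonarchimedeanLocalField := Literature.NumberTheory.GaloisRepresentations.Padic.isNonarchimedeanLocalField_holds 3
      isModuleTopology := inferInstance
      S := S
      mu := ![μ, μ, μ', μ]
      eps := ![eb 1 one_ne_zero, eb 3 h3, eb 1 one_ne_zero, eb 1 one_ne_zero]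
      chi := chiv
      V := fun _ => ℂ
      omega := ωv }
  -- Lemma D.1, first sentence + (1), member by member (rank `3 ≠ 2`)
  have hItem1 : Lf.Item1AsPrinted := fun k =>
    lemD1_1AsPrinted_of_character_of_rank_ne_two (Lf.single k) (lamv k) (hω k) (hcen k) (hopen k) (by norm_num)
  -- the isomorphism pattern: `ω_j ≅ ω_i ↔ λ_j = λ_i ↔ j = i`
  have hN : ∀ k, augmentation (ωv k) S.scalar (chiv k).1 = ⊥ := fun k =>
    augmentation_eq_bot_of_character (ωv k) S.scalar (chiv k).1 (lamv k) (hω k) (hcen k)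
  have hquot : ∀ i j : Fin 4, AreIsomorphicRep (Lf.quot j) (Lf.quot i) ↔ lamv j = lamv i := fun i j =>
    areIsomorphicRep_quotRep_iff_of_character (ωv j) (ωv i) S.scalar_mem_center (chiv j).1 (chiv i).1 (lamv j) (lamv i)
      (hω j) (hω i) (hN j) (hN i)
  have hniso : ∀ i j : Fin 4, i ≠ j → ¬ AreIsomorphicRep (Lf.quot j) (Lf.quot i) := fun i j hij h =>
    hdist i j hij ((hquot i j).1 h)
  -- the label triples are pairwise distinct (up to the class of `ε`)
  have hlab : ∀ i j : Fin 4, (Lf.mu j = Lf.mu i ∧ LemD1.SameClass (Lf.eps i) (Lf.eps j) ∧ Lf.chi j = Lf.chi i) → i = j := by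
    rintro i j ⟨hm, he, hc⟩
    fin_cases i <;> fin_cases j
    · rfl
    · exact absurd he h01
    · exact absurd hm hμne
    · exact absurd hc hχne
    · exact absurd he (fun h => h01 h.symm)
    · rfl
    · exact absurd he (fun h => h01 h.symm)
    · exact absurd he (fun h => h01 h.symm)
    · exact absurd hm.symm hμne
    · exact absurd he h01
    · rfl
    · exact absurd hc hχne
    · exact absurd hc.symm hχne
    · exact absurd he h01
    · exact absurd hc.symm hχne
    · rfl
  have hItem3 : LemD1_3AsPrintedI Lf := by
    intro _ i j
    by_cases hij : i = j
    · subst hij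
      exact iff_of_true (AreIsomorphicRep.refl _) ⟨rfl, LemD1.SameClass.refl _, rfl⟩
    · exact iff_of_false (hniso i j hij) fun h => hij (hlab i j h)
  exact ⟨Lf, isField, hS, hgram, hItem1, hItem3, hniso, ⟨rfl, h01, rfl⟩, ⟨hμne, rfl, rfl⟩, ⟨rfl, rfl, hχne⟩⟩

end SlotTable

/-! ## §11 (v3) Rank `n = 2` over the field: the conjunct «`χ̌ = μ²`» of Lemma D.1 (1), ALONE, at truth value FALSE
(`E` a field, `V = diag(1, 3)` anisotropic, `n = 2` all TRUE; Step-2 character `μ·ť` with `(μ·ť)² = ť² ≠ 1 = χ̌` for `χ = 1`) -/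

section CheckClause

variable [TopologicalSpace (QuadraticAlgebra ℚ_[3] (-1) 0)] [IsTopologicalRing (QuadraticAlgebra ℚ_[3] (-1) 0)]
  [IsModuleTopology ℚ_[3] (QuadraticAlgebra ℚ_[3] (-1) 0)]

/-- **«`χ̌ = μ²`» AS THE DECIDING CONJUNCT OF LEMMA D.1 (1)** (in-kernel certificate, our bookkeeping): over `F = ℚ₃`,
`E = ℚ₃(i)` — a FIELD —, the ANISOTROPIC binary hermitian space `(E², diag(1, 3))` (`n = 2`), `ε = i`, `χ = 1` (so `χ̌ = 1`), and
the Step-2 character `μ·ť` (`μ = (−1)^{ord_E}` with `μ² = 1`, `t` the quartic character of `E¹`, `ť(x) = t(x/x^c)`;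
`exists_muSet_mul_check`): at `x₀ = 1 + i` one has `x₀/x₀^c = i` and `(μ·ť)(x₀)² = t(i)² = −1 ≠ 1 = χ̌(x₀)`, so the conjunct
«`χ̌ = μ²`» of the printed right-hand side of (1) is FALSE while «`E` is a field», «`V` is anisotropic», «`n = 2`» are all TRUE.
With the trivial line as ⟨CARRIER⟩ the maximal `χ`-quotient is a NON-ZERO line and `LemD1_1AsPrinted` HOLDS — both sides of
(1) FALSE, the right one through «`χ̌ = μ²`» ALONE (the last conjunct of (1) not previously exercised at FALSE:
`exists_lemD1Data_exceptional` has it TRUE, the rank-`≠ 2` and isotropic data fail elsewhere).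
[cite: Liu2021, App. D Lemma D.1 (1) (l. 5229); §D.1 l. 5224 («`χ̌(x) = χ(x/x^c)`»)] -/
theorem exists_lemD1Data_checkClause_false :
    ∃ L : LemD1Data ℚ_[3] (QuadraticAlgebra ℚ_[3] (-1) 0) 2 ℂ,
      (∀ x, L.S.conj x = star x) ∧ L.S.gram = Matrix.diagonal ![1, 3] ∧
      LemD1_1AsPrinted L ∧
      Nontrivial (ℂ ⧸ augmentation L.omega L.S.scalar L.chi) ∧
      (IsField (QuadraticAlgebra ℚ_[3] (-1) 0) ∧ L.IsAnisotropic) ∧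
      ¬ (∀ x : (QuadraticAlgebra ℚ_[3] (-1) 0)ˣ, L.S.check L.chi x = L.mu x ^ 2) := by
  classical
  haveI hF : Fact (∀ r : ℚ_[3], r ^ 2 ≠ -1 + 0 * r) := ⟨sq_ne_neg_one⟩
  obtain ⟨S, hS, hG⟩ := exists_standingData_aniso
  obtain ⟨μ, hμsq⟩ := exists_muSet_sq_eq_one (S := S) hS
  obtain ⟨t, ht_norm, ht_cont, ht_i⟩ := exists_quarticChar (S := S) hS
  obtain ⟨μ'', hμ''⟩ := exists_muSet_mul_check μ (⟨t, ht_norm, ht_cont⟩ : LemD1.ChiSet S)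
  -- `ε = i`
  have hωne : (⟨0, 1⟩ : QuadraticAlgebra ℚ_[3] (-1) 0) ≠ 0 := fun h => by
    have := congrArg QuadraticAlgebra.im h
    norm_num at this
  have hskew : (⟨0, 1⟩ : QuadraticAlgebra ℚ_[3] (-1) 0) ∈ S.skew := by
    rw [S.mem_skew_iff, hS, QuadraticAlgebra.star_mk]
    ext <;> simp
  -- `x₀ = 1 + i`, `x₀ / x₀^c = i`
  have hx₀ne : (⟨1, 1⟩ : QuadraticAlgebra ℚ_[3] (-1) 0) ≠ 0 := fun h => by
    have := congrArg QuadraticAlgebra.im h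
    norm_num at this
  have hdc : (((S.divConj (Units.mk0 _ hx₀ne) : S.normOne) : (QuadraticAlgebra ℚ_[3] (-1) 0)ˣ) :
      QuadraticAlgebra ℚ_[3] (-1) 0) = ⟨0, 1⟩ := by
    rw [OscillatorStandingData.coe_divConj, Units.val_div_eq_div_val, Units.coe_map, Units.val_mk0,
      MonoidHom.coe_coe, OscillatorStandingData.σ_apply, hS, QuadraticAlgebra.star_mk]
    have hne' : (⟨1 + 0 * 1, -1⟩ : QuadraticAlgebra ℚ_[3] (-1) 0) ≠ 0 := fun h => by
      have := congrArg QuadraticAlgebra.im h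
      norm_num at this
    rw [div_eq_iff hne']
    ext <;> simp
  -- the carrier: the trivial line
  let ω : Representation ℂ S.U ℂ := Representation.trivial ℂ S.U ℂ
  have hω : ∀ (g : S.U) (x : ℂ), ω g x = ((1 : S.U →* ℂˣ) g : ℂ) * x := fun g x => by
    rw [MonoidHom.one_apply, Units.val_one, one_mul]; rfl
  let L : LemD1Data ℚ_[3] (QuadraticAlgebra ℚ_[3] (-1) 0) 2 ℂ :=
    { isNonarchimedeanLocalField := Literature.NumberTheory.GaloisRepresentations.Padic.isNonarchimedeanLocalField_holds 3
      isModuleTopology := inferInstance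
      S := S
      eps := Units.mk0 _ hωne
      eps_mem_skew := by rw [Units.val_mk0]; exact hskew
      mu := μ''.1
      norm_mu := μ''.2.1
      continuous_mu := μ''.2.2.1
      mu_algebraMap_eq_one_iff := μ''.2.2.2
      chi := 1
      norm_chi := fun z => by simp
      continuous_chi := by simpa using continuous_const
      omega := ω }
  have hN : augmentation ω S.scalar (1 : S.normOne →* ℂˣ) = ⊥ :=
    augmentation_eq_bot_of_character ω S.scalar 1 1 hω fun z => rfl
  have hnt : Nontrivial (ℂ ⧸ augmentation ω S.scalar (1 : S.normOne →* ℂˣ)) :=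
    Submodule.Quotient.nontrivial_iff.2 (by rw [hN]; exact bot_ne_top)
  have haniso : L.IsAnisotropic := fun v hv => form_anisotropic_of_gram_diag hS hG v hv
  -- «χ̌ = μ²» FAILS at `x₀`
  have hcheck : ¬ ∀ x : (QuadraticAlgebra ℚ_[3] (-1) 0)ˣ, L.S.check L.chi x = L.mu x ^ 2 := by
    intro h
    have h1 := h (Units.mk0 _ hx₀ne)
    change S.check 1 _ = μ''.1 _ ^ 2 at h1
    rw [OscillatorStandingData.check_apply, MonoidHom.one_apply, hμ'', mul_pow, pow_two, hμsq, one_mul,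
      OscillatorStandingData.check_apply, pow_two] at h1
    have hval := ht_i (S.divConj (Units.mk0 _ hx₀ne)) hdc
    have h1' := congrArg (fun u : ℂˣ => (u : ℂ)) h1
    simp only [Units.val_one] at h1'
    rw [← h1'] at hval
    norm_num at hval
  have h1 : LemD1_1AsPrinted L :=
    lemD1_1AsPrinted_of_character_of_not_exceptional L 1 hω (fun z => rfl)
      ⟨Set.univ, isOpen_univ, Set.mem_univ _, fun g _ => rfl⟩ fun h => hcheck h.2.2
  exact ⟨L, hS, hG, h1, hnt, ⟨isField, haniso⟩, hcheck⟩

/-- **Contrast — at the same configuration item (1) EXCLUDES a zero `ω(μ, ε, χ)`**: the same standing data (`ℚ₃(i)/ℚ₃`,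
anisotropic `diag(1, 3)`, `n = 2`), the same labels `μ·ť`, `ε = i`, `χ = 1` (so the printed right-hand side of (1) is FALSE, through
«`χ̌ = μ²`» alone), but the ⟨CARRIER⟩ line `t ∘ det`, on which the centre `i·1₂` acts by `t(i²) = t(i)² = −1 ≠ χ(i) = 1`: the maximal
`χ`-quotient is the ZERO space, so the left side of (1) is TRUE and `LemD1_1AsPrinted` FAILS.  Together with
`exists_lemD1Data_exceptional` (same carrier, `μ` instead of `μ·ť`: quotient zero, (1) HOLDS) this isolates the content of the clause
«`χ̌ = μ²`»: changing ONLY the Step-2 label flips the verdict of the record on the same carrier.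
[cite: Liu2021, App. D Lemma D.1 (1) (l. 5229); §D.1 l. 5224] -/
theorem exists_lemD1Data_checkClause_false_violated :
    ∃ L : LemD1Data ℚ_[3] (QuadraticAlgebra ℚ_[3] (-1) 0) 2 ℂ,
      (∀ x, L.S.conj x = star x) ∧ L.S.gram = Matrix.diagonal ![1, 3] ∧
      Subsingleton (ℂ ⧸ augmentation L.omega L.S.scalar L.chi) ∧
      (IsField (QuadraticAlgebra ℚ_[3] (-1) 0) ∧ L.IsAnisotropic) ∧
      ¬ (∀ x : (QuadraticAlgebra ℚ_[3] (-1) 0)ˣ, L.S.check L.chi x = L.mu x ^ 2) ∧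
      ¬ LemD1_1AsPrinted L := by
  classical
  haveI hF : Fact (∀ r : ℚ_[3], r ^ 2 ≠ -1 + 0 * r) := ⟨sq_ne_neg_one⟩
  obtain ⟨S, hS, hG⟩ := exists_standingData_aniso
  obtain ⟨μ, hμsq⟩ := exists_muSet_sq_eq_one (S := S) hS
  obtain ⟨t, ht_norm, ht_cont, ht_i⟩ := exists_quarticChar (S := S) hS
  obtain ⟨μ'', hμ''⟩ := exists_muSet_mul_check μ (⟨t, ht_norm, ht_cont⟩ : LemD1.ChiSet S)
  obtain ⟨detN, hdetN⟩ := exists_detNormOne' (S := S)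
  -- `ε = i`, and `i ∈ E¹`
  have hωne : (⟨0, 1⟩ : QuadraticAlgebra ℚ_[3] (-1) 0) ≠ 0 := fun h => by
    have := congrArg QuadraticAlgebra.im h
    norm_num at this
  have hskew : (⟨0, 1⟩ : QuadraticAlgebra ℚ_[3] (-1) 0) ∈ S.skew := by
    rw [S.mem_skew_iff, hS, QuadraticAlgebra.star_mk]
    ext <;> simp
  have hi1 : Units.mk0 (⟨0, 1⟩ : QuadraticAlgebra ℚ_[3] (-1) 0) hωne ∈ S.normOne := by
    rw [S.mem_normOne_iff', Units.val_mk0, hS, QuadraticAlgebra.star_mk]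
    ext <;> simp [QuadraticAlgebra.re_one, QuadraticAlgebra.im_one]
  let zi : S.normOne := ⟨_, hi1⟩
  -- `x₀ = 1 + i`, `x₀ / x₀^c = i`
  have hx₀ne : (⟨1, 1⟩ : QuadraticAlgebra ℚ_[3] (-1) 0) ≠ 0 := fun h => by
    have := congrArg QuadraticAlgebra.im h
    norm_num at this
  have hdc : (((S.divConj (Units.mk0 _ hx₀ne) : S.normOne) : (QuadraticAlgebra ℚ_[3] (-1) 0)ˣ) :
      QuadraticAlgebra ℚ_[3] (-1) 0) = ⟨0, 1⟩ := by
    rw [OscillatorStandingData.coe_divConj, Units.val_div_eq_div_val, Units.coe_map, Units.val_mk0,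
      MonoidHom.coe_coe, OscillatorStandingData.σ_apply, hS, QuadraticAlgebra.star_mk]
    have hne' : (⟨1 + 0 * 1, -1⟩ : QuadraticAlgebra ℚ_[3] (-1) 0) ≠ 0 := fun h => by
      have := congrArg QuadraticAlgebra.im h
      norm_num at this
    rw [div_eq_iff hne']
    ext <;> simp
  -- the carrier: the line `t ∘ det`
  let lam : S.U →* ℂˣ := t.comp detN
  let ω : Representation ℂ S.U ℂ := (DistribMulAction.toModuleEnd ℂ ℂ).comp lam
  have hω : ∀ (g : S.U) (x : ℂ), ω g x = ((t (detN g) : ℂˣ) : ℂ) * x := fun g x => by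
    change (lam g : ℂˣ) • x = _
    rw [Units.smul_def, smul_eq_mul]
    rfl
  let L : LemD1Data ℚ_[3] (QuadraticAlgebra ℚ_[3] (-1) 0) 2 ℂ :=
    { isNonarchimedeanLocalField := Literature.NumberTheory.GaloisRepresentations.Padic.isNonarchimedeanLocalField_holds 3
      isModuleTopology := inferInstance
      S := S
      eps := Units.mk0 _ hωne
      eps_mem_skew := by rw [Units.val_mk0]; exact hskew
      mu := μ''.1
      norm_mu := μ''.2.1
      continuous_mu := μ''.2.2.1
      mu_algebraMap_eq_one_iff := μ''.2.2.2
      chi := 1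
      norm_chi := fun z => by simp
      continuous_chi := by simpa using continuous_const
      omega := ω }
  -- the centre element `i·1₂` acts by `t(i²) = t(i)² = −1`
  have hdet_zi : detN (S.scalar zi) = zi ^ 2 := by
    apply Subtype.ext
    rw [hdetN]
    apply Units.ext
    rw [Matrix.GeneralLinearGroup.val_det_apply, SubgroupClass.coe_pow, Units.val_pow_eq_pow_val]
    change (Matrix.scalar (Fin 2) (((zi : (QuadraticAlgebra ℚ_[3] (-1) 0)ˣ)) : QuadraticAlgebra ℚ_[3] (-1) 0)).det = _
    simp [Matrix.scalar_apply, Matrix.det_diagonal, Finset.prod_const]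
  have hact : ω (S.scalar zi) 1 = -1 := by
    rw [hω, mul_one, hdet_zi, map_pow, pow_two]
    exact ht_i zi rfl
  have hmem : (2 : ℂ) ∈ augmentation ω S.scalar (1 : S.normOne →* ℂˣ) := by
    have h := Literature.RepresentationTheory.CentralCharacterQuotient.sub_smul_mem_augmentation ω S.scalar
      (1 : S.normOne →* ℂˣ) zi (1 : ℂ)
    rw [hact, MonoidHom.one_apply, Units.val_one, one_smul] at h
    norm_num at h
    exact h
  have htop : augmentation ω S.scalar (1 : S.normOne →* ℂˣ) = ⊤ := by
    rw [Submodule.eq_top_iff']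
    intro x
    have h := Submodule.smul_mem _ (x * (2 : ℂ)⁻¹) hmem
    rwa [smul_eq_mul, inv_mul_cancel_right₀ (by norm_num : (2 : ℂ) ≠ 0)] at h
  have hsub : Subsingleton (ℂ ⧸ augmentation ω S.scalar (1 : S.normOne →* ℂˣ)) :=
    Submodule.Quotient.subsingleton_iff.2 htop
  have haniso : L.IsAnisotropic := fun v hv => form_anisotropic_of_gram_diag hS hG v hv
  -- «χ̌ = μ²» FAILS at `x₀`
  have hcheck : ¬ ∀ x : (QuadraticAlgebra ℚ_[3] (-1) 0)ˣ, L.S.check L.chi x = L.mu x ^ 2 := by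
    intro h
    have h1 := h (Units.mk0 _ hx₀ne)
    change S.check 1 _ = μ''.1 _ ^ 2 at h1
    rw [OscillatorStandingData.check_apply, MonoidHom.one_apply, hμ'', mul_pow, pow_two, hμsq, one_mul,
      OscillatorStandingData.check_apply, pow_two] at h1
    have hval := ht_i (S.divConj (Units.mk0 _ hx₀ne)) hdc
    have h1' := congrArg (fun u : ℂˣ => (u : ℂ)) h1
    simp only [Units.val_one] at h1'
    rw [← h1'] at hval
    norm_num at hval
  refine ⟨L, hS, hG, hsub, ⟨isField, haniso⟩, hcheck, fun h => hcheck (h.2.1 hsub).2.2⟩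

end CheckClause

end LemD1IndexedNonVacuityNonsplit

end Literature.NumberTheory.Automorphic.Liu2021

end
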